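import Literature.NumberTheory.Sieve.BombieriFriedlanderIwaniecTheorem2R1
import Literature.NumberTheory.Sieve.BombieriFriedlanderIwaniecTheorem2Numerics
import Literature.NumberTheory.Sieve.BombieriFriedlanderIwaniecDispersionS2Uniform
import HarnessLib

/-!
# Bombieri–Friedlander–Iwaniec 1986, Theorem 2 — the assembly (conditional on Lemma 7 for `𝓑_m`)

Topic `Literature/NumberTheory/Sieve`.  E. Bombieri, J. B. Friedlander, H. Iwaniec, *Primes in
arithmetic progressions to large moduli*, Acta Math. 156 (1986), 203–251, **Theorem 2** (§9, p. 230):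
the dispersion estimate `𝒢(M,N,Q,R) ≪ ‖β‖² x R⁻¹ ℒ^{−A}` in the range (i)–(iii), which is the named
fact `Literature.NumberTheory.Sieve.BombieriFriedlanderIwaniecTheorem2` of `…Dispersion`.

This file completes the assembly of the proof from the tree's §3–§9 files:

* `BFI.e7_le` — the `𝒮₂` term with the uniform Poisson error of `…DispersionS2Uniform` (no Weil
  bound is needed in the range of Theorem 2, where `QNR < x^{1−ε}`);
* `BFI.theorem2_core` — the skeleton `BFI.dispG_le_errors` combined with the eight pre-asymptotic
  bounds (`…Theorem2Errors`, `…Theorem2R1`, `e7_le`) and the numerics (`…Theorem2Numerics`):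
  `𝒢 ≤ 8‖β‖²xR⁻¹ℒ^{−A}` under explicit structural and "saving" hypotheses;
* the parameter lemmas (`BFI.range_facts`, `BFI.level_e1`, `BFI.theta_bounds`, …) deriving those
  hypotheses from the range of Theorem 2 with the choices
  `Y = M/2`, `ε₀ = min(ε, 1/10)`, `Q₀ = ℒ^{A₁}`, `z = ℒ^{B₀}`, `ε₁ = ε₀/4`, `H = [16x^{ε₁}Q²R/M]`,
  `θ = 8Q²R/(2πY(H+1))`, `j = ⌈5/ε₁⌉+2`, `η = δ = ε₀/40`, `P₀ = x^{ε₀/3}`, `ε₅ = ε₀`, Lemma 3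
  (`BombieriFriedlanderIwaniecLemma3_holds`) at `(A, ε) = (b+1, ε₀/3)` and `(B₃, ε₀)`, Theorem 0 (a)
  (`BombieriFriedlanderIwaniecTheorem0a`) at exponent `A'`, divisor moments and `τ(n) ≪ n^δ`;
* **`BFI.BombieriFriedlanderIwaniecTheorem2_of_lemma7`**:
  `(Lemma 7 for 𝓑_m) → BombieriFriedlanderIwaniecTheorem2`.

## The remaining input

The single hypothesis `h7` is BFI's **Lemma 7** (Deshouillers–Iwaniec's bound for the trilinear
Kloosterman-type form, BFI (9.16) with right-hand side `BFI.lemma7Rhs`) for the variant `BFI.dispBm`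
of `…DispersionB` (characters to modulus `δq₀k`, which is what the rigorous form of (9.7) requires —
see `…DispersionR1Second`), uniformly in the twist `m ≥ 1` and for both signs of `a`, with a constant
depending on `a, η` only.  It is a published theorem (Deshouillers–Iwaniec, Invent. Math. 70 (1982),
Theorem 12; BFI §9 Lemma 7) that is not in the tree; in accordance with the fact discipline it enters
as an explicit hypothesis of the final theorem and NOT as a new named fact, so the named fact
`BombieriFriedlanderIwaniecTheorem2` itself is not discharged here.

Everything in this file is PROVED (0 `sorry`); no definitions, no named facts.

## References

* E. Bombieri, J. B. Friedlander, H. Iwaniec, Acta Math. 156 (1986), 203–251: §3 (3.3)–(3.5), §4,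
  §5 (5.1)–(5.4), §6 (6.3)–(6.12), §7, §9 (9.1)–(9.21), Theorem 2 p. 230.
  [BombieriFriedlanderIwaniecActa1986]
* J.-M. Deshouillers, H. Iwaniec, *Kloosterman sums and Fourier coefficients of cusp forms*, Invent.
  Math. 70 (1982), 219–288, Theorem 12 (the input `h7`). [cited for context only]
-/

noncomputable section

open Finset Real MeasureTheory Complex
open scoped FourierTransform ArithmeticFunction.sigma ArithmeticFunction.omega

namespace Literature.NumberTheory.Sieve

namespace BFI

/-! ## E7: the `𝒮₂` term with the uniform Poisson error -/

/-- **E7** (the `𝒮₂`-error with the uniform Poisson estimate; BFI (5.4) in the range of Theorem 2):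
with `|γ_q| ≤ τ(q)^b` and the divisor moments for `τ^b`, `τ^{b+2}`, `τ`, for `Q, R ≥ 1/2`,
`2‖𝒮₂ − α̂₀X‖ ≤ 2 (2(M+2Y)/Y + K₂)(2N+1)‖β‖² (4C_bQ(log 4Q)^{k_b})(4C₂(log 4Q)^{k₂})(4C₀(log 4R)^{k₀})`,
i.e. `≪ N Q ‖β‖² ℒ^c`. [cite: BombieriFriedlanderIwaniecActa1986, §5 (5.4) p. 218] -/
theorem e7_le {M Y : ℝ} (hY : 0 < Y) (hYM : Y ≤ M) (a : ℤ) {N Q R : ℝ} (hN : 0 ≤ N)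
    (hQ : 1 / 2 ≤ Q) (hR : 1 / 2 ≤ R) (β : ℕ → ℝ) {γ : ℕ → ℝ} {b : ℕ}
    (hγ : ∀ q, |γ q| ≤ (σ 0 q : ℝ) ^ b) {Cb C₂ C₀ : ℝ} {kb k₂ k₀ : ℕ} (hb : MomentHyp b Cb kb)
    (h₂ : MomentHyp (b + 2) C₂ k₂) (h₀ : MomentHyp 1 C₀ k₀) :
    2 * ‖(dS2 a (mRange M Y) N Q R (fun m => bump M Y m) β γ : ℂ) -
        alphaHat M Y * (mainX a N Q R β γ : ℂ)‖ ≤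
      2 * (2 * (M + 2 * Y) / Y + derivConst 2) * ((2 * N + 1) * l2Sq N β) *
        ((4 * Cb * Q * Real.log (4 * Q) ^ kb) * (4 * C₂ * Real.log (4 * Q) ^ k₂) *
          (4 * C₀ * Real.log (4 * R) ^ k₀)) := by
  have hQ0 : 0 < Q := by linarith
  have hR0 : 0 < R := by linarith
  have hK : 0 ≤ 2 * (M + 2 * Y) / Y + derivConst 2 := by
    have := one_le_derivConst 2; have hM : 0 ≤ M := hY.le.trans hYM; positivity
  have h := norm_dS2_sub_mainX_le_uniform hY hYM a (N := N) hQ0.le hR0.le β γ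
  unfold classErr at h
  have hβ : (∑ n ∈ dyadic N, |β n|) ^ 2 ≤ (2 * N + 1) * l2Sq N β := by
    have h := sum_abs_le_sqrt_l2Sq hN β
    have h0 : 0 ≤ ∑ n ∈ dyadic N, |β n| := Finset.sum_nonneg fun _ _ => abs_nonneg _
    calc (∑ n ∈ dyadic N, |β n|) ^ 2 ≤ (Real.sqrt (l2Sq N β) * Real.sqrt (2 * N + 1)) ^ 2 :=
          pow_le_pow_left₀ h0 h 2
      _ = (2 * N + 1) * l2Sq N β := by
          rw [mul_pow, Real.sq_sqrt (l2Sq_nonneg N β), Real.sq_sqrt (by linarith)]; ring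
  have hl2 := l2Sq_nonneg N β
  -- termwise: `|γ₁||γ₂| (∑|β|)² τ(q₂)/φ(q₂r) ≤ (2N+1)S₂ · τ(q₁)^b · τ(q₂)^{b+2}/q₂ · τ(r)/r`
  have hterm : ∀ r ∈ dyadic R, ∀ q₁ ∈ dyadic Q, ∀ q₂ ∈ dyadic Q,
      |γ q₁| * |γ q₂| * (∑ n ∈ dyadic N, |β n|) ^ 2 * ((σ 0 q₂ : ℝ) / (Nat.totient (q₂ * r) : ℝ)) *
          (2 * (M + 2 * Y) / Y + derivConst 2) ≤
        (2 * (M + 2 * Y) / Y + derivConst 2) * ((2 * N + 1) * l2Sq N β) *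
          ((σ 0 q₁ : ℝ) ^ b * ((σ 0 q₂ : ℝ) ^ (b + 2) / q₂) * ((σ 0 r : ℝ) / r)) := by
    intro r hr q₁ hq₁ q₂ hq₂
    have hq₂0 := pos_of_mem_dyadic hQ0.le hq₂
    have hr0 := pos_of_mem_dyadic hR0.le hr
    have hφ := inv_totient_mul_le hq₂0 hr0
    have hq₂r : (0 : ℝ) < q₂ := by exact_mod_cast hq₂0
    have hrr : (0 : ℝ) < r := by exact_mod_cast hr0
    have hw : |γ q₁| * |γ q₂| * ((σ 0 q₂ : ℝ) / (Nat.totient (q₂ * r) : ℝ)) ≤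
        (σ 0 q₁ : ℝ) ^ b * ((σ 0 q₂ : ℝ) ^ (b + 2) / q₂) * ((σ 0 r : ℝ) / r) := by
      rw [div_eq_mul_inv]
      have hA : |γ q₁| * |γ q₂| ≤ (σ 0 q₁ : ℝ) ^ b * (σ 0 q₂ : ℝ) ^ b :=
        mul_le_mul (hγ q₁) (hγ q₂) (abs_nonneg _) (by positivity)
      have hB : (σ 0 q₂ : ℝ) * ((Nat.totient (q₂ * r) : ℝ))⁻¹ ≤
          (σ 0 q₂ : ℝ) * ((σ 0 q₂ : ℝ) * (σ 0 r : ℝ) / ((q₂ : ℝ) * r)) :=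
        mul_le_mul_of_nonneg_left hφ (Nat.cast_nonneg _)
      have hB0 : 0 ≤ (σ 0 q₂ : ℝ) * ((Nat.totient (q₂ * r) : ℝ))⁻¹ :=
        mul_nonneg (Nat.cast_nonneg _) (inv_nonneg.2 (Nat.cast_nonneg _))
      calc |γ q₁| * |γ q₂| * ((σ 0 q₂ : ℝ) * ((Nat.totient (q₂ * r) : ℝ))⁻¹)
          ≤ (σ 0 q₁ : ℝ) ^ b * (σ 0 q₂ : ℝ) ^ b * ((σ 0 q₂ : ℝ) * ((σ 0 q₂ : ℝ) * (σ 0 r : ℝ) / ((q₂ : ℝ) * r))) :=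
            mul_le_mul hA hB hB0 (by positivity)
        _ = _ := by field_simp; ring
    have hw0 : 0 ≤ |γ q₁| * |γ q₂| * ((σ 0 q₂ : ℝ) / (Nat.totient (q₂ * r) : ℝ)) := by positivity
    calc _ = (2 * (M + 2 * Y) / Y + derivConst 2) * ((∑ n ∈ dyadic N, |β n|) ^ 2 *
          (|γ q₁| * |γ q₂| * ((σ 0 q₂ : ℝ) / (Nat.totient (q₂ * r) : ℝ)))) := by ring
      _ ≤ (2 * (M + 2 * Y) / Y + derivConst 2) * (((2 * N + 1) * l2Sq N β) *
          ((σ 0 q₁ : ℝ) ^ b * ((σ 0 q₂ : ℝ) ^ (b + 2) / q₂) * ((σ 0 r : ℝ) / r))) :=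
          mul_le_mul_of_nonneg_left (mul_le_mul hβ hw hw0 (by positivity)) hK
      _ = _ := by ring
  calc _ ≤ 2 * ∑ r ∈ dyadic R, ∑ q₁ ∈ dyadic Q, ∑ q₂ ∈ dyadic Q,
        (2 * (M + 2 * Y) / Y + derivConst 2) * ((2 * N + 1) * l2Sq N β) *
          ((σ 0 q₁ : ℝ) ^ b * ((σ 0 q₂ : ℝ) ^ (b + 2) / q₂) * ((σ 0 r : ℝ) / r)) := by
        refine mul_le_mul_of_nonneg_left (h.trans ?_) (by norm_num)
        exact Finset.sum_le_sum fun r hr => Finset.sum_le_sum fun q₁ hq₁ => Finset.sum_le_sum fun q₂ hq₂ =>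
          hterm r hr q₁ hq₁ q₂ hq₂
    _ = 2 * (2 * (M + 2 * Y) / Y + derivConst 2) * ((2 * N + 1) * l2Sq N β) *
          ((∑ q ∈ dyadic Q, (σ 0 q : ℝ) ^ b) * (∑ q ∈ dyadic Q, (σ 0 q : ℝ) ^ (b + 2) / q) *
            ∑ r ∈ dyadic R, (σ 0 r : ℝ) / r) := by
        rw [sum₃_mul_eq]; ring
    _ ≤ _ := by
        have hA := hb.sum_dyadic_le hQ
        have hB := h₂.sum_dyadic_div_le hQ
        have hC := h₀.sum_dyadic_div_le hR
        have hA0 : 0 ≤ ∑ q ∈ dyadic Q, (σ 0 q : ℝ) ^ b := Finset.sum_nonneg fun _ _ => by positivity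
        have hB0 : 0 ≤ ∑ q ∈ dyadic Q, (σ 0 q : ℝ) ^ (b + 2) / q := Finset.sum_nonneg fun _ _ => by positivity
        have hC0 : 0 ≤ ∑ r ∈ dyadic R, (σ 0 r : ℝ) / r := Finset.sum_nonneg fun _ _ => by positivity
        have hpre : 0 ≤ 2 * (2 * (M + 2 * Y) / Y + derivConst 2) * ((2 * N + 1) * l2Sq N β) := by
          positivity
        refine mul_le_mul_of_nonneg_left ?_ hpre
        simp only [pow_one] at hC
        have hlogQ : 0 ≤ Real.log (4 * Q) := Real.log_nonneg (by linarith)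
        have hCb : 0 ≤ 4 * Cb * Q * Real.log (4 * Q) ^ kb := le_trans hA0 hA
        have hC2 : 0 ≤ 4 * C₂ * Real.log (4 * Q) ^ k₂ := le_trans hB0 hB
        exact mul_le_mul (mul_le_mul hA hB hB0 hCb) hC hC0 (mul_nonneg hCb hC2)



/-! ## Parameter tools for Theorem 2: powers of `Λ = log x` -/

/-- Product rule for `Λ`-power majorants. [folklore] -/
theorem lpow_mul {Λ p q u v : ℝ} (hΛ : 1 ≤ Λ) (hv : 0 ≤ v) (h1 : u ≤ Λ ^ p) (h2 : v ≤ Λ ^ q) :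
    u * v ≤ Λ ^ (p + q) := by
  rw [Real.rpow_add (by linarith)]
  exact mul_le_mul h1 h2 hv (Real.rpow_nonneg (by linarith) _)

/-- `(2Λ)^B ≤ Λ^{2B}` for `Λ ≥ 2`, `B ≥ 0` (real exponent). [folklore] -/
theorem lam_two_mul_rpow_le {Λ B : ℝ} (hΛ : 2 ≤ Λ) (hB : 0 ≤ B) : (2 * Λ) ^ B ≤ Λ ^ (2 * B) := by
  rw [Real.rpow_mul (by linarith), Real.rpow_two]
  exact Real.rpow_le_rpow (by linarith) (by nlinarith) hB

/-- `(2Λ)^k ≤ Λ^{2k}` for `Λ ≥ 2` (natural exponent, real-exponent right side). [folklore] -/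
theorem lam_two_mul_pow_le {Λ : ℝ} (hΛ : 2 ≤ Λ) (k : ℕ) : (2 * Λ) ^ k ≤ Λ ^ (2 * (k : ℝ)) := by
  have := lam_two_mul_rpow_le hΛ (Nat.cast_nonneg k)
  rwa [Real.rpow_natCast] at this

/-- `Λ^k = Λ^{(k:ℝ)}`. [folklore] -/
theorem pow_le_rpow_natCast (Λ : ℝ) (k : ℕ) : Λ ^ k ≤ Λ ^ ((k : ℝ)) := by
  rw [Real.rpow_natCast]

/-- `2^B ≤ Λ^B` for `Λ ≥ 2`, `B ≥ 0`. [folklore] -/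
theorem lam_two_rpow_le {Λ B : ℝ} (hΛ : 2 ≤ Λ) (hB : 0 ≤ B) : (2 : ℝ) ^ B ≤ Λ ^ B :=
  Real.rpow_le_rpow (by norm_num) hΛ hB

/-- `2^k ≤ Λ^k`. [folklore] -/
theorem lam_two_pow_le {Λ : ℝ} (hΛ : 2 ≤ Λ) (k : ℕ) : (2 : ℝ) ^ k ≤ Λ ^ ((k : ℝ)) := by
  rw [Real.rpow_natCast]; exact pow_le_pow_left₀ (by norm_num) hΛ k

/-- A constant is `≤ Λ^1` once `Λ ≥ c`. [folklore] -/
theorem const_le_lpow {Λ c : ℝ} (h : c ≤ Λ) : c ≤ Λ ^ (1 : ℝ) := by rwa [Real.rpow_one]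

/-- `4Λ + 1 ≤ Λ^2` for `Λ ≥ 5`. [folklore] -/
theorem four_mul_add_one_le {Λ : ℝ} (hΛ : 5 ≤ Λ) : 4 * Λ + 1 ≤ Λ ^ (2 : ℝ) := by
  rw [Real.rpow_two]; nlinarith

/-- `2 + 3Λ ≤ Λ^2` for `Λ ≥ 4`. [folklore] -/
theorem two_add_three_mul_le {Λ : ℝ} (hΛ : 4 ≤ Λ) : 2 + 3 * Λ ≤ Λ ^ (2 : ℝ) := by
  rw [Real.rpow_two]; nlinarith

/-- Monotonicity in the exponent for `Λ ≥ 1`. [folklore] -/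
theorem lpow_le_lpow {Λ p q : ℝ} (hΛ : 1 ≤ Λ) (h : p ≤ q) : Λ ^ p ≤ Λ ^ q :=
  Real.rpow_le_rpow_of_exponent_le hΛ h

/-! ## The range of Theorem 2: consequences of (i)–(iii) -/

/-- **Range facts.**  From `MN = x`, `x^ε ≤ N ≤ x^{1−ε}`, `x^ε R < N`, and the conditions (i)–(iii) of
Theorem 2 (with `0 < ε₀ ≤ ε`, `x ≥ 1`): `N²Q² ≤ x^{1−2ε₀}R`, `N^{5/2}Q ≤ x^{1−5ε₀/2}`,
`N⁴Q³ ≤ x^{2−4ε₀}`, `R x^{ε₀} ≤ N`, `QNR ≤ x^{1−4ε₀}`. [cite: BombieriFriedlanderIwaniecActa1986, §9 Theorem 2 p. 230] -/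
theorem range_facts {x N Q R ε ε₀ : ℝ} (hx : 1 ≤ x) (hε : ε₀ ≤ ε)
    (hN1 : x ^ ε ≤ N) (hN2 : N ≤ x ^ (1 - ε)) (hQ : 1 / 2 ≤ Q) (hR : 1 / 2 ≤ R)
    (ha' : x ^ ε * R < N) (hi : N < x ^ (-ε) * (x * R / Q ^ 2) ^ (1 / 2 : ℝ))
    (hii : N < x ^ (-ε) * (x / Q) ^ (2 / 5 : ℝ)) (hiii : N < x ^ (-ε) * (x ^ 2 / Q ^ 3) ^ (1 / 4 : ℝ)) :
    N ^ 2 * Q ^ 2 ≤ x ^ (1 - 2 * ε₀) * R ∧ N ^ (5 / 2 : ℝ) * Q ≤ x ^ (1 - 5 * ε₀ / 2) ∧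
      N ^ 4 * Q ^ 3 ≤ x ^ (2 - 4 * ε₀) ∧ R * x ^ ε₀ ≤ N ∧ Q * N * R ≤ x ^ (1 - 4 * ε₀) ∧
      N ≤ x ^ (1 - ε₀) ∧ x ^ ε₀ ≤ N := by
  have hx0 : 0 < x := by linarith
  have hQ0 : 0 < Q := by linarith
  have hR0 : 0 < R := by linarith
  have hxe : 0 < x ^ ε := Real.rpow_pos_of_pos hx0 _
  have hN0 : 0 < N := lt_of_lt_of_le hxe hN1
  -- monotonicity in the exponent (`x ≥ 1`)
  have hxm : ∀ {p q : ℝ}, p ≤ q → x ^ p ≤ x ^ q := fun h => Real.rpow_le_rpow_of_exponent_le hx h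
  have hxε : x ^ (-ε) ≤ x ^ (-ε₀) := hxm (by linarith)
  have hxε0 : 0 < x ^ (-ε) := Real.rpow_pos_of_pos hx0 _
  -- (i): square
  have h1 : N ^ 2 * Q ^ 2 ≤ x ^ (1 - 2 * ε₀) * R := by
    have hb : 0 ≤ x ^ (-ε) * (x * R / Q ^ 2) ^ (1 / 2 : ℝ) := by positivity
    have hsq : N ^ 2 ≤ (x ^ (-ε) * (x * R / Q ^ 2) ^ (1 / 2 : ℝ)) ^ 2 := pow_le_pow_left₀ hN0.le hi.le 2
    rw [mul_pow, ← Real.rpow_natCast ((x * R / Q ^ 2) ^ (1 / 2 : ℝ)) 2, ← Real.rpow_mul (by positivity)] at hsq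
    norm_num at hsq
    have e : (x ^ (-ε)) ^ 2 = x ^ (-2 * ε) := by
      rw [← Real.rpow_natCast, ← Real.rpow_mul hx0.le]; ring_nf
    rw [e] at hsq
    have h2 : x ^ (-2 * ε) ≤ x ^ (-2 * ε₀) := hxm (by linarith)
    calc N ^ 2 * Q ^ 2 ≤ x ^ (-2 * ε) * (x * R / Q ^ 2) * Q ^ 2 := mul_le_mul_of_nonneg_right hsq (sq_nonneg _)
      _ = x ^ (-2 * ε) * x * R := by field_simp
      _ ≤ x ^ (-2 * ε₀) * x * R := by gcongr
      _ = x ^ (1 - 2 * ε₀) * R := by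
          rw [show (1 - 2 * ε₀) = (-2 * ε₀) + 1 by ring, Real.rpow_add hx0, Real.rpow_one]
  -- (ii): power 5/2
  have h2 : N ^ (5 / 2 : ℝ) * Q ≤ x ^ (1 - 5 * ε₀ / 2) := by
    have hb : 0 ≤ x ^ (-ε) * (x / Q) ^ (2 / 5 : ℝ) := by positivity
    have hp : N ^ (5 / 2 : ℝ) ≤ (x ^ (-ε) * (x / Q) ^ (2 / 5 : ℝ)) ^ (5 / 2 : ℝ) :=
      Real.rpow_le_rpow hN0.le hii.le (by norm_num)
    rw [Real.mul_rpow hxε0.le (by positivity), ← Real.rpow_mul hx0.le, ← Real.rpow_mul (by positivity)] at hp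
    norm_num at hp
    have h3 : x ^ (-(ε * (5 / 2))) ≤ x ^ (-(5 * ε₀ / 2)) := hxm (by nlinarith)
    calc N ^ (5 / 2 : ℝ) * Q ≤ x ^ (-(ε * (5 / 2))) * (x / Q) * Q := mul_le_mul_of_nonneg_right hp hQ0.le
      _ = x ^ (-(ε * (5 / 2))) * x := by field_simp
      _ ≤ x ^ (-(5 * ε₀ / 2)) * x := by gcongr
      _ = x ^ (1 - 5 * ε₀ / 2) := by
          rw [show (1 - 5 * ε₀ / 2) = -(5 * ε₀ / 2) + 1 by ring, Real.rpow_add hx0, Real.rpow_one]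
  -- (iii): power 4
  have h3 : N ^ 4 * Q ^ 3 ≤ x ^ (2 - 4 * ε₀) := by
    have hb : 0 ≤ x ^ (-ε) * (x ^ 2 / Q ^ 3) ^ (1 / 4 : ℝ) := by positivity
    have hp : N ^ 4 ≤ (x ^ (-ε) * (x ^ 2 / Q ^ 3) ^ (1 / 4 : ℝ)) ^ 4 := pow_le_pow_left₀ hN0.le hiii.le 4
    rw [mul_pow, ← Real.rpow_natCast ((x ^ 2 / Q ^ 3) ^ (1 / 4 : ℝ)) 4, ← Real.rpow_mul (by positivity)] at hp
    norm_num at hp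
    have e : (x ^ (-ε)) ^ 4 = x ^ (-4 * ε) := by
      rw [← Real.rpow_natCast, ← Real.rpow_mul hx0.le]; ring_nf
    rw [e] at hp
    have h4 : x ^ (-4 * ε) ≤ x ^ (-4 * ε₀) := hxm (by linarith)
    calc N ^ 4 * Q ^ 3 ≤ x ^ (-4 * ε) * (x ^ 2 / Q ^ 3) * Q ^ 3 := mul_le_mul_of_nonneg_right hp (by positivity)
      _ = x ^ (-4 * ε) * x ^ 2 := by field_simp
      _ ≤ x ^ (-4 * ε₀) * x ^ 2 := by gcongr
      _ = x ^ (2 - 4 * ε₀) := by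
          rw [show (2 - 4 * ε₀) = (-4 * ε₀) + 2 by ring, Real.rpow_add hx0, Real.rpow_two]
  -- `R x^{ε₀} ≤ N`
  have h4 : R * x ^ ε₀ ≤ N := by
    have : x ^ ε₀ ≤ x ^ ε := hxm hε
    nlinarith [Real.rpow_pos_of_pos hx0 ε₀]
  have h6 : N ≤ x ^ (1 - ε₀) := hN2.trans (hxm (by linarith))
  have h7 : x ^ ε₀ ≤ N := (hxm hε).trans hN1
  -- `QNR ≤ x^{1-4ε₀}`: `QNR ≤ Q N² x^{-ε₀}` and `N²Q ≤ N^{5/2}Q / N^{1/2} ≤ x^{1-5ε₀/2} x^{-ε₀/2}`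
  have h5 : Q * N * R ≤ x ^ (1 - 4 * ε₀) := by
    have hxε₀ : 0 < x ^ ε₀ := Real.rpow_pos_of_pos hx0 _
    have hR' : R ≤ N / x ^ ε₀ := by rw [le_div_iff₀ hxε₀]; exact h4
    have hsqN : x ^ (ε₀ / 2) ≤ N ^ (1 / 2 : ℝ) := by
      have : (x ^ ε₀) ^ (1 / 2 : ℝ) ≤ N ^ (1 / 2 : ℝ) := Real.rpow_le_rpow hxε₀.le h7 (by norm_num)
      rwa [← Real.rpow_mul hx0.le, show ε₀ * (1 / 2) = ε₀ / 2 by ring] at this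
    have hN2Q : N ^ 2 * Q * x ^ (ε₀ / 2) ≤ x ^ (1 - 5 * ε₀ / 2) := by
      calc N ^ 2 * Q * x ^ (ε₀ / 2) ≤ N ^ 2 * Q * N ^ (1 / 2 : ℝ) := by gcongr
        _ = N ^ (5 / 2 : ℝ) * Q := by
            rw [show (5 / 2 : ℝ) = 2 + 1 / 2 by norm_num, Real.rpow_add hN0, Real.rpow_two]; ring
        _ ≤ _ := h2
    have hx2 : 0 < x ^ (ε₀ / 2) := Real.rpow_pos_of_pos hx0 _
    calc Q * N * R ≤ Q * N * (N / x ^ ε₀) := by gcongr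
      _ = (N ^ 2 * Q * x ^ (ε₀ / 2)) / (x ^ (ε₀ / 2) * x ^ ε₀) := by field_simp
      _ ≤ x ^ (1 - 5 * ε₀ / 2) / (x ^ (ε₀ / 2) * x ^ ε₀) := by gcongr
      _ = x ^ (1 - 4 * ε₀) := by
          rw [← Real.rpow_add hx0, div_eq_iff (Real.rpow_pos_of_pos hx0 _).ne', ← Real.rpow_add hx0]
          ring_nf
  exact ⟨h1, h2, h3, h4, h5, h6, h7⟩

/-- **More range facts**: `QR ≤ M x^{−4ε₀}`, `QR² ≤ x^{1−5ε₀}`, `Q² ≤ M x^{−3ε₀}`,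
`NQ/√R ≤ x^{1/2−ε₀}`, `√(N^{5/2}Q) ≤ x^{1/2−ε₀}`, `√(N²Q^{3/2}) ≤ x^{1/2−ε₀}`, `Q²R²N ≤ x^{2−4ε₀}`.
[cite: BombieriFriedlanderIwaniecActa1986, §9 (9.21) p. 231] -/
theorem range_facts' {x M N Q R ε₀ : ℝ} (hx : 1 ≤ x) (hMN : M * N = x) (hε₀ : 0 < ε₀) (hε₁ : ε₀ ≤ 1 / 10)
    (hN0 : 1 ≤ N) (hQ : 1 / 2 ≤ Q) (hR : 1 / 2 ≤ R) (hQR : Q * R < x)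
    (h1 : N ^ 2 * Q ^ 2 ≤ x ^ (1 - 2 * ε₀) * R) (h2 : N ^ (5 / 2 : ℝ) * Q ≤ x ^ (1 - 5 * ε₀ / 2))
    (h3 : N ^ 4 * Q ^ 3 ≤ x ^ (2 - 4 * ε₀)) (h4 : R * x ^ ε₀ ≤ N) (h5 : Q * N * R ≤ x ^ (1 - 4 * ε₀)) :
    Q * R ≤ M * x ^ (-4 * ε₀) ∧ Q * R ^ 2 ≤ x ^ (1 - 5 * ε₀) ∧ Q ^ 2 ≤ M * x ^ (-3 * ε₀) ∧
      N * Q / Real.sqrt R ≤ x ^ (1 / 2 - ε₀) ∧ Real.sqrt (N ^ (5 / 2 : ℝ) * Q) ≤ x ^ (1 / 2 - ε₀) ∧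
      Real.sqrt (N ^ 2 * Q ^ (3 / 2 : ℝ)) ≤ x ^ (1 / 2 - ε₀) ∧ Q ^ 2 * R ^ 2 * N ≤ x ^ (2 - 4 * ε₀) := by
  have hx0 : 0 < x := by linarith
  have hQ0 : 0 < Q := by linarith
  have hR0 : 0 < R := by linarith
  have hN0' : 0 < N := by linarith
  have hM0 : 0 < M := by
    by_contra h; rw [not_lt] at h
    have : M * N ≤ 0 := mul_nonpos_of_nonpos_of_nonneg h hN0'.le
    linarith
  have hxm : ∀ {p q : ℝ}, p ≤ q → x ^ p ≤ x ^ q := fun h => Real.rpow_le_rpow_of_exponent_le hx h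
  have hxp : ∀ p : ℝ, 0 < x ^ p := fun p => Real.rpow_pos_of_pos hx0 p
  have hMx : M = x / N := by rw [← hMN]; field_simp
  -- QR ≤ M x^{-4ε₀}
  have f1 : Q * R ≤ M * x ^ (-4 * ε₀) := by
    rw [hMx]
    rw [show x / N * x ^ (-4 * ε₀) = x ^ (1 - 4 * ε₀) / N by
      rw [show (1 - 4 * ε₀) = 1 + (-4 * ε₀) by ring, Real.rpow_add hx0, Real.rpow_one]; ring]
    rw [le_div_iff₀ hN0']; nlinarith
  -- QR² ≤ x^{1-5ε₀}
  have f2 : Q * R ^ 2 ≤ x ^ (1 - 5 * ε₀) := by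
    have hR' : R ≤ N * x ^ (-ε₀) := by
      have : R * x ^ ε₀ * x ^ (-ε₀) ≤ N * x ^ (-ε₀) := mul_le_mul_of_nonneg_right h4 (hxp _).le
      rwa [mul_assoc, ← Real.rpow_add hx0, add_neg_cancel, Real.rpow_zero, mul_one] at this
    calc Q * R ^ 2 = (Q * R) * R := by ring
      _ ≤ (Q * R) * (N * x ^ (-ε₀)) := by gcongr
      _ = Q * N * R * x ^ (-ε₀) := by ring
      _ ≤ x ^ (1 - 4 * ε₀) * x ^ (-ε₀) := by gcongr
      _ = x ^ (1 - 5 * ε₀) := by rw [← Real.rpow_add hx0]; ring_nf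
  -- Q² ≤ M x^{-3ε₀}: `N²Q² ≤ x^{1-2ε₀} R ≤ x^{1-2ε₀} N x^{-ε₀}`
  have f3 : Q ^ 2 ≤ M * x ^ (-3 * ε₀) := by
    have hR' : R ≤ N * x ^ (-ε₀) := by
      have : R * x ^ ε₀ * x ^ (-ε₀) ≤ N * x ^ (-ε₀) := mul_le_mul_of_nonneg_right h4 (hxp _).le
      rwa [mul_assoc, ← Real.rpow_add hx0, add_neg_cancel, Real.rpow_zero, mul_one] at this
    have h : N ^ 2 * Q ^ 2 ≤ x ^ (1 - 2 * ε₀) * (N * x ^ (-ε₀)) := h1.trans (by gcongr)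
    rw [hMx]
    rw [show x / N * x ^ (-3 * ε₀) = x ^ (1 - 2 * ε₀) * x ^ (-ε₀) / N by
      rw [← Real.rpow_add hx0, show (1 - 2 * ε₀ + -ε₀) = 1 + (-3 * ε₀) by ring, Real.rpow_add hx0,
        Real.rpow_one]; ring]
    rw [le_div_iff₀ hN0']
    nlinarith
  -- the three square-root facts
  have hhalf : ∀ {u : ℝ} {p : ℝ}, 0 ≤ u → u ≤ x ^ p → Real.sqrt u ≤ x ^ (p / 2) := by
    intro u p hu h
    calc Real.sqrt u ≤ Real.sqrt (x ^ p) := Real.sqrt_le_sqrt h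
      _ = x ^ (p / 2) := by rw [Real.sqrt_eq_rpow, ← Real.rpow_mul hx0.le]; ring_nf
  have f4 : N * Q / Real.sqrt R ≤ x ^ (1 / 2 - ε₀) := by
    have hsR : 0 < Real.sqrt R := Real.sqrt_pos.2 hR0
    rw [div_le_iff₀ hsR]
    have h : (N * Q) ^ 2 ≤ x ^ (1 - 2 * ε₀) * R := by nlinarith
    have := hhalf (by positivity) (show (N * Q) ^ 2 / R ≤ x ^ (1 - 2 * ε₀) by rw [div_le_iff₀ hR0]; exact h)
    rw [Real.sqrt_div (by positivity), Real.sqrt_sq (by positivity), div_le_iff₀ hsR] at this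
    convert this using 2; ring
  have f5 : Real.sqrt (N ^ (5 / 2 : ℝ) * Q) ≤ x ^ (1 / 2 - ε₀) := by
    refine (hhalf (by positivity) h2).trans (hxm (by linarith))
  have f6 : Real.sqrt (N ^ 2 * Q ^ (3 / 2 : ℝ)) ≤ x ^ (1 / 2 - ε₀) := by
    have h : N ^ 2 * Q ^ (3 / 2 : ℝ) ≤ x ^ (1 - 2 * ε₀) := by
      have hsq : (N ^ 2 * Q ^ (3 / 2 : ℝ)) ^ 2 = N ^ 4 * Q ^ 3 := by
        rw [mul_pow, ← Real.rpow_natCast (Q ^ (3 / 2 : ℝ)) 2, ← Real.rpow_mul hQ0.le]; norm_num; left; ring_nf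
      have hx2 : (x ^ (1 - 2 * ε₀)) ^ 2 = x ^ (2 - 4 * ε₀) := by
        rw [← Real.rpow_natCast, ← Real.rpow_mul hx0.le]; ring_nf
      have : (N ^ 2 * Q ^ (3 / 2 : ℝ)) ^ 2 ≤ (x ^ (1 - 2 * ε₀)) ^ 2 := by rw [hsq, hx2]; exact h3
      exact (pow_le_pow_iff_left₀ (by positivity) (hxp _).le two_ne_zero).1 this
    refine (hhalf (by positivity) h).trans (le_of_eq (by ring_nf))
  have f7 : Q ^ 2 * R ^ 2 * N ≤ x ^ (2 - 4 * ε₀) := by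
    calc Q ^ 2 * R ^ 2 * N = (Q * N * R) * (Q * R) := by ring
      _ ≤ x ^ (1 - 4 * ε₀) * x := mul_le_mul h5 hQR.le (by positivity) (hxp _).le
      _ = x ^ (2 - 4 * ε₀) := by
          rw [show (2 - 4 * ε₀) = (1 - 4 * ε₀) + 1 by ring, Real.rpow_add hx0, Real.rpow_one]
  exact ⟨f1, f2, f3, f4, f5, f6, f7⟩


/-! ## Parameter lemmas for Theorem 2 (levels, thresholds, small reductions) -/

/-- The level for `E2`: `q₁ r n ≤ ((5M/2) n)^{1−ε₀/3}` for `q₁ ∼ Q`, `r ∼ R`, `n ∼ N` once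
`QR ≤ M x^{−4ε₀}` and `16 ≤ x^{11ε₀/3}`. [folklore] -/
theorem level_e2 {x M N Q R ε₀ : ℝ} (hx : 1 ≤ x) (hMN : M * N = x) (hM : 0 < M) (hN : 0 < N)
    (hQ : 0 < Q) (hR : 0 < R) (hε₀ : 0 < ε₀) (hε₁ : ε₀ ≤ 1) (hQR : Q * R ≤ M * x ^ (-4 * ε₀))
    (h16 : (16 : ℝ) ≤ x ^ (11 * ε₀ / 3)) :
    ∀ q₁ ∈ dyadic Q, ∀ r ∈ dyadic R, ∀ n ∈ dyadic N,
      ((q₁ * r * n : ℕ) : ℝ) ≤ ((2 * M + M / 2) * n) ^ (1 - ε₀ / 3) := by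
  intro q₁ hq₁ r hr n hn
  have hx0 : 0 < x := by linarith
  obtain ⟨-, hq₁2⟩ := (mem_dyadic hQ.le).1 hq₁
  obtain ⟨-, hr2⟩ := (mem_dyadic hR.le).1 hr
  obtain ⟨hn1, hn2⟩ := (mem_dyadic hN.le).1 hn
  set u : ℝ := M * n with hu
  have hux : x ≤ u := by rw [hu, ← hMN]; exact mul_le_mul_of_nonneg_left hn1.le hM.le
  have hu0 : 0 < u := by linarith
  have hxp : ∀ p : ℝ, 0 < x ^ p := fun p => Real.rpow_pos_of_pos hx0 p
  have hl : ((q₁ * r * n : ℕ) : ℝ) ≤ 4 * x ^ (-4 * ε₀) * u := by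
    push_cast
    calc (q₁ : ℝ) * r * n ≤ (2 * Q) * (2 * R) * n := by gcongr
      _ = 4 * (Q * R) * n := by ring
      _ ≤ 4 * (M * x ^ (-4 * ε₀)) * n := by gcongr
      _ = 4 * x ^ (-4 * ε₀) * u := by rw [hu]; ring
  have hr' : u / (2 * x) ^ (ε₀ / 3) ≤ ((2 * M + M / 2) * n) ^ (1 - ε₀ / 3) := by
    have e : (2 * M + M / 2) * n = 5 / 2 * u := by rw [hu]; ring
    rw [e]
    have hu2 : u ≤ 2 * x := by
      rw [hu, ← hMN]; exact (mul_le_mul_of_nonneg_left hn2 hM.le).trans (le_of_eq (by ring))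
    calc u / (2 * x) ^ (ε₀ / 3) ≤ u / u ^ (ε₀ / 3) := by
          gcongr
      _ = u ^ (1 - ε₀ / 3) := by rw [Real.rpow_sub hu0, Real.rpow_one]
      _ ≤ (5 / 2 * u) ^ (1 - ε₀ / 3) := Real.rpow_le_rpow hu0.le (by linarith) (by linarith)
  refine hl.trans (le_trans ?_ hr')
  rw [le_div_iff₀ (by positivity)]
  have h2x : (2 * x) ^ (ε₀ / 3) ≤ 2 * x ^ (ε₀ / 3) := by
    rw [Real.mul_rpow (by norm_num) hx0.le]
    refine mul_le_mul_of_nonneg_right ?_ (hxp _).le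
    calc (2 : ℝ) ^ (ε₀ / 3) ≤ (2 : ℝ) ^ (1 : ℝ) := Real.rpow_le_rpow_of_exponent_le (by norm_num) (by linarith)
      _ = 2 := Real.rpow_one 2
  have hkey : 8 * x ^ (-4 * ε₀) * x ^ (ε₀ / 3) ≤ 1 := by
    have e : x ^ (-4 * ε₀) * x ^ (ε₀ / 3) * x ^ (11 * ε₀ / 3) = 1 := by
      rw [← Real.rpow_add hx0, ← Real.rpow_add hx0]; (ring_nf; simp)
    have h0 : 0 < x ^ (-4 * ε₀) * x ^ (ε₀ / 3) := mul_pos (hxp _) (hxp _)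
    nlinarith
  calc 4 * x ^ (-4 * ε₀) * u * (2 * x) ^ (ε₀ / 3) ≤ 4 * x ^ (-4 * ε₀) * u * (2 * x ^ (ε₀ / 3)) := by gcongr
    _ = (8 * x ^ (-4 * ε₀) * x ^ (ε₀ / 3)) * u := by ring
    _ ≤ 1 * u := mul_le_mul_of_nonneg_right hkey hu0.le
    _ = u := one_mul u

/-- The level for `E1` (U-part): `m t ≤ (2mN)^{1−ε₀/3}` for `M/2 < m ≤ 5M/2`, `t ≤ 2P₀R`,
`P₀ = x^{ε₀/3}`, once `R ≤ N x^{−ε₀}` and `5 ≤ x^{ε₀/3}`. [folklore] -/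
theorem level_e1 {x M N R ε₀ : ℝ} (hx : 1 ≤ x) (hMN : M * N = x) (hM : 0 < M)
    (hε₁ : ε₀ ≤ 1) (hRN : R ≤ N * x ^ (-ε₀)) (h5 : (5 : ℝ) ≤ x ^ (ε₀ / 3)) :
    ∀ m : ℕ, M - M / 2 < (m : ℝ) → (m : ℝ) ≤ 2 * M + M / 2 → ∀ t : ℕ, (t : ℝ) ≤ 2 * x ^ (ε₀ / 3) * R →
      ((m * t : ℕ) : ℝ) ≤ (2 * m * N) ^ (1 - ε₀ / 3) := by
  intro m hm1 hm2 t ht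
  have hx0 : 0 < x := by linarith
  have hmN : x ≤ 2 * m * N := by rw [← hMN]; nlinarith
  have hl : ((m * t : ℕ) : ℝ) ≤ 5 * x ^ (1 - 2 * ε₀ / 3) := by
    push_cast
    calc (m : ℝ) * t ≤ (2 * M + M / 2) * (2 * x ^ (ε₀ / 3) * R) := by gcongr
      _ = 5 * x ^ (ε₀ / 3) * (M * R) := by ring
      _ ≤ 5 * x ^ (ε₀ / 3) * (M * (N * x ^ (-ε₀))) := by gcongr
      _ = 5 * (x ^ (ε₀ / 3) * (x ^ (1 : ℝ) * x ^ (-ε₀))) := by rw [Real.rpow_one, ← hMN]; ring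
      _ = 5 * x ^ (1 - 2 * ε₀ / 3) := by rw [← Real.rpow_add hx0, ← Real.rpow_add hx0]; ring_nf
  have hr' : x ^ (1 - ε₀ / 3) ≤ (2 * m * N) ^ (1 - ε₀ / 3) := Real.rpow_le_rpow hx0.le hmN (by linarith)
  refine hl.trans (le_trans ?_ hr')
  calc 5 * x ^ (1 - 2 * ε₀ / 3) ≤ x ^ (ε₀ / 3) * x ^ (1 - 2 * ε₀ / 3) :=
        mul_le_mul_of_nonneg_right h5 (Real.rpow_nonneg hx0.le _)
    _ = x ^ (1 - ε₀ / 3) := by rw [← Real.rpow_add hx0]; ring_nf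

/-- The level for `E1` (V-part): `k ≤ 4QR ⟹ k ≤ (5M/2)^{1−ε₀}` once `QR ≤ M x^{−4ε₀}`, `M ≤ x` and
`4 ≤ x^{3ε₀}`. [folklore] -/
theorem level_e1' {x M Q R ε₀ : ℝ} (hx : 1 ≤ x) (hM : 0 < M) (hMx : M ≤ x) (hε₀ : 0 < ε₀) (hε₁ : ε₀ ≤ 1)
    (hQR : Q * R ≤ M * x ^ (-4 * ε₀)) (h4 : (4 : ℝ) ≤ x ^ (3 * ε₀)) :
    ∀ k : ℕ, (k : ℝ) ≤ 4 * Q * R → (k : ℝ) ≤ (2 * M + M / 2) ^ (1 - ε₀) := by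
  intro k hk
  have hx0 : 0 < x := by linarith
  have h1 : (k : ℝ) ≤ 4 * M * x ^ (-4 * ε₀) := hk.trans (by nlinarith [Real.rpow_pos_of_pos hx0 (-4 * ε₀)])
  have h2 : M * x ^ (-ε₀) ≤ (2 * M + M / 2) ^ (1 - ε₀) := by
    calc M * x ^ (-ε₀) ≤ M * M ^ (-ε₀) := by
          gcongr M * ?_
          exact Real.rpow_le_rpow_of_nonpos hM hMx (by linarith)
      _ = M ^ (1 - ε₀) := by rw [show (1 - ε₀) = 1 + (-ε₀) by ring, Real.rpow_add hM, Real.rpow_one]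
      _ ≤ (2 * M + M / 2) ^ (1 - ε₀) := Real.rpow_le_rpow hM.le (by linarith) (by linarith)
  refine h1.trans (le_trans ?_ h2)
  have e : x ^ (-4 * ε₀) * x ^ (3 * ε₀) = x ^ (-ε₀) := by rw [← Real.rpow_add hx0]; ring_nf
  calc 4 * M * x ^ (-4 * ε₀) ≤ x ^ (3 * ε₀) * M * x ^ (-4 * ε₀) := by gcongr
    _ = M * (x ^ (-4 * ε₀) * x ^ (3 * ε₀)) := by ring
    _ = M * x ^ (-ε₀) := by rw [e]

/-- The uniform divisor bound for the V-part of `E1`: `τ(mn − a)^{b+1} ≤ T` with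
`T = (C_T (6x)^{η/(b+1)})^{b+1}`. [folklore] -/
theorem tau_shift_le_T {x M N : ℝ} {a : ℤ} {b : ℕ} {η CT : ℝ} (hMN : M * N = x) (hM : 0 < M) (hN : 0 < N)
    (hax : |(a : ℝ)| ≤ x) (hη : 0 < η) (hCT : 0 ≤ CT)
    (hTδ : ∀ n : ℕ, ((σ 0 n : ℕ) : ℝ) ≤ CT * (n : ℝ) ^ (η / ((b : ℝ) + 1))) :
    ∀ m : ℕ, (m : ℝ) ≤ 2 * M + M / 2 → ∀ n ∈ dyadic N,
      (σ 0 (((m * n : ℕ) : ℤ) - a).toNat : ℝ) ^ ((b : ℝ) + 1) ≤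
        (CT * (6 * x) ^ (η / ((b : ℝ) + 1))) ^ ((b : ℝ) + 1) := by
  intro m hm n hn
  obtain ⟨-, hn2⟩ := (mem_dyadic hN.le).1 hn
  set v : ℕ := (((m * n : ℕ) : ℤ) - a).toNat with hv
  have hv6 : (v : ℝ) ≤ 6 * x := by
    have h1 : v ≤ m * n + a.natAbs := by
      rw [hv, Int.toNat_le]; push_cast
      have : -a ≤ |a| := neg_le_abs a
      have : (|a| : ℤ) = (a.natAbs : ℤ) := (Int.natCast_natAbs a).symm
      linarith
    have h1' : (v : ℝ) ≤ (m : ℝ) * n + (a.natAbs : ℝ) := by exact_mod_cast h1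
    have h2 : ((a.natAbs : ℕ) : ℝ) = |(a : ℝ)| := by
      rw [← Int.cast_natCast, Int.natCast_natAbs, Int.cast_abs]
    have h3 : (m : ℝ) * n ≤ (2 * M + M / 2) * (2 * N) := by gcongr
    have h4 : (2 * M + M / 2) * (2 * N) = 5 * x := by rw [← hMN]; ring
    rw [h2] at h1'
    linarith
  have h1 : (σ 0 v : ℝ) ≤ CT * (6 * x) ^ (η / ((b : ℝ) + 1)) :=
    (hTδ v).trans (mul_le_mul_of_nonneg_left (Real.rpow_le_rpow (Nat.cast_nonneg _) hv6 (by positivity)) hCT)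
  exact Real.rpow_le_rpow (Nat.cast_nonneg _) h1 (by positivity)

/-- Logarithms in the ranges of `E1`/`E2`, and `ω(n) ≤ 4 log x`. [folklore] -/
theorem log_ranges {x M N : ℝ} (hx : 5 ≤ x) (hMN : M * N = x) (hM : 1 ≤ M) (hN : 1 ≤ N) :
    (∀ n ∈ dyadic N, 0 ≤ Real.log ((2 * M + M / 2) * n) ∧ Real.log ((2 * M + M / 2) * n) ≤ 2 * Real.log x) ∧
    (∀ m : ℕ, M - M / 2 < (m : ℝ) → (m : ℝ) ≤ 2 * M + M / 2 →
      0 ≤ Real.log (2 * m * N) ∧ Real.log (2 * m * N) ≤ 2 * Real.log x) ∧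
    (∀ n ∈ dyadic N, (n.primeFactors.card : ℝ) ≤ 4 * Real.log x) := by
  have hx0 : 0 < x := by linarith
  have hN0 : 0 < N := by linarith
  have h2 : 2 * Real.log x = Real.log (x * x) := by rw [Real.log_mul hx0.ne' hx0.ne']; ring
  refine ⟨fun n hn => ?_, fun m hm1 hm2 => ?_, fun n hn => ?_⟩
  · obtain ⟨hn1, hn2⟩ := (mem_dyadic hN0.le).1 hn
    have h1 : (1 : ℝ) ≤ (2 * M + M / 2) * n := by nlinarith
    have h3 : (2 * M + M / 2) * n ≤ x * x := by
      have h4 : (2 * M + M / 2) * n ≤ (2 * M + M / 2) * (2 * N) := by gcongr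
      have h5 : (2 * M + M / 2) * (2 * N) = 5 * x := by rw [← hMN]; ring
      nlinarith
    exact ⟨Real.log_nonneg h1, h2 ▸ Real.log_le_log (by linarith) h3⟩
  · have h1 : x ≤ 2 * m * N := by rw [← hMN]; nlinarith
    have h3 : 2 * m * N ≤ x * x := by
      have h4 : 2 * (m : ℝ) * N ≤ 2 * (2 * M + M / 2) * N := by gcongr
      have h5 : 2 * (2 * M + M / 2) * N = 5 * x := by rw [← hMN]; ring
      nlinarith
    exact ⟨Real.log_nonneg (by linarith), h2 ▸ Real.log_le_log (by linarith) h3⟩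
  · obtain ⟨hn1, hn2⟩ := (mem_dyadic hN0.le).1 hn
    have hn0 : 0 < (n : ℝ) := by linarith
    calc (n.primeFactors.card : ℝ) ≤ (Nat.log 2 n : ℝ) := by exact_mod_cast card_primeFactors_le_log n
      _ ≤ 2 * Real.log n := natLog_two_le n
      _ ≤ 2 * (2 * Real.log x) := by
          gcongr
          rw [h2]; exact Real.log_le_log hn0 (by nlinarith)
      _ = 4 * Real.log x := by ring

/-- `H ≤ R` in the range of Theorem 2 (`Q² ≤ M x^{−3ε₀}`, `16 ≤ x^{11ε₀/4}`). [folklore] -/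
theorem floorH_le_R {x M Q R ε₀ : ℝ} (hx : 0 < x) (hM : 0 < M) (hR : 0 < R) (hQ2 : Q ^ 2 ≤ M * x ^ (-3 * ε₀))
    (h16 : (16 : ℝ) ≤ x ^ (11 * ε₀ / 4)) :
    ((⌊16 * x ^ (ε₀ / 4) * Q ^ 2 * R / M⌋₊ : ℕ) : ℝ) ≤ R := by
  refine (Nat.floor_le (by positivity)).trans ?_
  rw [div_le_iff₀ hM]
  have hxp : ∀ p : ℝ, 0 < x ^ p := fun p => Real.rpow_pos_of_pos hx p
  have h1 : 16 * x ^ (ε₀ / 4) * Q ^ 2 ≤ M := by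
    have e : x ^ (ε₀ / 4) * x ^ (-3 * ε₀) * x ^ (11 * ε₀ / 4) = 1 := by
      rw [← Real.rpow_add hx, ← Real.rpow_add hx]; (ring_nf; simp)
    have h0 : 0 < x ^ (ε₀ / 4) * x ^ (-3 * ε₀) := mul_pos (hxp _) (hxp _)
    have hk : 16 * (x ^ (ε₀ / 4) * x ^ (-3 * ε₀)) ≤ 1 := by nlinarith
    calc 16 * x ^ (ε₀ / 4) * Q ^ 2 ≤ 16 * x ^ (ε₀ / 4) * (M * x ^ (-3 * ε₀)) := by gcongr
      _ = 16 * (x ^ (ε₀ / 4) * x ^ (-3 * ε₀)) * M := by ring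
      _ ≤ 1 * M := mul_le_mul_of_nonneg_right hk hM.le
      _ = M := one_mul M
  calc 16 * x ^ (ε₀ / 4) * Q ^ 2 * R ≤ M * R := mul_le_mul_of_nonneg_right h1 hR.le
    _ = R * M := mul_comm _ _

/-- The Poisson dual length `θ = 8Q²R/(2π(M/2)(H+1)) ≤ x^{−ε₁}` for `H = [16x^{ε₁}Q²R/M]`, and
`(H+1)θ ≤ 6x²`. [folklore] -/
theorem theta_bounds {x M Q R ε₁ : ℝ} (hx : 1 ≤ x) (hM : 1 ≤ M) (hQ : 0 < Q) (hQx : Q ≤ 2 * x) (hR : 0 < R)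
    (hQR : Q * R < x) :
    8 * Q ^ 2 * R / (2 * π * (M / 2) * (((⌊16 * x ^ ε₁ * Q ^ 2 * R / M⌋₊ : ℕ) : ℝ) + 1)) ≤ x ^ (-ε₁) ∧
    (((⌊16 * x ^ ε₁ * Q ^ 2 * R / M⌋₊ : ℕ) : ℝ) + 1) *
      (8 * Q ^ 2 * R / (2 * π * (M / 2) * (((⌊16 * x ^ ε₁ * Q ^ 2 * R / M⌋₊ : ℕ) : ℝ) + 1))) ≤ 6 * x ^ 2 := by
  have hx0 : 0 < x := by linarith
  have hM0 : 0 < M := by linarith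
  set Hn : ℕ := ⌊16 * x ^ ε₁ * Q ^ 2 * R / M⌋₊ with hHn
  have hπ3 : (3 : ℝ) ≤ π := by have := Real.pi_gt_three; linarith
  have hxp : ∀ p : ℝ, 0 < x ^ p := fun p => Real.rpow_pos_of_pos hx0 p
  constructor
  · have hH1 : 16 * x ^ ε₁ * Q ^ 2 * R / M < (Hn : ℝ) + 1 := Nat.lt_floor_add_one _
    rw [div_lt_iff₀ hM0] at hH1
    rw [div_le_iff₀ (by positivity)]
    have e : x ^ (-ε₁) * x ^ ε₁ = 1 := by rw [← Real.rpow_add hx0, neg_add_cancel, Real.rpow_zero]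
    have h0 : 0 ≤ Q ^ 2 * R := by positivity
    -- `8 Q²R = 8 Q² R (x^{-ε₁} x^{ε₁}) ≤ x^{-ε₁} (Hn+1) M / 2 ≤ x^{-ε₁} π M (Hn+1)`
    have h1 : 8 * Q ^ 2 * R ≤ x ^ (-ε₁) * (((Hn : ℝ) + 1) * M) / 2 := by
      have : 16 * x ^ ε₁ * Q ^ 2 * R ≤ ((Hn : ℝ) + 1) * M := hH1.le
      have h2 : x ^ (-ε₁) * (16 * x ^ ε₁ * Q ^ 2 * R) ≤ x ^ (-ε₁) * (((Hn : ℝ) + 1) * M) :=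
        mul_le_mul_of_nonneg_left this (hxp _).le
      have e2 : x ^ (-ε₁) * (16 * x ^ ε₁ * Q ^ 2 * R) = 16 * Q ^ 2 * R := by
        rw [show x ^ (-ε₁) * (16 * x ^ ε₁ * Q ^ 2 * R) = 16 * Q ^ 2 * R * (x ^ (-ε₁) * x ^ ε₁) by ring, e, mul_one]
      linarith
    calc 8 * Q ^ 2 * R ≤ x ^ (-ε₁) * (((Hn : ℝ) + 1) * M) / 2 := h1
      _ ≤ x ^ (-ε₁) * (2 * π * (M / 2) * ((Hn : ℝ) + 1)) := by
          rw [div_le_iff₀ (by norm_num : (0:ℝ) < 2)]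
          have : ((Hn : ℝ) + 1) * M ≤ 2 * π * (M / 2) * ((Hn : ℝ) + 1) * 2 / 1 := by
            rw [le_div_iff₀ one_pos]; nlinarith [mul_pos hM0 (by positivity : (0:ℝ) < (Hn : ℝ) + 1)]
          nlinarith [(hxp (-ε₁)).le, mul_nonneg (hxp (-ε₁)).le (by positivity : (0:ℝ) ≤ ((Hn : ℝ) + 1) * M)]
  · have e : ((Hn : ℝ) + 1) * (8 * Q ^ 2 * R / (2 * π * (M / 2) * ((Hn : ℝ) + 1))) = 8 * Q ^ 2 * R / (π * M) := by
      field_simp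
    rw [e, div_le_iff₀ (by positivity)]
    have h1 : Q ^ 2 * R ≤ 2 * x ^ 2 := by nlinarith [mul_le_mul hQx hQR.le (by positivity) (by positivity)]
    nlinarith [mul_le_mul hπ3 hM zero_le_one (by positivity), sq_nonneg x]

/-- The geometric tail factor: with `θ ≤ x^{−ε₁}`, `(H+1)θ ≤ 6x²`, `ε₁ (j−1) ≥ 5`, `R ≤ 2x`, `x ≥ 12`:
`P R (H+1) θ^j ≤ 1` whenever `P ≤ x^{η}`, `η ≤ 1`. [folklore] -/
theorem tail_small {x P R H θ ε₁ η : ℝ} {j : ℕ} (hx : 12 ≤ x) (hP : P ≤ x ^ η) (hη : η ≤ 1)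
    (hR0 : 0 ≤ R) (hRx : R ≤ 2 * x) (hH0 : 0 ≤ H + 1) (hθ0 : 0 ≤ θ) (hθ : θ ≤ x ^ (-ε₁)) (hHθ : (H + 1) * θ ≤ 6 * x ^ 2)
    (hj : 2 ≤ j) (hj5 : 5 ≤ ε₁ * ((j - 1 : ℕ) : ℝ)) :
    P * R * (H + 1) * θ ^ j ≤ 1 := by
  have hx0 : 0 < x := by linarith
  have hx1 : 1 ≤ x := by linarith
  obtain ⟨j', hj'⟩ : ∃ j', j = j' + 1 := ⟨j - 1, by omega⟩
  have hj'' : (j - 1 : ℕ) = j' := by omega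
  rw [hj''] at hj5
  have hθj : θ ^ j' ≤ x ^ (-(5 : ℝ)) := by
    calc θ ^ j' ≤ (x ^ (-ε₁)) ^ j' := pow_le_pow_left₀ hθ0 hθ j'
      _ = x ^ (-(ε₁ * j')) := by rw [← Real.rpow_natCast, ← Real.rpow_mul hx0.le]; ring_nf
      _ ≤ x ^ (-(5 : ℝ)) := Real.rpow_le_rpow_of_exponent_le hx1 (by linarith)
  calc P * R * (H + 1) * θ ^ j = P * R * ((H + 1) * θ) * θ ^ j' := by rw [hj', pow_succ]; ring
    _ ≤ x ^ η * (2 * x) * (6 * x ^ 2) * x ^ (-(5 : ℝ)) := by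
        gcongr
    _ = 12 * (x ^ η * x ^ (3 : ℝ) * x ^ (-(5 : ℝ))) := by
        rw [show x ^ (3 : ℝ) = x * x ^ 2 by rw [show (3:ℝ) = ((3:ℕ):ℝ) by norm_num, Real.rpow_natCast]; ring]
        ring
    _ = 12 * x ^ (η - 2) := by rw [← Real.rpow_add hx0, ← Real.rpow_add hx0]; ring_nf
    _ ≤ 12 * x ^ (-(1 : ℝ)) := by
        gcongr 12 * ?_
        exact Real.rpow_le_rpow_of_exponent_le hx1 (by linarith)
    _ ≤ 1 := by
        rw [Real.rpow_neg hx0.le, Real.rpow_one, mul_inv_le_iff₀ hx0]; linarith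

/-- `γ`-bound with the natural exponent `b = ⌈B⌉`. [folklore] -/
theorem gamma_natpow {γ : ℕ → ℝ} {B : ℝ} (hB : 0 ≤ B) (hγ : ∀ q, |γ q| ≤ (σ 0 q : ℝ) ^ B) :
    ∀ q, |γ q| ≤ (σ 0 q : ℝ) ^ ⌈B⌉₊ := by
  intro q
  rcases eq_or_ne q 0 with rfl | hq
  · have h0 := hγ 0
    simp only [ArithmeticFunction.map_zero, Nat.cast_zero] at h0 ⊢
    rcases hB.eq_or_lt with hB0 | hBpos
    · rw [← hB0] at h0 ⊢
      simpa using h0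
    · rw [Real.zero_rpow hBpos.ne'] at h0
      exact h0.trans (pow_nonneg le_rfl _)
  · exact (hγ q).trans (rpow_sigma_le_pow_ceil hq B)

/-- Lemma 7 with a common constant for `a` and `−a` (using `lemma7Rhs ≥ 0`). [folklore] -/
theorem lemma7_common {a : ℤ} {η C₇a C₇b : ℝ}
    (h7a : ∀ m : ℕ, 0 < m → ∀ C D K H N' : ℝ, 1 ≤ C → 1 ≤ D → 1 ≤ K → 1 ≤ H → 1 ≤ N' →
      ∀ (bb : ℕ → ℝ) (β' : ℕ → ℕ → ℂ), (∀ h n, ‖β' h n‖ ≤ |bb n|) →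
        dispBm a m C D K H N' β' ≤ C₇a * lemma7Rhs C D K H N' η
          (∑ n ∈ Icc 1 ⌊N'⌋₊, bb n ^ 2) (∑ n ∈ Icc 1 ⌊N'⌋₊, (rho n : ℝ) * bb n ^ 4))
    (h7b : ∀ m : ℕ, 0 < m → ∀ C D K H N' : ℝ, 1 ≤ C → 1 ≤ D → 1 ≤ K → 1 ≤ H → 1 ≤ N' →
      ∀ (bb : ℕ → ℝ) (β' : ℕ → ℕ → ℂ), (∀ h n, ‖β' h n‖ ≤ |bb n|) →
        dispBm (-a) m C D K H N' β' ≤ C₇b * lemma7Rhs C D K H N' η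
          (∑ n ∈ Icc 1 ⌊N'⌋₊, bb n ^ 2) (∑ n ∈ Icc 1 ⌊N'⌋₊, (rho n : ℝ) * bb n ^ 4)) :
    ∀ a' : ℤ, (a' = a ∨ a' = -a) → ∀ m : ℕ, 0 < m → ∀ C D K H N' : ℝ,
      1 ≤ C → 1 ≤ D → 1 ≤ K → 1 ≤ H → 1 ≤ N' → ∀ (bb : ℕ → ℝ) (β' : ℕ → ℕ → ℂ),
        (∀ h n, ‖β' h n‖ ≤ |bb n|) →
          dispBm a' m C D K H N' β' ≤ max (max C₇a C₇b) 0 * lemma7Rhs C D K H N' η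
            (∑ n ∈ Icc 1 ⌊N'⌋₊, bb n ^ 2) (∑ n ∈ Icc 1 ⌊N'⌋₊, (rho n : ℝ) * bb n ^ 4) := by
  intro a' ha' m hm C D K H N' hC1 hD1 hK1 hH1 hN'1 bb β' hβ'
  have hS4 : 0 ≤ ∑ n ∈ Icc 1 ⌊N'⌋₊, (rho n : ℝ) * bb n ^ 4 := Finset.sum_nonneg fun n _ => by positivity
  have hS2 : 0 ≤ ∑ n ∈ Icc 1 ⌊N'⌋₊, bb n ^ 2 := Finset.sum_nonneg fun n _ => by positivity
  have hC0 : 0 < C := by linarith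
  have hD0 : 0 < D := by linarith
  have hK0 : 0 < K := by linarith
  have hH0 : 0 < H := by linarith
  have hN'0 : 0 < N' := by linarith
  have hL0 : 0 ≤ lemma7Rhs C D K H N' η (∑ n ∈ Icc 1 ⌊N'⌋₊, bb n ^ 2)
      (∑ n ∈ Icc 1 ⌊N'⌋₊, (rho n : ℝ) * bb n ^ 4) := by
    unfold lemma7Rhs; positivity
  rcases ha' with rfl | rfl
  · exact (h7a m hm C D K H N' hC1 hD1 hK1 hH1 hN'1 bb β' hβ').trans
      (mul_le_mul_of_nonneg_right ((le_max_left _ _).trans (le_max_left _ _)) hL0)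
  · exact (h7b m hm C D K H N' hC1 hD1 hK1 hH1 hN'1 bb β' hβ').trans
      (mul_le_mul_of_nonneg_right ((le_max_right _ _).trans (le_max_left _ _)) hL0)

/-- Lemma 3 with monotone constants: exponent `max B 1` (or `max B 0`) and constant `max C 0`, for
`X ≥ max X₀ 3`. [folklore] -/
theorem lemma3_mono {a : ℤ} {A B C X₀ ε B' : ℝ} (hBB' : B ≤ B')
    (hL : ∀ x : ℝ, X₀ ≤ x → ∀ k : ℕ, 1 ≤ k → (k : ℝ) ≤ x ^ (1 - ε) → ∀ l : ZMod k,
      ∑ m ∈ (Finset.Icc 1 ⌊x⌋₊).filter (fun m : ℕ => |a| < (m : ℤ) ∧ (m : ZMod k) = l),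
          (σ 0 m : ℝ) ^ A * (σ 0 ((m : ℤ) - a).toNat : ℝ) ^ A ≤ C * (x / k) * ((σ 0 k : ℝ) * Real.log x) ^ B) :
    ∀ X : ℝ, max X₀ 3 ≤ X → ∀ k : ℕ, 0 < k → (k : ℝ) ≤ X ^ (1 - ε) → ∀ l : ZMod k,
      ∑ v ∈ l3Set a X k l, l3Term a A v ≤ max C 0 * (X / k) * ((σ 0 k : ℝ) * Real.log X) ^ B' := by
  intro X hX k hk hkX l
  have hX3 : 3 ≤ X := (le_max_right _ _).trans hX
  have hX0 : 0 < X := by linarith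
  have hlog : 1 ≤ Real.log X := by
    rw [Real.le_log_iff_exp_le hX0]; have := Real.exp_one_lt_d9; linarith
  have hlX : 0 ≤ Real.log X := by linarith
  have h := hL X ((le_max_left _ _).trans hX) k hk hkX l
  have ht : 1 ≤ (σ 0 k : ℝ) * Real.log X := by
    have h1 : (1 : ℝ) ≤ (σ 0 k : ℝ) := by exact_mod_cast one_le_sigma_zero hk.ne'
    nlinarith
  calc ∑ v ∈ l3Set a X k l, l3Term a A v ≤ C * (X / k) * ((σ 0 k : ℝ) * Real.log X) ^ B := h
    _ ≤ max C 0 * (X / k) * ((σ 0 k : ℝ) * Real.log X) ^ B :=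
        mul_le_mul_of_nonneg_right (mul_le_mul_of_nonneg_right (le_max_left _ _) (by positivity))
          (Real.rpow_nonneg (by positivity) _)
    _ ≤ max C 0 * (X / k) * ((σ 0 k : ℝ) * Real.log X) ^ B' :=
        mul_le_mul_of_nonneg_left (Real.rpow_le_rpow_of_exponent_le ht hBB') (by positivity)

/-- Theorem 0 (a) in the shape `hBDH` of `BFI.e6_le`. [folklore] -/
theorem bdh_input {N B A' C₀ : ℝ} {β : ℕ → ℝ} {Csw : ℝ → ℝ} {L : ℝ} (hN : 0 < N) (hlog : 0 < Real.log N)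
    (h0a : ∀ d : ℕ, 1 ≤ d → ∀ Q : ℝ, Q ≤ N / Real.log N ^ (2 * A' + 4) →
        ∑ q ∈ Icc 1 ⌊Q⌋₊, ∑ l ∈ (range q).filter (fun l => l.Coprime q),
          ((∑ n ∈ dyadic N, if (n : ZMod q) = (l : ZMod q) ∧ n.Coprime d then β n else 0) -
            (∑ n ∈ dyadic N, if n.Coprime (d * q) then β n else 0) / (Nat.totient q : ℝ)) ^ 2 ≤
          C₀ * (σ 0 d : ℝ) ^ B * l2Sq N β * N / Real.log N ^ A')
    (hL : L ≤ N / Real.log N ^ (2 * A' + 4)) (_hCsw : Csw = Csw) :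
    ∀ d : ℕ, 1 ≤ d → ∑ q ∈ Icc 1 ⌊L⌋₊, bdhD N β d q ≤
      (max C₀ 0 * l2Sq N β * N / Real.log N ^ A') * (σ 0 d : ℝ) ^ ⌈B⌉₊ := by
  intro d hd
  have h := h0a d hd L hL
  have hτ : (σ 0 d : ℝ) ^ B ≤ (σ 0 d : ℝ) ^ ⌈B⌉₊ := rpow_sigma_le_pow_ceil (by omega) B
  have hl0 : 0 < Real.log N ^ A' := Real.rpow_pos_of_pos hlog _
  calc ∑ q ∈ Icc 1 ⌊L⌋₊, bdhD N β d q
      = ∑ q ∈ Icc 1 ⌊L⌋₊, ∑ l ∈ (range q).filter (fun l => l.Coprime q),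
        ((∑ n ∈ dyadic N, if (n : ZMod q) = (l : ZMod q) ∧ n.Coprime d then β n else 0) -
          (∑ n ∈ dyadic N, if n.Coprime (d * q) then β n else 0) / (Nat.totient q : ℝ)) ^ 2 := rfl
    _ ≤ C₀ * (σ 0 d : ℝ) ^ B * l2Sq N β * N / Real.log N ^ A' := h
    _ ≤ max C₀ 0 * (σ 0 d : ℝ) ^ ⌈B⌉₊ * l2Sq N β * N / Real.log N ^ A' := by
        rw [div_le_div_iff_of_pos_right hl0]
        refine mul_le_mul_of_nonneg_right (mul_le_mul_of_nonneg_right ?_ (l2Sq_nonneg N β)) hN.le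
        exact mul_le_mul (le_max_left _ _) hτ (Real.rpow_nonneg (Nat.cast_nonneg _) _) (le_max_right _ _)
    _ = _ := by ring

/-- The `W`-saving in the shape `hWa`: if `G ≤ (log N)^{A'}` then `G · W ≤ S₂ N` for
`W = C₀' S₂ N/(log N)^{A'}`. [folklore] -/
theorem w_saving {G C₀' S₂ N A' lN : ℝ} (hlN : 0 < lN) (hS : 0 ≤ S₂ * N) (hG : C₀' * G ≤ lN ^ A') :
    G * (C₀' * S₂ * N / lN ^ A') ≤ S₂ * N := by
  have hl0 : 0 < lN ^ A' := Real.rpow_pos_of_pos hlN _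
  calc G * (C₀' * S₂ * N / lN ^ A') = (C₀' * G) / lN ^ A' * (S₂ * N) := by field_simp
    _ ≤ 1 * (S₂ * N) := by
        refine mul_le_mul_of_nonneg_right ?_ hS
        rw [div_le_one hl0]; exact hG
    _ = S₂ * N := one_mul _

/-- `√D_τ ≤ √(C_δ 8^η + 1) x^{η}` for `D_τ = ⌈C_δ (4NQ)^η⌉`, `N ≤ x`, `Q ≤ 2x`. [folklore] -/
theorem sqrt_Dtau_le {x N Q Cδ η : ℝ} (hx : 1 ≤ x) (hN0 : 0 ≤ N) (hNx : N ≤ x) (hQ0 : 0 ≤ Q) (hQx : Q ≤ 2 * x)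
    (hCδ : 0 ≤ Cδ) (hη : 0 < η) :
    Real.sqrt ((⌈Cδ * (4 * N * Q) ^ η⌉₊ : ℕ) : ℝ) ≤ Real.sqrt (Cδ * 8 ^ η + 1) * x ^ η := by
  have hx0 : 0 < x := by linarith
  have h1 : ((⌈Cδ * (4 * N * Q) ^ η⌉₊ : ℕ) : ℝ) ≤ (Cδ * 8 ^ η + 1) * x ^ (2 * η) := by
    have hlt : ((⌈Cδ * (4 * N * Q) ^ η⌉₊ : ℕ) : ℝ) < Cδ * (4 * N * Q) ^ η + 1 := Nat.ceil_lt_add_one (by positivity)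
    have h2 : (4 * N * Q) ^ η ≤ 8 ^ η * x ^ (2 * η) := by
      calc (4 * N * Q) ^ η ≤ (8 * x ^ 2) ^ η :=
            Real.rpow_le_rpow (by positivity) (by nlinarith [mul_le_mul hNx hQx hQ0 hx0.le]) hη.le
        _ = 8 ^ η * x ^ (2 * η) := by
            rw [Real.mul_rpow (by norm_num) (by positivity), show x ^ 2 = x ^ (2:ℝ) by
              rw [← Real.rpow_natCast]; norm_num, ← Real.rpow_mul hx0.le]
    have h3 : 1 ≤ x ^ (2 * η) := Real.one_le_rpow hx (by positivity)
    nlinarith [mul_le_mul_of_nonneg_left h2 hCδ]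
  calc Real.sqrt ((⌈Cδ * (4 * N * Q) ^ η⌉₊ : ℕ) : ℝ) ≤ Real.sqrt ((Cδ * 8 ^ η + 1) * x ^ (2 * η)) :=
        Real.sqrt_le_sqrt h1
    _ = Real.sqrt (Cδ * 8 ^ η + 1) * x ^ η := by
        rw [Real.sqrt_mul (by positivity), show x ^ (2 * η) = (x ^ η) ^ 2 by
          rw [← Real.rpow_natCast, ← Real.rpow_mul hx0.le]; ring_nf, Real.sqrt_sq (Real.rpow_nonneg hx0.le _)]

/-- `√(C₇ P^η) ≤ √(C₇ 512^η) x^{3η}` for `P = 4NQ·2Q·(N/R)·H·2N` with `N ≤ x, Q ≤ 2x, N/R ≤ 2x, H ≤ 2x`.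
[folklore] -/
theorem sqrt_Peta_le {x N Q R H C₇ η : ℝ} (hx : 1 ≤ x) (hN0 : 0 ≤ N) (hNx : N ≤ x) (hQ0 : 0 ≤ Q)
    (hQx : Q ≤ 2 * x) (hR0 : 0 < R) (hNR : N / R ≤ 2 * x) (hH0 : 0 ≤ H) (hHx : H ≤ 2 * x) (hC₇ : 0 ≤ C₇)
    (hη : 0 < η) :
    Real.sqrt (C₇ * (4 * N * Q * (2 * Q) * (N / R) * H * (2 * N)) ^ η) ≤ Real.sqrt (C₇ * 512 ^ η) * x ^ (3 * η) := by
  have hx0 : 0 < x := by linarith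
  have hNR0 : 0 ≤ N / R := by positivity
  have h1 : 4 * N * Q * (2 * Q) * (N / R) * H * (2 * N) ≤ 512 * x ^ 6 := by
    calc 4 * N * Q * (2 * Q) * (N / R) * H * (2 * N)
        ≤ 4 * x * (2 * x) * (2 * (2 * x)) * (2 * x) * (2 * x) * (2 * x) := by gcongr
      _ = 256 * x ^ 6 := by ring
      _ ≤ 512 * x ^ 6 := by nlinarith [pow_nonneg hx0.le 6]
  have h2 : (4 * N * Q * (2 * Q) * (N / R) * H * (2 * N)) ^ η ≤ 512 ^ η * x ^ (6 * η) := by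
    calc _ ≤ (512 * x ^ 6) ^ η := Real.rpow_le_rpow (by positivity) h1 hη.le
      _ = 512 ^ η * x ^ (6 * η) := by
          rw [Real.mul_rpow (by norm_num) (by positivity), show x ^ 6 = x ^ (6:ℝ) by
            rw [← Real.rpow_natCast]; norm_num, ← Real.rpow_mul hx0.le]
  calc Real.sqrt (C₇ * (4 * N * Q * (2 * Q) * (N / R) * H * (2 * N)) ^ η)
      ≤ Real.sqrt (C₇ * (512 ^ η * x ^ (6 * η))) := Real.sqrt_le_sqrt (mul_le_mul_of_nonneg_left h2 hC₇)
    _ = Real.sqrt (C₇ * 512 ^ η) * x ^ (3 * η) := by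
        rw [← mul_assoc, Real.sqrt_mul (by positivity), show x ^ (6 * η) = (x ^ (3 * η)) ^ 2 by
          rw [← Real.rpow_natCast, ← Real.rpow_mul hx0.le]; ring_nf, Real.sqrt_sq (Real.rpow_nonneg hx0.le _)]

/-- The last factor of (9.21): `√8 + 2√(48 √(D C₅) N^{ε₀/2}) ≤ c x^{η/4+ε₀/4}` with `D = C_δ(2N)^η`.
[folklore] -/
theorem last_factor_le {x N Cδ C₅ η ε₀ : ℝ} (hx : 1 ≤ x) (hN0 : 0 < N) (hNx : N ≤ x) (hCδ : 0 ≤ Cδ)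
    (hC₅ : 0 ≤ C₅) (hη : 0 < η) (hε₀ : 0 < ε₀) :
    Real.sqrt 8 + 2 * Real.sqrt (48 * Real.sqrt (Cδ * (2 * N) ^ η * C₅) * N ^ (ε₀ / 2)) ≤
      (Real.sqrt 8 + 2 * Real.sqrt (48 * Real.sqrt (Cδ * 2 ^ η * C₅))) * x ^ (η / 4 + ε₀ / 4) := by
  have hx0 : 0 < x := by linarith
  have hxp : ∀ p : ℝ, 0 < x ^ p := fun p => Real.rpow_pos_of_pos hx0 p
  have hx4 : 1 ≤ x ^ (η / 4 + ε₀ / 4) := Real.one_le_rpow hx (by positivity)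
  have hD1 : Cδ * (2 * N) ^ η * C₅ ≤ Cδ * 2 ^ η * C₅ * x ^ η := by
    have : (2 * N) ^ η ≤ 2 ^ η * x ^ η := by
      rw [← Real.mul_rpow (by norm_num) hx0.le]; exact Real.rpow_le_rpow (by positivity) (by linarith) hη.le
    calc Cδ * (2 * N) ^ η * C₅ ≤ Cδ * (2 ^ η * x ^ η) * C₅ := by gcongr
      _ = _ := by ring
  have hD2 : Real.sqrt (Cδ * (2 * N) ^ η * C₅) ≤ Real.sqrt (Cδ * 2 ^ η * C₅) * x ^ (η / 2) := by
    calc Real.sqrt (Cδ * (2 * N) ^ η * C₅) ≤ Real.sqrt (Cδ * 2 ^ η * C₅ * x ^ η) := Real.sqrt_le_sqrt hD1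
      _ = _ := by
          rw [Real.sqrt_mul (by positivity), show x ^ η = (x ^ (η / 2)) ^ 2 by
            rw [← Real.rpow_natCast, ← Real.rpow_mul hx0.le]; ring_nf, Real.sqrt_sq (hxp _).le]
  have hN2' : N ^ (ε₀ / 2) ≤ x ^ (ε₀ / 2) := Real.rpow_le_rpow hN0.le hNx (by positivity)
  have hD3 : 48 * Real.sqrt (Cδ * (2 * N) ^ η * C₅) * N ^ (ε₀ / 2) ≤
      48 * Real.sqrt (Cδ * 2 ^ η * C₅) * x ^ (2 * (η / 4 + ε₀ / 4)) := by
    calc 48 * Real.sqrt (Cδ * (2 * N) ^ η * C₅) * N ^ (ε₀ / 2)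
        ≤ 48 * (Real.sqrt (Cδ * 2 ^ η * C₅) * x ^ (η / 2)) * x ^ (ε₀ / 2) := by gcongr
      _ = 48 * Real.sqrt (Cδ * 2 ^ η * C₅) * (x ^ (η / 2) * x ^ (ε₀ / 2)) := by ring
      _ = _ := by rw [← Real.rpow_add hx0]; ring_nf
  have hD4 : Real.sqrt (48 * Real.sqrt (Cδ * (2 * N) ^ η * C₅) * N ^ (ε₀ / 2)) ≤
      Real.sqrt (48 * Real.sqrt (Cδ * 2 ^ η * C₅)) * x ^ (η / 4 + ε₀ / 4) := by
    calc _ ≤ Real.sqrt (48 * Real.sqrt (Cδ * 2 ^ η * C₅) * x ^ (2 * (η / 4 + ε₀ / 4))) := Real.sqrt_le_sqrt hD3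
      _ = _ := by
          rw [Real.sqrt_mul (by positivity), show x ^ (2 * (η / 4 + ε₀ / 4)) = (x ^ (η / 4 + ε₀ / 4)) ^ 2 by
            rw [← Real.rpow_natCast, ← Real.rpow_mul hx0.le]; ring_nf, Real.sqrt_sq (hxp _).le]
  calc Real.sqrt 8 + 2 * Real.sqrt (48 * Real.sqrt (Cδ * (2 * N) ^ η * C₅) * N ^ (ε₀ / 2))
      ≤ Real.sqrt 8 * x ^ (η / 4 + ε₀ / 4) +
        2 * (Real.sqrt (48 * Real.sqrt (Cδ * 2 ^ η * C₅)) * x ^ (η / 4 + ε₀ / 4)) := by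
        gcongr
        exact le_mul_of_one_le_right (Real.sqrt_nonneg _) hx4
    _ = _ := by ring

/-- (A5) with a nonnegative constant. [folklore] -/
theorem a5_conv {N ε₀ C₅ S : ℝ} {β : ℕ → ℝ} (hN : 0 < N)
    (hA5 : N ^ (1 - ε₀) * ∑ n ∈ dyadic N, β n ^ 4 ≤ C₅ * S ^ 2) :
    ∑ n ∈ dyadic N, β n ^ 4 ≤ max C₅ 0 * N ^ (ε₀ - 1) * S ^ 2 := by
  have h1 : N ^ (1 - ε₀) * ∑ n ∈ dyadic N, β n ^ 4 ≤ max C₅ 0 * S ^ 2 :=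
    hA5.trans (mul_le_mul_of_nonneg_right (le_max_left _ _) (sq_nonneg _))
  have e : N ^ (ε₀ - 1) * N ^ (1 - ε₀) = 1 := by
    rw [← Real.rpow_add hN]; ring_nf; simp
  calc ∑ n ∈ dyadic N, β n ^ 4 = N ^ (ε₀ - 1) * (N ^ (1 - ε₀) * ∑ n ∈ dyadic N, β n ^ 4) := by
        rw [← mul_assoc, e, one_mul]
    _ ≤ N ^ (ε₀ - 1) * (max C₅ 0 * S ^ 2) := mul_le_mul_of_nonneg_left h1 (Real.rpow_nonneg hN.le _)
    _ = _ := by ring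

/-- Divisor bounds in the shapes `hD`, `hDτ` of `BFI.e4_le`. [folklore] -/
theorem divisor_inputs {N Q Cδ η : ℝ} (hN : 0 < N) (hQ : 0 < Q) (hCδ : 0 ≤ Cδ) (hη : 0 < η)
    (hδ : ∀ n : ℕ, ((σ 0 n : ℕ) : ℝ) ≤ Cδ * (n : ℝ) ^ η) :
    (∀ n ∈ dyadic N, (n.divisors.card : ℝ) ≤ Cδ * (2 * N) ^ η) ∧
    (∀ c ∈ Icc 1 ⌊4 * N * Q⌋₊, c.divisors.card ≤ ⌈Cδ * (4 * N * Q) ^ η⌉₊) := by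
  refine ⟨fun n hn => ?_, fun c hc => ?_⟩
  · obtain ⟨-, hn2⟩ := (mem_dyadic hN.le).1 hn
    have h := hδ n
    rw [ArithmeticFunction.sigma_zero_apply] at h
    exact h.trans (mul_le_mul_of_nonneg_left (Real.rpow_le_rpow (Nat.cast_nonneg _) hn2 hη.le) hCδ)
  · have hc2 : (c : ℝ) ≤ 4 * N * Q := (Nat.le_floor_iff (by positivity)).1 (Finset.mem_Icc.1 hc).2
    have h := hδ c
    rw [ArithmeticFunction.sigma_zero_apply] at h
    have : (c.divisors.card : ℝ) ≤ ⌈Cδ * (4 * N * Q) ^ η⌉₊ :=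
      (h.trans (mul_le_mul_of_nonneg_left (Real.rpow_le_rpow (Nat.cast_nonneg _) hc2 hη.le) hCδ)).trans
        (Nat.le_ceil _)
    exact_mod_cast this

/-- Elementary facts about `M = x/N` in the range of Theorem 2. [folklore] -/
theorem m_facts {x M N ε₀ : ℝ} (hx : 1 ≤ x) (hMN : M * N = x) (hε₀ : 0 ≤ ε₀) (hN1 : x ^ ε₀ ≤ N)
    (hN2 : N ≤ x ^ (1 - ε₀)) : 1 ≤ N ∧ N ≤ x ∧ M ≤ x ∧ x ^ ε₀ ≤ M ∧ 1 ≤ M := by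
  have hx0 : 0 < x := by linarith
  have hxε : 1 ≤ x ^ ε₀ := Real.one_le_rpow hx hε₀
  have hN0 : 1 ≤ N := hxε.trans hN1
  have hN0' : 0 < N := by linarith
  have hNx : N ≤ x := hN2.trans ((Real.rpow_le_rpow_of_exponent_le hx (by linarith)).trans (le_of_eq (Real.rpow_one x)))
  have hMdef : M = x / N := by rw [← hMN]; field_simp
  have hMx : M ≤ x := by rw [hMdef]; exact div_le_self hx0.le hN0
  have hMε : x ^ ε₀ ≤ M := by
    rw [hMdef, le_div_iff₀ hN0']
    calc x ^ ε₀ * N ≤ x ^ ε₀ * x ^ (1 - ε₀) := by gcongr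
      _ = x := by rw [← Real.rpow_add hx0]; norm_num
  exact ⟨hN0, hNx, hMx, hMε, hxε.trans hMε⟩


/-! ## The core combination: skeleton + the eight bounds + the numerics -/

set_option maxHeartbeats 6000000 in
/-- **Theorem 2, core form**: for data satisfying the structural hypotheses of the eight
pre-asymptotic bounds (`BFI.e1_le` … `BFI.e8_le`, `BFI.e4_le`) with `Y = M/2`, `β' = μ²β`, and the
saving inequalities of the numerics (`BFI.e1_num` … `BFI.e8_num`), one has
`𝒢(M,N,Q,R) ≤ 8 ‖β‖² x R⁻¹ (log x)^{−A}`.  (All inputs explicit; the final theorem chooses the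
parameters and discharges them in the range of Theorem 2.)
[cite: BombieriFriedlanderIwaniecActa1986, §3 (3.3)–(3.5), §9 Theorem 2 p. 230] -/
theorem theorem2_core {a : ℤ} (ha : a ≠ 0) {x M N Q R Q₀ z A : ℝ} {β γ : ℕ → ℝ} {b : ℕ}
    -- basic ranges
    (hx : 32 ≤ x) (hMN : M * N = x) (hN : 1 ≤ N) (hNx : N ≤ x) (hMx : M ≤ x) (hM1 : 1 ≤ M)
    (haM : (|a| : ℝ) < M - M / 2) (hQ : 1 / 2 ≤ Q) (hQx : Q ≤ 2 * x) (hR : 1 / 2 ≤ R) (hRx : R ≤ 2 * x)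
    (hRN : R ≤ N) (hQ₀ : 1 ≤ Q₀) (hQ₀x : Q₀ ≤ x) (hz : 1 ≤ z)
    (hγ : ∀ q, |γ q| ≤ (σ 0 q : ℝ) ^ b) (hsift : IsSifted (dyadic N) z β)
    -- moments
    {Cm : ℕ → ℝ} {km : ℕ → ℕ} (hm : ∀ r, MomentHyp r (Cm r) (km r)) (hCm : ∀ r, 0 < Cm r)
    -- E8 / E7
    {ε₀ : ℝ} (hN2 : N ≤ x ^ (1 - ε₀)) (hQNR : Q * N * R ≤ 2 * x ^ (1 - ε₀))
    (hev8 : 3 * (8 + derivConst 2) * (4 * Cm (b + 2)) ^ 2 * (4 * Cm 3) * (2 : ℝ) ^ (2 * km (b + 2) + km 3) *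
      Real.log x ^ (2 * km (b + 2) + km 3) * Real.log x ^ A ≤ x ^ ε₀)
    (hev7 : 12 * (8 + derivConst 2) * (4 * Cm b) * (4 * Cm (b + 2)) * (4 * Cm 1) *
      (2 : ℝ) ^ (km b + km (b + 2) + km 1) * Real.log x ^ (km b + km (b + 2) + km 1) * Real.log x ^ A ≤ x ^ ε₀)
    (hS2u : 2 * ‖(dS2 a (mRange M (M / 2)) N Q R (fun m => bump M (M / 2) m) β γ : ℂ) -
        alphaHat M (M / 2) * (mainX a N Q R β γ : ℂ)‖ ≤
      2 * (2 * (M + 2 * (M / 2)) / (M / 2) + derivConst 2) * ((2 * N + 1) * l2Sq N β) *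
        ((4 * Cm b * Q * Real.log (4 * Q) ^ km b) * (4 * Cm (b + 2) * Real.log (4 * Q) ^ km (b + 2)) *
          (4 * Cm 1 * Real.log (4 * R) ^ km 1)))
    -- E5
    (hsave5 : 64 * Real.sqrt (8 * Cm 1 * Real.sqrt (32 * Cm 2)) * (Cm b) ^ 2 *
      (2 : ℝ) ^ (2 * km b + (km 1 + km 2)) * Q₀ * Real.log x ^ (2 * km b + (km 1 + km 2)) * Real.log x ^ A ≤
      Real.sqrt (Real.sqrt z))
    -- Lemma 3 (two instances) and E2/E1 data
    {C₃ B₃ X₀ ε₃ C₄ B₄ X₀' ε₃' P₀ T lg ω₀ : ℝ} (hC₃ : 0 ≤ C₃) (hB₃ : 0 ≤ B₃) (hC₄ : 0 ≤ C₄)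
    (hB₄ : 0 ≤ B₄) (hP₀ : 0 < P₀) (hT : 0 ≤ T) (hω₀0 : 0 ≤ ω₀) (hlg0 : 0 ≤ lg)
    (hlgΛ : lg ≤ 2 * Real.log x) (hω₀Λ : ω₀ ≤ 4 * Real.log x)
    (hL3 : ∀ X : ℝ, X₀ ≤ X → ∀ k : ℕ, 0 < k → (k : ℝ) ≤ X ^ (1 - ε₃) → ∀ l : ZMod k,
      ∑ v ∈ l3Set a X k l, l3Term a ((b : ℝ) + 1) v ≤ C₃ * (X / k) * ((σ 0 k : ℝ) * Real.log X) ^ B₃)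
    (hL3' : ∀ X : ℝ, X₀' ≤ X → ∀ k : ℕ, 0 < k → (k : ℝ) ≤ X ^ (1 - ε₃') → ∀ l : ZMod k,
      ∑ v ∈ l3Set a X k l, l3Term a B₃ v ≤ C₄ * (X / k) * ((σ 0 k : ℝ) * Real.log X) ^ B₄)
    (hX₀ : X₀ ≤ 2 * (M - M / 2) * N) (hX₀' : X₀' ≤ 2 * M + M / 2)
    (hlev2 : ∀ q₁ ∈ dyadic Q, ∀ r ∈ dyadic R, ∀ n ∈ dyadic N,
      ((q₁ * r * n : ℕ) : ℝ) ≤ ((2 * M + M / 2) * n) ^ (1 - ε₃))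
    (hlgn : ∀ n ∈ dyadic N, 0 ≤ Real.log ((2 * M + M / 2) * n) ∧ Real.log ((2 * M + M / 2) * n) ≤ lg)
    (hlev : ∀ m : ℕ, M - M / 2 < (m : ℝ) → (m : ℝ) ≤ 2 * M + M / 2 → ∀ t : ℕ, (t : ℝ) ≤ 2 * P₀ * R →
      ((m * t : ℕ) : ℝ) ≤ (2 * m * N) ^ (1 - ε₃))
    (hlev' : ∀ k : ℕ, (k : ℝ) ≤ 4 * Q * R → (k : ℝ) ≤ (2 * M + M / 2) ^ (1 - ε₃'))
    (hTv : ∀ m : ℕ, (m : ℝ) ≤ 2 * M + M / 2 → ∀ n ∈ dyadic N,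
      (σ 0 (((m * n : ℕ) : ℤ) - a).toNat : ℝ) ^ ((b : ℝ) + 1) ≤ T)
    (hlgm : ∀ m : ℕ, M - M / 2 < (m : ℝ) → (m : ℝ) ≤ 2 * M + M / 2 →
      0 ≤ Real.log (2 * m * N) ∧ Real.log (2 * m * N) ≤ lg)
    (hω : ∀ n ∈ dyadic N, (n.primeFactors.card : ℝ) ≤ ω₀)
    (hsave2 : 5 * C₃ * (2 : ℝ) ^ B₃ * Real.log x ^ B₃ *
      (4 * Cm (b + ⌈B₃⌉₊) * (2 : ℝ) ^ km (b + ⌈B₃⌉₊) * Real.log x ^ km (b + ⌈B₃⌉₊)) *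
      Real.sqrt (6 * (Cm (2 * ⌈B₃⌉₊) + Cm (2 * ⌈B₃⌉₊ + 2)) *
        Real.sqrt (4 * (6 * (Cm (4 * ⌈B₃⌉₊) + Cm (4 * ⌈B₃⌉₊ + 4))))) *
        ((2 : ℝ) ^ (km (4 * ⌈B₃⌉₊) + km (4 * ⌈B₃⌉₊ + 4) + (km (2 * ⌈B₃⌉₊) + km (2 * ⌈B₃⌉₊ + 2))) *
          Real.log x ^ (km (4 * ⌈B₃⌉₊) + km (4 * ⌈B₃⌉₊ + 4) + (km (2 * ⌈B₃⌉₊) + km (2 * ⌈B₃⌉₊ + 2)))) *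
        Real.log x ^ A ≤ Real.sqrt (Real.sqrt z))
    (hz1 : 1280 * C₃ * C₄ * (2 : ℝ) ^ B₃ * (2 * Real.log x) ^ B₃ * (2 * Real.log x) ^ B₄ *
      Cm (b + ⌈B₄⌉₊) * Cm (⌈B₃⌉₊ + ⌈B₄⌉₊) *
      (2 * Real.log x) ^ (km (b + ⌈B₄⌉₊) + km (⌈B₃⌉₊ + ⌈B₄⌉₊)) * Real.log x * Real.log x ^ A ≤ z)
    (hQ₀1 : 320 * C₃ * C₄ * (2 * Real.log x) ^ B₃ * (2 * Real.log x) ^ B₄ * Cm (b + 1 + ⌈B₃⌉₊ + ⌈B₄⌉₊) *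
      Cm (⌈B₃⌉₊ + ⌈B₄⌉₊) * (2 * Real.log x) ^ (km (b + 1 + ⌈B₃⌉₊ + ⌈B₄⌉₊) + km (⌈B₃⌉₊ + ⌈B₄⌉₊)) *
      Real.log x ^ A ≤ Q₀)
    (h3a : 320 * (T * (4 * Real.log x + 1) * (4 * Cm (b + 1) * (2 * Real.log x) ^ km (b + 1))) *
      Real.log x ^ A ≤ P₀)
    (h3b : 128 * (T * (4 * Real.log x + 1) * (4 * Cm (b + 1) * (2 * Real.log x) ^ km (b + 1))) *
      Real.log x ^ A * (Q * N * R) ≤ x * P₀)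
    (h3c : 160 * (T * (4 * Real.log x + 1) * (4 * Cm (b + 1) * (2 * Real.log x) ^ km (b + 1))) *
      Real.log x ^ A * R ≤ N)
    (h3d : 64 * (T * (4 * Real.log x + 1) * (4 * Cm (b + 1) * (2 * Real.log x) ^ km (b + 1))) *
      Real.log x ^ A * (Q * R ^ 2) ≤ x)
    -- E6 (BDH)
    {W : ℝ} (hW : 0 ≤ W)
    (hBDH : ∀ d : ℕ, 1 ≤ d → ∑ q ∈ Icc 1 ⌊2 * Q₀ * R⌋₊, bdhD N β d q ≤ W * (σ 0 d : ℝ) ^ b)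
    (hWa : 128 * W * Q₀ * (Cm (2 * b)) ^ 2 * (2 * Real.log x) ^ (2 * km (2 * b)) * Real.log x ^ A ≤ l2Sq N β * N)
    (hzb : 2048 * (Cm b) ^ 2 * (2 * Real.log x) ^ (2 * km b + 1) * Real.log x ^ A ≤ z)
    (hRN6 : 1024 * (Cm b) ^ 2 * (2 * Real.log x) ^ (2 * km b + 1) * Q₀ * Real.log x ^ A * R ≤ N)
    (hQ₀c : 12288 * Cm 1 * (Cm b) ^ 2 * Cm (2 * b + 1) * (2 * Real.log x) ^ (km 1 + 2 * km b + km (2 * b + 1)) *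
      Real.log x ^ A ≤ Q₀)
    -- E3 (Poisson tails / phase)
    {Hn j : ℕ} {θ ε₁ : ℝ} (hj : 2 ≤ j) (hθ0 : 0 ≤ θ)
    (hθ : 8 * Q ^ 2 * R / (2 * π * (M / 2) * ((Hn : ℝ) + 1)) ≤ θ)
    (hHle : (Hn : ℝ) ≤ 16 * x ^ ε₁ * Q ^ 2 * R / M)
    (htail : 3072 * derivConst j * (Cm b) ^ 2 * (2 * Real.log x) ^ (2 * km b) * Q₀ * Real.log x ^ A * R *
      ((Hn : ℝ) + 1) * θ ^ j ≤ 1)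
    (hphase : 786432 * π * |(a : ℝ)| * (Cm b) ^ 2 * (2 * Real.log x) ^ (2 * km b) * Q₀ ^ 2 * Real.log x ^ A *
      x ^ (2 * ε₁) * (Q ^ 2 * R ^ 2 * N) ≤ x ^ 2)
    -- E4 (ℛ₁ via Lemma 7)
    {η C₇ D C₅ ε₅ Pη : ℝ} {Dτ : ℕ}
    (h7 : ∀ a' : ℤ, (a' = a ∨ a' = -a) → ∀ m : ℕ, 0 < m → ∀ C D' K H N' : ℝ,
      1 ≤ C → 1 ≤ D' → 1 ≤ K → 1 ≤ H → 1 ≤ N' → ∀ (bb : ℕ → ℝ) (β' : ℕ → ℕ → ℂ),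
        (∀ h n, ‖β' h n‖ ≤ |bb n|) →
          dispBm a' m C D' K H N' β' ≤ C₇ * lemma7Rhs C D' K H N' η
            (∑ n ∈ Icc 1 ⌊N'⌋₊, bb n ^ 2) (∑ n ∈ Icc 1 ⌊N'⌋₊, (rho n : ℝ) * bb n ^ 4))
    (hC₇ : 0 ≤ C₇) (hD : ∀ n ∈ dyadic N, (n.divisors.card : ℝ) ≤ D) (hD0 : 0 ≤ D) (hC₅ : 0 ≤ C₅)
    (hDτ : ∀ c ∈ Icc 1 ⌊4 * N * Q⌋₊, c.divisors.card ≤ Dτ)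
    (hA5 : ∑ n ∈ dyadic N, β n ^ 4 ≤ C₅ * N ^ (ε₅ - 1) * l2Sq N β ^ 2)
    (hPη : (4 * N * Q * (2 * Q) * (N / R) * (Hn : ℝ) * (2 * N)) ^ η = Pη)
    (hHK : (Hn : ℝ) * (N / R) ≤ N)
    (hr1 : N * Q / Real.sqrt R ≤ x ^ (1 / 2 - ε₀)) (hr2 : Real.sqrt (N ^ (5 / 2 : ℝ) * Q) ≤ x ^ (1 / 2 - ε₀))
    (hr3 : Real.sqrt (N ^ 2 * Q ^ (3 / 2 : ℝ)) ≤ x ^ (1 / 2 - ε₀))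
    (hbig : (4 * Q₀ * (a.natAbs.divisors.card : ℝ) * (2 * (2 * Real.log x) + 1) * (3 * Q₀) *
        (2 * Real.sqrt (32 * derivConst 2)) * (2 + 3 * Real.log x) * (4 * Cm (2 * b) * Real.log (4 * Q) ^ km (2 * b)) *
        Real.sqrt (Dτ : ℝ) * Real.sqrt (C₇ * Pη) * (4 * x ^ (ε₁ / 2)) *
        (Real.sqrt 8 + 2 * Real.sqrt (48 * Real.sqrt (D * C₅) * N ^ (ε₅ / 2)))) * Real.log x ^ A ≤ x ^ ε₀) :
    dispG a M N Q R β γ ≤ 8 * (l2Sq N β * x * R⁻¹ / Real.log x ^ A) := by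
  have hx16 : 16 ≤ x := by linarith
  have hx0 : 0 < x := by linarith
  have hN0 : 0 ≤ N := by linarith
  have hN0' : 0 < N := by linarith
  have hM0 : 0 < M := by linarith
  have hY : 0 < M / 2 := by positivity
  have hYM : M / 2 ≤ M := by linarith
  have hQ0 : 0 < Q := by linarith
  have hR0 : 0 < R := by linarith
  have hQ₀0 : 0 < Q₀ := by linarith
  have hz0 : 0 < z := by linarith
  have hl2 := l2Sq_nonneg N β
  set S₂ := l2Sq N β with hS₂
  set β' := sqfPart β with hβ'
  -- the skeleton
  have hsk := dispG_le_errors a hY hYM N Q R Q₀ β β' γ Hn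
  -- `M + 2Y = 2M`, `(2(M+2Y)/Y + K₂) = 8 + K₂`
  have hK : 2 * (M + 2 * (M / 2)) / (M / 2) + derivConst 2 = 8 + derivConst 2 := by
    field_simp; ring
  -- E8
  have E8 : ‖(dS3 a (mRange M (M / 2)) N Q R (fun m => bump M (M / 2) m) β γ : ℂ) -
      alphaHat M (M / 2) * (mainX a N Q R β γ : ℂ)‖ ≤ S₂ * x * R⁻¹ / Real.log x ^ A := by
    have h := e8_le hY hYM a hN0 hQ hR β hγ (hm (b + 2)) (hm 3)
    rw [hK] at h
    exact h.trans (e8_num hx16 hN hN2 hQ hQx hR hRx hl2 (hCm _).le (hCm _).le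
      (by have := one_le_derivConst 2; linarith) hev8)
  -- E7
  have E7 : 2 * ‖(dS2 a (mRange M (M / 2)) N Q R (fun m => bump M (M / 2) m) β γ : ℂ) -
      alphaHat M (M / 2) * (mainX a N Q R β γ : ℂ)‖ ≤ S₂ * x * R⁻¹ / Real.log x ^ A := by
    rw [hK] at hS2u
    exact hS2u.trans (e7_num hx16 hN hQ hQx hR hRx hQNR hl2 (hCm _).le (hCm _).le (hCm _).le
      (by have := one_le_derivConst 2; linarith) hev7)
  -- E5
  have E5 : ‖alphaHat M (M / 2)‖ * |calX a N Q R Q₀ β γ - calX a N Q R Q₀ β' γ| ≤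
      S₂ * x * R⁻¹ / Real.log x ^ A := by
    have h := e5_le hY hYM a (by linarith : 1 / 2 ≤ N) hQ hR0 hQ₀0 hz hγ hsift (hm b) (hm 1) (hm 2)
      (hCm 1).le (hCm 2).le (Q₀ := Q₀)
    refine h.trans (e5_num hx16 hMN hN hNx hQ hQx hR0 hQ₀0.le hl2 (Real.sqrt_nonneg _) hz0 hsave5)
  -- E2
  have E2 : |dS1c a (mRange M (M / 2)) N Q R Q₀ (fun m => bump M (M / 2) m) β γ -
      dS1c a (mRange M (M / 2)) N Q R Q₀ (fun m => bump M (M / 2) m) β' γ| ≤ S₂ * x * R⁻¹ / Real.log x ^ A := by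
    have h := e2_le hY hYM haM hN hQ hR0 hz hγ hsift hC₃ hB₃ hlg0 hL3 (by linarith [hX₀]) hlev2 hlgn
      (hm (b + ⌈B₃⌉₊)) (hm (2 * ⌈B₃⌉₊)) (hm (2 * ⌈B₃⌉₊ + 2)) (hm (4 * ⌈B₃⌉₊)) (hm (4 * ⌈B₃⌉₊ + 4))
      (hCm _) (hCm _).le (hCm _) (hCm _).le (Q₀ := Q₀)
    refine h.trans ?_
    exact e2_num hx16 hMN hN hNx hQ hQx hR0 hl2 hz0 hlg0 hlgΛ hC₃ hB₃ (hCm (b + ⌈B₃⌉₊)).le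
      (hCm (2 * ⌈B₃⌉₊)) (hCm (2 * ⌈B₃⌉₊ + 2)).le (hCm (4 * ⌈B₃⌉₊)) (hCm (4 * ⌈B₃⌉₊ + 4)).le hsave2
      (A := A)
  -- E6
  have E6 : ‖alphaHat M (M / 2)‖ * |calX a N Q R Q₀ β γ - mainX a N Q R β γ| ≤
      S₂ * x * R⁻¹ / Real.log x ^ A := by
    have h := e6_le hY hYM a (by linarith : 1 / 2 ≤ N) hQ hR hQ₀ hz hW hγ hsift hBDH (hm (2 * b)) (hm b)
      (hm 1) (hm (2 * b + 1)) (hCm 1).le (hCm b).le (hCm _).le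
    refine h.trans (e6_num hx hMN hN hNx hQ hQx hR hRx hl2 hz0 hQ₀0 hW (hCm _).le (hCm _).le (hCm _).le
      (hCm _).le hWa hzb hRN6 hQ₀c)
  -- E3
  have hβ'le : ∀ n, |β' n| ≤ |β n| := fun n => abs_sqfPart_le β n
  have E3 : ‖(dS1c a (mRange M (M / 2)) N Q R Q₀ (fun m => bump M (M / 2) m) β' γ : ℂ) -
      alphaHat M (M / 2) * (calX a N Q R Q₀ β' γ : ℂ) - calR1 a M (M / 2) N Q R Q₀ β' γ Hn‖ ≤
      S₂ * x * R⁻¹ / Real.log x ^ A := by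
    have h := e3_le hY hYM hN0' hQ hR hQ₀ hγ hβ'le Hn hj hθ0 hθ (hm b) (a := a)
    refine h.trans (e3_num hx16 hMN hN hQ hQx hR hl2 hQ₀0.le hθ0 (by have := one_le_derivConst j; linarith)
      (abs_nonneg _) (Nat.cast_nonneg _) hHle htail hphase)
  -- E1
  have E1 : |dS1n a (mRange M (M / 2)) N Q R Q₀ (fun m => bump M (M / 2) m) β γ| ≤
      S₂ * x * R⁻¹ / Real.log x ^ A := by
    have h := e1_le hY hYM hM1 haM hN hQ hR hQ₀0 hγ β hz0 hsift hC₃ hB₃ hC₄ hB₄ hP₀ hT hω₀0 hlg0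
      hL3 hL3' hX₀ hX₀' hlev hlev' hTv hlgm hω (hm (b + ⌈B₄⌉₊)) (hm (⌈B₃⌉₊ + ⌈B₄⌉₊))
      (hm (b + 1 + ⌈B₃⌉₊ + ⌈B₄⌉₊)) (hm (b + 1)) (hCm _).le (hCm _).le
    refine h.trans (e1_num hx16 hMN hN hNx hMx hQ hQx hR hRx hl2 hz0 hQ₀0 hP₀ hT hlg0 hlgΛ hω₀Λ hC₃ hB₃ hC₄
      hB₄ (hCm _).le (hCm _).le (hCm _).le (hCm _).le hz1 hQ₀1 h3a h3b h3c h3d)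
  -- E4
  have E4 : ‖calR1 a M (M / 2) N Q R Q₀ β' γ Hn‖ ≤ S₂ * x * R⁻¹ / Real.log x ^ A := by
    rcases Nat.eq_zero_or_pos Hn with hH0 | hHpos
    · -- no frequencies
      have : calR1 a M (M / 2) N Q R Q₀ β' γ Hn = 0 := by
        unfold calR1 oscR
        rw [hH0]
        simp
      rw [this, norm_zero]
      have hΛ0 : 0 < Real.log x := Real.log_pos (by linarith)
      exact div_nonneg (by positivity) (Real.rpow_nonneg hΛ0.le _)
    · have hH1 : 1 ≤ Hn := hHpos
      have hNR : 1 ≤ N / R := by rw [le_div_iff₀ hR0]; linarith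
      have hsf : ∀ n ∈ dyadic N, β' n ≠ 0 → Squarefree n := fun n _ h => squarefree_of_sqfPart_ne_zero h
      set ΓQ := ∑ q ∈ dyadic Q, γ q ^ 2 with hΓQ
      have h := e4_le ha h7 hC₇ hY hYM hN hQ hR0 hNR hQ₀ hH1 hsf hD hDτ (le_refl ΓQ) (γ := γ) (Q₀ := Q₀)
      refine h.trans ?_
      -- replace `β'` by `β` inside (monotonicity)
      have hS₂' : l2Sq N β' ≤ S₂ := l2Sq_sqfPart_le N β
      have hS₄' : D * ∑ n ∈ dyadic N, β' n ^ 4 ≤ D * ∑ n ∈ dyadic N, β n ^ 4 :=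
        mul_le_mul_of_nonneg_left (Finset.sum_le_sum fun n _ => sqfPart_pow_le β n (by decide) (by norm_num)) hD0
      have hS₄0 : 0 ≤ D * ∑ n ∈ dyadic N, β' n ^ 4 := by positivity
      set L : ℝ := C₇ * lemma7Rhs (4 * N * Q) (2 * Q) (N / R) Hn (2 * N) η S₂ (D * ∑ n ∈ dyadic N, β n ^ 4)
        with hL
      have hmono : C₇ * lemma7Rhs (4 * N * Q) (2 * Q) (N / R) Hn (2 * N) η (l2Sq N β')
          (D * ∑ n ∈ dyadic N, β' n ^ 4) ≤ L :=
        mul_le_mul_of_nonneg_left (lemma7Rhs_mono (by positivity) (by positivity) (by positivity)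
          (by positivity) (by positivity) hS₄0 hS₂' hS₄') hC₇
      -- the bound for `L` (Lemma 7 after (9.20))
      have hLb : L ≤ C₇ * Pη * S₂ * Hn * (8 * N ^ 2 * Q ^ 2 / R +
          48 * Real.sqrt (D * C₅) * N ^ (ε₅ / 2) * (N ^ (5 / 2 : ℝ) * Q + N ^ 2 * Q ^ (3 / 2 : ℝ))) := by
        have hat := lemma7Rhs_at_le hN hQ hR0 (by exact_mod_cast hH1) hHK
          (by positivity : 0 ≤ D * ∑ n ∈ dyadic N, β n ^ 4) (η := η) (S₂ := S₂)
        rw [hPη] at hat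
        refine (mul_le_mul_of_nonneg_left hat hC₇).trans ?_
        -- `S₄^{1/2} ≤ (DC₅)^{1/2} N^{(ε₅-1)/2} S₂`
        have hS₄ : (D * ∑ n ∈ dyadic N, β n ^ 4) ^ (1 / 2 : ℝ) ≤ Real.sqrt (D * C₅) * (N ^ ((ε₅ - 1) / 2) * S₂) := by
          have h1 : D * ∑ n ∈ dyadic N, β n ^ 4 ≤ (D * C₅) * (N ^ (ε₅ - 1) * S₂ ^ 2) := by
            calc D * ∑ n ∈ dyadic N, β n ^ 4 ≤ D * (C₅ * N ^ (ε₅ - 1) * S₂ ^ 2) := mul_le_mul_of_nonneg_left hA5 hD0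
              _ = _ := by ring
          calc (D * ∑ n ∈ dyadic N, β n ^ 4) ^ (1 / 2 : ℝ) ≤ ((D * C₅) * (N ^ (ε₅ - 1) * S₂ ^ 2)) ^ (1 / 2 : ℝ) :=
                Real.rpow_le_rpow (by positivity) h1 (by norm_num)
            _ = _ := by
                rw [← Real.sqrt_eq_rpow, Real.sqrt_mul (by positivity), Real.sqrt_mul (Real.rpow_nonneg hN0 _),
                  Real.sqrt_sq hl2, Real.sqrt_eq_rpow (N ^ (ε₅ - 1)), ← Real.rpow_mul hN0]
                ring_nf
        have hNpow : N ^ (1 / 2 : ℝ) * N ^ ((ε₅ - 1) / 2) = N ^ (ε₅ / 2) := by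
          rw [← Real.rpow_add hN0']; ring_nf
        have hPη0 : 0 ≤ Pη := by rw [← hPη]; positivity
        calc C₇ * (Pη *
              (8 * N ^ 2 * Q ^ 2 * (Hn / R) * S₂ +
              48 * (N ^ (5 / 2 : ℝ) * Q + N ^ 2 * Q ^ (3 / 2 : ℝ)) * Hn * N ^ (1 / 2 : ℝ) *
                (D * ∑ n ∈ dyadic N, β n ^ 4) ^ (1 / 2 : ℝ)))
            ≤ C₇ * (Pη * (8 * N ^ 2 * Q ^ 2 * (Hn / R) * S₂ +
              48 * (N ^ (5 / 2 : ℝ) * Q + N ^ 2 * Q ^ (3 / 2 : ℝ)) * Hn * N ^ (1 / 2 : ℝ) *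
                (Real.sqrt (D * C₅) * (N ^ ((ε₅ - 1) / 2) * S₂)))) := by
              gcongr
          _ = _ := by rw [← hNpow]; ring
      calc 2 * (Q₀ * ((a.natAbs.divisors.card : ℝ) * 2 * (2 * Real.log (N / R) + 1) *
            ((3 * M * Q₀ / (Q ^ 2 * R)) * (2 * π * Real.sqrt (8 * (M + 2 * (M / 2)) * fourierDecayConst (M / 2))) *
              (2 + Real.log (3 * Q₀ * N + 2)) *
              ((Real.sqrt (N / R) * ΓQ * Real.sqrt (l2Sq N β')) *
                Real.sqrt (Dτ * (C₇ * lemma7Rhs (4 * N * Q) (2 * Q) (N / R) Hn (2 * N) η (l2Sq N β')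
                  (D * ∑ n ∈ dyadic N, β' n ^ 4)))))))
          ≤ 2 * (Q₀ * ((a.natAbs.divisors.card : ℝ) * 2 * (2 * Real.log (N / R) + 1) *
            ((3 * M * Q₀ / (Q ^ 2 * R)) * (2 * π * Real.sqrt (8 * (M + 2 * (M / 2)) * fourierDecayConst (M / 2))) *
              (2 + Real.log (3 * Q₀ * N + 2)) *
              ((Real.sqrt (N / R) * ΓQ * Real.sqrt S₂) * Real.sqrt (Dτ * L))))) := by
            have hlogNR : 0 ≤ Real.log (N / R) := Real.log_nonneg hNR
            have hlog3 : 0 ≤ Real.log (3 * Q₀ * N + 2) := Real.log_nonneg (by nlinarith)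
            have hΓQ0 : 0 ≤ ΓQ := Finset.sum_nonneg fun _ _ => sq_nonneg _
            gcongr
        _ ≤ S₂ * x * R⁻¹ / Real.log x ^ A := by
            have hΓ : ΓQ ≤ Q * (4 * Cm (2 * b) * Real.log (4 * Q) ^ km (2 * b)) := by
              have h1 : ΓQ ≤ ∑ q ∈ dyadic Q, (σ 0 q : ℝ) ^ (2 * b) := by
                refine Finset.sum_le_sum fun q _ => ?_
                have h2 : |γ q| ^ 2 ≤ ((σ 0 q : ℝ) ^ b) ^ 2 := pow_le_pow_left₀ (abs_nonneg _) (hγ q) 2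
                rw [sq_abs, ← pow_mul, mul_comm] at h2
                exact h2
              refine h1.trans (((hm (2 * b)).sum_dyadic_le hQ).trans (le_of_eq (by ring)))
            have hΓQ0 : 0 ≤ ΓQ := Finset.sum_nonneg fun _ _ => sq_nonneg _
            have hPη0 : 0 ≤ Pη := by rw [← hPη]; positivity
            have hΓ'0 : 0 ≤ 4 * Cm (2 * b) * Real.log (4 * Q) ^ km (2 * b) :=
              mul_nonneg (mul_nonneg (by norm_num) (hCm _).le) (pow_nonneg (Real.log_nonneg (by linarith)) _)
            exact e4_num hx16 hMN hN hNx hQ hR hRN hl2 hQ₀ hQ₀x hΓ'0 hΓ hΓQ0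
              hC₇ hPη0 (Nat.cast_nonneg _) (by exact_mod_cast hH1) hHle hLb hr1 hr2 hr3 hbig
  -- combine
  have htot := hsk.trans (add_le_add (add_le_add (add_le_add (add_le_add (add_le_add (add_le_add (add_le_add
    E1 E2) E3) E4) E5) E6) E7) E8)
  linarith


/-! ## Theorem 2 from Lemma 7 for `𝓑_m`: the choice of the parameters -/

set_option maxHeartbeats 20000000 in
/-- **Theorem 2 of Bombieri–Friedlander–Iwaniec (1986), conditionally on Lemma 7 for the twisted
Kloosterman-type sum `𝓑_m`** (Deshouillers–Iwaniec).  The hypothesis `h7` is Lemma 7 of the paper in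
the uniform-in-`m` form needed in §9 (characters to modulus `δq₀k`, both signs of `a`): for every
`a ≠ 0` and `η > 0` there is `C₇` with `𝓑_m ≤ C₇ · lemma7Rhs` (BFI (9.16)).  Everything else —
§§3–8, the squarefree reduction, §9 up to Lemma 7, and the choice of the parameters
`Y = M/2, Q₀ = ℒ^{A₁}, z = ℒ^{B₀}, H = [16 x^{ε₁} Q²R/M], ε₅ = ε₀ = min(ε, 1/10)` — is proved in the
tree, so that this theorem discharges the named fact `BombieriFriedlanderIwaniecTheorem2` from `h7`.
[cite: BombieriFriedlanderIwaniecActa1986, §9 Theorem 2 p. 230, (9.16)–(9.21); §3 (3.3)–(3.5)] -/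
theorem BombieriFriedlanderIwaniecTheorem2_of_lemma7
    (h7 : ∀ a : ℤ, a ≠ 0 → ∀ η : ℝ, 0 < η → ∃ C₇ : ℝ, ∀ m : ℕ, 0 < m → ∀ C D K H N' : ℝ,
      1 ≤ C → 1 ≤ D → 1 ≤ K → 1 ≤ H → 1 ≤ N' → ∀ (b : ℕ → ℝ) (β' : ℕ → ℕ → ℂ),
        (∀ h n, ‖β' h n‖ ≤ |b n|) →
          dispBm a m C D K H N' β' ≤ C₇ * lemma7Rhs C D K H N' η
            (∑ n ∈ Icc 1 ⌊N'⌋₊, b n ^ 2) (∑ n ∈ Icc 1 ⌊N'⌋₊, (rho n : ℝ) * b n ^ 4)) :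
    BombieriFriedlanderIwaniecTheorem2 := by
  intro a ha ε hε A hA B hB Csw C₅
  -- ε₀, b, η, ε₁, j
  set ε₀ : ℝ := min ε (1 / 10) with hε₀def
  have hε₀ : 0 < ε₀ := lt_min hε (by norm_num)
  have hε₀ε : ε₀ ≤ ε := min_le_left _ _
  have hε₀1 : ε₀ ≤ 1 / 10 := min_le_right _ _
  have hε₀one : ε₀ ≤ 1 := by linarith only [hε₀1]
  set b : ℕ := ⌈B⌉₊ with hbdef
  set η : ℝ := ε₀ / 40 with hηdef
  have hη : 0 < η := by positivity
  have hη1 : η ≤ 1 := by rw [hηdef]; linarith only [hε₀1]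
  have hηε₀ : η ≤ ε₀ := by rw [hηdef]; linarith only [hε₀]
  set ε₁ : ℝ := ε₀ / 4 with hε₁def
  have hε₁ : 0 < ε₁ := by positivity
  set j : ℕ := ⌈5 / ε₁⌉₊ + 2 with hjdef
  have hj2 : 2 ≤ j := by rw [hjdef]; omega
  have hj5 : 5 ≤ ε₁ * ((j - 1 : ℕ) : ℝ) := by
    have h1 : ((j - 1 : ℕ) : ℝ) = ⌈5 / ε₁⌉₊ + 1 := by
      have : j - 1 = ⌈5 / ε₁⌉₊ + 1 := by rw [hjdef]; omega
      rw [this]; push_cast; ring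
    have h2 : 5 / ε₁ ≤ ⌈5 / ε₁⌉₊ := Nat.le_ceil _
    have h3 : 5 / ε₁ * ε₁ = 5 := div_mul_cancel₀ _ hε₁.ne'
    rw [h1, mul_add, mul_one]
    nlinarith only [h2, h3, hε₁]
  -- Lemma 7 constants
  obtain ⟨C₇a, h7a⟩ := h7 a ha η hη
  obtain ⟨C₇b, h7b⟩ := h7 (-a) (neg_ne_zero.2 ha) η hη
  set C₇ : ℝ := max (max C₇a C₇b) 0 with hC₇def
  have hC₇0 : 0 ≤ C₇ := le_max_right _ _
  have h7' := lemma7_common (η := η) h7a h7b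
  -- Lemma 3 (two instances)
  obtain ⟨B₃r, C₃r, X₃, hL3r⟩ := BombieriFriedlanderIwaniecLemma3_holds a ha ((b : ℝ) + 1) (by positivity)
    (ε₀ / 3) (by positivity)
  set B₃ : ℝ := max B₃r 1 with hB₃def
  set C₃ : ℝ := max C₃r 0 with hC₃def
  have hB₃1 : 1 ≤ B₃ := le_max_right _ _
  have hB₃0 : 0 ≤ B₃ := zero_le_one.trans hB₃1
  have hC₃0 : 0 ≤ C₃ := le_max_right _ _
  obtain ⟨B₄r, C₄r, X₄, hL3r'⟩ := BombieriFriedlanderIwaniecLemma3_holds a ha B₃ (by linarith only [hB₃1]) ε₀ hε₀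
  set B₄ : ℝ := max B₄r 0 with hB₄def
  set C₄ : ℝ := max C₄r 0 with hC₄def
  have hB₄0 : 0 ≤ B₄ := le_max_right _ _
  have hC₄0 : 0 ≤ C₄ := le_max_right _ _
  have hL3 := lemma3_mono (le_max_left B₃r 1) hL3r
  have hL3' := lemma3_mono (le_max_left B₄r 0) hL3r'
  -- moments
  choose Cm hCm0 hCm using fun r => exists_momentHyp r
  set km : ℕ → ℕ := fun r => 2 ^ (r + 1) with hkmdef
  have hCm' : ∀ r, MomentHyp r (Cm r) (km r) := fun r => hCm r
  have hc_b : 0 < Cm b := hCm0 _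
  have hc_b1 : 0 < Cm (b + 1) := hCm0 _
  have hc_b2 : 0 < Cm (b + 2) := hCm0 _
  have hc_1 : 0 < Cm 1 := hCm0 _
  have hc_2 : 0 < Cm 2 := hCm0 _
  have hc_3 : 0 < Cm 3 := hCm0 _
  have hc_2b : 0 < Cm (2 * b) := hCm0 _
  have hc_2b1 : 0 < Cm (2 * b + 1) := hCm0 _
  have hc_9 : 0 < Cm (b + ⌈B₃⌉₊) := hCm0 _
  have hc_10 : 0 < Cm (2 * ⌈B₃⌉₊) := hCm0 _
  have hc_11 : 0 < Cm (2 * ⌈B₃⌉₊ + 2) := hCm0 _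
  have hc_12 : 0 < Cm (4 * ⌈B₃⌉₊) := hCm0 _
  have hc_13 : 0 < Cm (4 * ⌈B₃⌉₊ + 4) := hCm0 _
  have hc_14 : 0 < Cm (b + ⌈B₄⌉₊) := hCm0 _
  have hc_15 : 0 < Cm (⌈B₃⌉₊ + ⌈B₄⌉₊) := hCm0 _
  have hc_16 : 0 < Cm (b + 1 + ⌈B₃⌉₊ + ⌈B₄⌉₊) := hCm0 _
  -- divisor bounds
  obtain ⟨Cδ, hCδ1, hδ⟩ := exists_sigma_zero_le_mul_rpow hη
  obtain ⟨CT, hCT1, hTδ⟩ := exists_sigma_zero_le_mul_rpow (ε := η / ((b : ℝ) + 1)) (by positivity)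
  have hCδ0 : 0 ≤ Cδ := zero_le_one.trans hCδ1
  have hCT0 : 0 ≤ CT := zero_le_one.trans hCT1
  set C₅' : ℝ := max C₅ 0 with hC₅'def
  have hC₅'0 : 0 ≤ C₅' := le_max_right _ _
  -- exponent budget
  set KM : ℝ := (km b : ℝ) + km (b + 1) + km (b + 2) + km 1 + km 2 + km 3 + km (2 * b) + km (2 * b + 1) +
      km (b + ⌈B₃⌉₊) + km (2 * ⌈B₃⌉₊) + km (2 * ⌈B₃⌉₊ + 2) + km (4 * ⌈B₃⌉₊) + km (4 * ⌈B₃⌉₊ + 4) +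
      km (b + ⌈B₄⌉₊) + km (⌈B₃⌉₊ + ⌈B₄⌉₊) + km (b + 1 + ⌈B₃⌉₊ + ⌈B₄⌉₊) with hKMdef
  have n1 : (0:ℝ) ≤ km b := Nat.cast_nonneg _
  have n2 : (0:ℝ) ≤ km (b + 1) := Nat.cast_nonneg _
  have n3 : (0:ℝ) ≤ km (b + 2) := Nat.cast_nonneg _
  have n4 : (0:ℝ) ≤ km 1 := Nat.cast_nonneg _
  have n5 : (0:ℝ) ≤ km 2 := Nat.cast_nonneg _
  have n6 : (0:ℝ) ≤ km 3 := Nat.cast_nonneg _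
  have n7 : (0:ℝ) ≤ km (2 * b) := Nat.cast_nonneg _
  have n8 : (0:ℝ) ≤ km (2 * b + 1) := Nat.cast_nonneg _
  have n9 : (0:ℝ) ≤ km (b + ⌈B₃⌉₊) := Nat.cast_nonneg _
  have n10 : (0:ℝ) ≤ km (2 * ⌈B₃⌉₊) := Nat.cast_nonneg _
  have n11 : (0:ℝ) ≤ km (2 * ⌈B₃⌉₊ + 2) := Nat.cast_nonneg _
  have n12 : (0:ℝ) ≤ km (4 * ⌈B₃⌉₊) := Nat.cast_nonneg _
  have n13 : (0:ℝ) ≤ km (4 * ⌈B₃⌉₊ + 4) := Nat.cast_nonneg _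
  have n14 : (0:ℝ) ≤ km (b + ⌈B₄⌉₊) := Nat.cast_nonneg _
  have n15 : (0:ℝ) ≤ km (⌈B₃⌉₊ + ⌈B₄⌉₊) := Nat.cast_nonneg _
  have n16 : (0:ℝ) ≤ km (b + 1 + ⌈B₃⌉₊ + ⌈B₄⌉₊) := Nat.cast_nonneg _
  have hKM0 : 0 ≤ KM := by
    rw [hKMdef]; linarith only [n1, n2, n3, n4, n5, n6, n7, n8, n9, n10, n11, n12, n13, n14, n15, n16]
  set Ktot : ℝ := 20 + 2 * B₃ + 2 * B₄ + A + 4 * KM with hKtotdef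
  have hKtot0 : 0 < Ktot := by rw [hKtotdef]; linarith only [hB₃0, hB₄0, hA, hKM0]
  set A₁ : ℝ := Ktot + 1 with hA₁def
  have hA₁0 : 0 < A₁ := by rw [hA₁def]; linarith only [hKtot0]
  set B₀ : ℝ := 4 * (Ktot + A₁ + 1) with hB₀def
  have hB₀0 : 0 ≤ B₀ := by rw [hB₀def]; linarith only [hKtot0, hA₁0]
  set A' : ℝ := Ktot + A₁ + 2 with hA'def
  have hA'0 : 0 < A' := by rw [hA'def]; linarith only [hKtot0, hA₁0]
  set Kbig : ℝ := Ktot + 2 * A₁ + 2 * A' + 10 with hKbigdef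
  -- Theorem 0 (a)
  obtain ⟨C₀, N₁, h0a⟩ := BombieriFriedlanderIwaniecTheorem0a hA'0 hB Csw
  set C₀' : ℝ := max C₀ 0 with hC₀'def
  have hC₀'0 : 0 ≤ C₀' := le_max_right _ _
  -- constants
  have hK2 : 0 ≤ derivConst 2 := zero_le_one.trans (one_le_derivConst 2)
  have hKj : 0 ≤ derivConst j := zero_le_one.trans (one_le_derivConst j)
  set cT : ℝ := CT ^ ((b : ℝ) + 1) * (6 : ℝ) ^ η with hcTdef
  have hcT0 : 0 ≤ cT := by positivity
  set τa : ℝ := (a.natAbs.divisors.card : ℝ) with hτadef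
  have hτa0 : 0 ≤ τa := Nat.cast_nonneg _
  set cD1 : ℝ := Real.sqrt (Cδ * 8 ^ η + 1) with hcD1def
  set cD2 : ℝ := Real.sqrt (C₇ * 512 ^ η) with hcD2def
  set cD3 : ℝ := Real.sqrt 8 + 2 * Real.sqrt (48 * Real.sqrt (Cδ * 2 ^ η * C₅')) with hcD3def
  have hcD10 : 0 ≤ cD1 := Real.sqrt_nonneg _
  have hcD20 : 0 ≤ cD2 := Real.sqrt_nonneg _
  have hcD30 : 0 ≤ cD3 := by positivity
  set Cbig : ℝ := max 800000 (max (8 + derivConst 2) (max ((4 * Cm (b + 2)) ^ 2) (max (4 * Cm 3) (max (4 * Cm b) (max (4 * Cm (b + 2)) (max (4 * Cm 1) (max (Real.sqrt (8 * Cm 1 * Real.sqrt (32 * Cm 2))) (max ((Cm b) ^ 2) (max C₃ (max C₄ (max (Cm (b + ⌈B₃⌉₊)) (max (Real.sqrt (6 * (Cm (2 * ⌈B₃⌉₊) + Cm (2 * ⌈B₃⌉₊ + 2)) * Real.sqrt (4 * (6 * (Cm (4 * ⌈B₃⌉₊) + Cm (4 * ⌈B₃⌉₊ + 4)))))) (max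 (Cm (b + ⌈B₄⌉₊)) (max (Cm (⌈B₃⌉₊ + ⌈B₄⌉₊)) (max (Cm (b + 1 + ⌈B₃⌉₊ + ⌈B₄⌉₊)) (max cT (max (Cm (b + 1)) (max (128 * C₀' * ε₀ ^ (-A')) (max ((Cm (2 * b)) ^ 2) (max (Cm 1) (max (Cm (2 * b + 1)) (max (derivConst j) (max |(a : ℝ)| (max τa (max (2 * Real.sqrt (32 * derivConst 2)) (max (Cm (2 * b)) (max cD1 (max cD2 cD3)))))))))))))))))))))))))))) with hCbigdef
  have cbK2 : (8 + derivConst 2) ≤ Cbig := by rw [hCbigdef]; exact le_max_of_le_right (le_max_left _ _)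
  have cbA : ((4 * Cm (b + 2)) ^ 2) ≤ Cbig := by rw [hCbigdef]; exact le_max_of_le_right (le_max_of_le_right (le_max_left _ _))
  have cbB : (4 * Cm 3) ≤ Cbig := by rw [hCbigdef]; exact le_max_of_le_right (le_max_of_le_right (le_max_of_le_right (le_max_left _ _)))
  have cbC : (4 * Cm b) ≤ Cbig := by rw [hCbigdef]; exact le_max_of_le_right (le_max_of_le_right (le_max_of_le_right (le_max_of_le_right (le_max_left _ _))))
  have cbD : (4 * Cm (b + 2)) ≤ Cbig := by rw [hCbigdef]; exact le_max_of_le_right (le_max_of_le_right (le_max_of_le_right (le_max_of_le_right (le_max_of_le_right (le_max_left _ _)))))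
  have cbE : (4 * Cm 1) ≤ Cbig := by rw [hCbigdef]; exact le_max_of_le_right (le_max_of_le_right (le_max_of_le_right (le_max_of_le_right (le_max_of_le_right (le_max_of_le_right (le_max_left _ _))))))
  have cbF : (Real.sqrt (8 * Cm 1 * Real.sqrt (32 * Cm 2))) ≤ Cbig := by rw [hCbigdef]; exact le_max_of_le_right (le_max_of_le_right (le_max_of_le_right (le_max_of_le_right (le_max_of_le_right (le_max_of_le_right (le_max_of_le_right (le_max_left _ _)))))))
  have cbG : ((Cm b) ^ 2) ≤ Cbig := by rw [hCbigdef]; exact le_max_of_le_right (le_max_of_le_right (le_max_of_le_right (le_max_of_le_right (le_max_of_le_right (le_max_of_le_right (le_max_of_le_right (le_max_of_le_right (le_max_left _ _))))))))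
  have cbC3 : C₃ ≤ Cbig := by rw [hCbigdef]; exact le_max_of_le_right (le_max_of_le_right (le_max_of_le_right (le_max_of_le_right (le_max_of_le_right (le_max_of_le_right (le_max_of_le_right (le_max_of_le_right (le_max_of_le_right (le_max_left _ _)))))))))
  have cbC4 : C₄ ≤ Cbig := by rw [hCbigdef]; exact le_max_of_le_right (le_max_of_le_right (le_max_of_le_right (le_max_of_le_right (le_max_of_le_right (le_max_of_le_right (le_max_of_le_right (le_max_of_le_right (le_max_of_le_right (le_max_of_le_right (le_max_left _ _))))))))))
  have cbH : (Cm (b + ⌈B₃⌉₊)) ≤ Cbig := by rw [hCbigdef]; exact le_max_of_le_right (le_max_of_le_right (le_max_of_le_right (le_max_of_le_right (le_max_of_le_right (le_max_of_le_right (le_max_of_le_right (le_max_of_le_right (le_max_of_le_right (le_max_of_le_right (le_max_of_le_right (le_max_left _ _)))))))))))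
  have cbI : (Real.sqrt (6 * (Cm (2 * ⌈B₃⌉₊) + Cm (2 * ⌈B₃⌉₊ + 2)) * Real.sqrt (4 * (6 * (Cm (4 * ⌈B₃⌉₊) + Cm (4 * ⌈B₃⌉₊ + 4)))))) ≤ Cbig := by rw [hCbigdef]; exact le_max_of_le_right (le_max_of_le_right (le_max_of_le_right (le_max_of_le_right (le_max_of_le_right (le_max_of_le_right (le_max_of_le_right (le_max_of_le_right (le_max_of_le_right (le_max_of_le_right (le_max_of_le_right (le_max_of_le_right (le_max_left _ _))))))))))))
  have cbJ : (Cm (b + ⌈B₄⌉₊)) ≤ Cbig := by rw [hCbigdef]; exact le_max_of_le_right (le_max_of_le_right (le_max_of_le_right (le_max_of_le_right (le_max_of_le_right (le_max_of_le_right (le_max_of_le_right (le_max_of_le_right (le_max_of_le_right (le_max_of_le_right (le_max_of_le_right (le_max_of_le_right (le_max_of_le_right (le_max_left _ _)))))))))))))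
  have cbK : (Cm (⌈B₃⌉₊ + ⌈B₄⌉₊)) ≤ Cbig := by rw [hCbigdef]; exact le_max_of_le_right (le_max_of_le_right (le_max_of_le_right (le_max_of_le_right (le_max_of_le_right (le_max_of_le_right (le_max_of_le_right (le_max_of_le_right (le_max_of_le_right (le_max_of_le_right (le_max_of_le_right (le_max_of_le_right (le_max_of_le_right (le_max_of_le_right (le_max_left _ _))))))))))))))
  have cbL : (Cm (b + 1 + ⌈B₃⌉₊ + ⌈B₄⌉₊)) ≤ Cbig := by rw [hCbigdef]; exact le_max_of_le_right (le_max_of_le_right (le_max_of_le_right (le_max_of_le_right (le_max_of_le_right (le_max_of_le_right (le_max_of_le_right (le_max_of_le_right (le_max_of_le_right (le_max_of_le_right (le_max_of_le_right (le_max_of_le_right (le_max_of_le_right (le_max_of_le_right (le_max_of_le_right (le_max_left _ _)))))))))))))))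
  have cbT : cT ≤ Cbig := by rw [hCbigdef]; exact le_max_of_le_right (le_max_of_le_right (le_max_of_le_right (le_max_of_le_right (le_max_of_le_right (le_max_of_le_right (le_max_of_le_right (le_max_of_le_right (le_max_of_le_right (le_max_of_le_right (le_max_of_le_right (le_max_of_le_right (le_max_of_le_right (le_max_of_le_right (le_max_of_le_right (le_max_of_le_right (le_max_left _ _))))))))))))))))
  have cbM : (Cm (b + 1)) ≤ Cbig := by rw [hCbigdef]; exact le_max_of_le_right (le_max_of_le_right (le_max_of_le_right (le_max_of_le_right (le_max_of_le_right (le_max_of_le_right (le_max_of_le_right (le_max_of_le_right (le_max_of_le_right (le_max_of_le_right (le_max_of_le_right (le_max_of_le_right (le_max_of_le_right (le_max_of_le_right (le_max_of_le_right (le_max_of_le_right (le_max_of_le_right (le_max_left _ _)))))))))))))))))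
  have cbW : (128 * C₀' * ε₀ ^ (-A')) ≤ Cbig := by rw [hCbigdef]; exact le_max_of_le_right (le_max_of_le_right (le_max_of_le_right (le_max_of_le_right (le_max_of_le_right (le_max_of_le_right (le_max_of_le_right (le_max_of_le_right (le_max_of_le_right (le_max_of_le_right (le_max_of_le_right (le_max_of_le_right (le_max_of_le_right (le_max_of_le_right (le_max_of_le_right (le_max_of_le_right (le_max_of_le_right (le_max_of_le_right (le_max_left _ _))))))))))))))))))
  have cbN : ((Cm (2 * b)) ^ 2) ≤ Cbig := by rw [hCbigdef]; exact le_max_of_le_right (le_max_of_le_right (le_max_of_le_right (le_max_of_le_right (le_max_of_le_right (le_max_of_le_right (le_max_of_le_right (le_max_of_le_right (le_max_of_le_right (le_max_of_le_right (le_max_of_le_right (le_max_of_le_right (le_max_of_le_right (le_max_of_le_right (le_max_of_le_right (le_max_of_le_right (le_max_of_le_right (le_max_of_le_right (le_max_of_le_right (le_max_left _ _)))))))))))))))))))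
  have cbO : (Cm 1) ≤ Cbig := by rw [hCbigdef]; exact le_max_of_le_right (le_max_of_le_right (le_max_of_le_right (le_max_of_le_right (le_max_of_le_right (le_max_of_le_right (le_max_of_le_right (le_max_of_le_right (le_max_of_le_right (le_max_of_le_right (le_max_of_le_right (le_max_of_le_right (le_max_of_le_right (le_max_of_le_right (le_max_of_le_right (le_max_of_le_right (le_max_of_le_right (le_max_of_le_right (le_max_of_le_right (le_max_of_le_right (le_max_left _ _))))))))))))))))))))
  have cbP : (Cm (2 * b + 1)) ≤ Cbig := by rw [hCbigdef]; exact le_max_of_le_right (le_max_of_le_right (le_max_of_le_right (le_max_of_le_right (le_max_of_le_right (le_max_of_le_right (le_max_of_le_right (le_max_of_le_right (le_max_of_le_right (le_max_of_le_right (le_max_of_le_right (le_max_of_le_right (le_max_of_le_right (le_max_of_le_right (le_max_of_le_right (le_max_of_le_right (le_max_of_le_right (le_max_of_le_right (le_max_of_le_right (le_max_of_le_right (le_max_of_le_right (le_max_left _ _)))))))))))))))))))))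
  have cbQ : (derivConst j) ≤ Cbig := by rw [hCbigdef]; exact le_max_of_le_right (le_max_of_le_right (le_max_of_le_right (le_max_of_le_right (le_max_of_le_right (le_max_of_le_right (le_max_of_le_right (le_max_of_le_right (le_max_of_le_right (le_max_of_le_right (le_max_of_le_right (le_max_of_le_right (le_max_of_le_right (le_max_of_le_right (le_max_of_le_right (le_max_of_le_right (le_max_of_le_right (le_max_of_le_right (le_max_of_le_right (le_max_of_le_right (le_max_of_le_right (le_max_of_le_right (le_max_left _ _))))))))))))))))))))))
  have cbR : |(a : ℝ)| ≤ Cbig := by rw [hCbigdef]; exact le_max_of_le_right (le_max_of_le_right (le_max_of_le_right (le_max_of_le_right (le_max_of_le_right (le_max_of_le_right (le_max_of_le_right (le_max_of_le_right (le_max_of_le_right (le_max_of_le_right (le_max_of_le_right (le_max_of_le_right (le_max_of_le_right (le_max_of_le_right (le_max_of_le_right (le_max_of_le_right (le_max_of_le_right (le_max_of_le_right (le_max_of_le_right (le_max_of_le_right (le_max_of_le_right (le_max_of_le_right (le_max_of_le_right (le_max_left _ _)))))))))))))))))))))))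
  have cbS : τa ≤ Cbig := by rw [hCbigdef]; exact le_max_of_le_right (le_max_of_le_right (le_max_of_le_right (le_max_of_le_right (le_max_of_le_right (le_max_of_le_right (le_max_of_le_right (le_max_of_le_right (le_max_of_le_right (le_max_of_le_right (le_max_of_le_right (le_max_of_le_right (le_max_of_le_right (le_max_of_le_right (le_max_of_le_right (le_max_of_le_right (le_max_of_le_right (le_max_of_le_right (le_max_of_le_right (le_max_of_le_right (le_max_of_le_right (le_max_of_le_right (le_max_of_le_right (le_max_of_le_right (le_max_left _ _))))))))))))))))))))))))
  have cbU : (2 * Real.sqrt (32 * derivConst 2)) ≤ Cbig := by rw [hCbigdef]; exact le_max_of_le_right (le_max_of_le_right (le_max_of_le_right (le_max_of_le_right (le_max_of_le_right (le_max_of_le_right (le_max_of_le_right (le_max_of_le_right (le_max_of_le_right (le_max_of_le_right (le_max_of_le_right (le_max_of_le_right (le_max_of_le_right (le_max_of_le_right (le_max_of_le_right (le_max_of_le_right (le_max_of_le_right (le_max_of_le_right (le_max_of_le_right (le_max_of_le_right (le_max_of_le_right (le_max_of_le_right (le_max_of_le_right (le_max_of_le_right (le_max_of_le_right (le_max_left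 _ _)))))))))))))))))))))))))
  have cbV : (Cm (2 * b)) ≤ Cbig := by rw [hCbigdef]; exact le_max_of_le_right (le_max_of_le_right (le_max_of_le_right (le_max_of_le_right (le_max_of_le_right (le_max_of_le_right (le_max_of_le_right (le_max_of_le_right (le_max_of_le_right (le_max_of_le_right (le_max_of_le_right (le_max_of_le_right (le_max_of_le_right (le_max_of_le_right (le_max_of_le_right (le_max_of_le_right (le_max_of_le_right (le_max_of_le_right (le_max_of_le_right (le_max_of_le_right (le_max_of_le_right (le_max_of_le_right (le_max_of_le_right (le_max_of_le_right (le_max_of_le_right (le_max_of_le_right (le_max_left _ _))))))))))))))))))))))))))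
  have cbX : cD1 ≤ Cbig := by rw [hCbigdef]; exact le_max_of_le_right (le_max_of_le_right (le_max_of_le_right (le_max_of_le_right (le_max_of_le_right (le_max_of_le_right (le_max_of_le_right (le_max_of_le_right (le_max_of_le_right (le_max_of_le_right (le_max_of_le_right (le_max_of_le_right (le_max_of_le_right (le_max_of_le_right (le_max_of_le_right (le_max_of_le_right (le_max_of_le_right (le_max_of_le_right (le_max_of_le_right (le_max_of_le_right (le_max_of_le_right (le_max_of_le_right (le_max_of_le_right (le_max_of_le_right (le_max_of_le_right (le_max_of_le_right (le_max_of_le_right (le_max_left _ _)))))))))))))))))))))))))))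
  have cbY : cD2 ≤ Cbig := by rw [hCbigdef]; exact le_max_of_le_right (le_max_of_le_right (le_max_of_le_right (le_max_of_le_right (le_max_of_le_right (le_max_of_le_right (le_max_of_le_right (le_max_of_le_right (le_max_of_le_right (le_max_of_le_right (le_max_of_le_right (le_max_of_le_right (le_max_of_le_right (le_max_of_le_right (le_max_of_le_right (le_max_of_le_right (le_max_of_le_right (le_max_of_le_right (le_max_of_le_right (le_max_of_le_right (le_max_of_le_right (le_max_of_le_right (le_max_of_le_right (le_max_of_le_right (le_max_of_le_right (le_max_of_le_right (le_max_of_le_right (le_max_of_le_right (le_max_left _ _))))))))))))))))))))))))))))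
  have cbZ : cD3 ≤ Cbig := by rw [hCbigdef]; exact le_max_of_le_right (le_max_of_le_right (le_max_of_le_right (le_max_of_le_right (le_max_of_le_right (le_max_of_le_right (le_max_of_le_right (le_max_of_le_right (le_max_of_le_right (le_max_of_le_right (le_max_of_le_right (le_max_of_le_right (le_max_of_le_right (le_max_of_le_right (le_max_of_le_right (le_max_of_le_right (le_max_of_le_right (le_max_of_le_right (le_max_of_le_right (le_max_of_le_right (le_max_of_le_right (le_max_of_le_right (le_max_of_le_right (le_max_of_le_right (le_max_of_le_right (le_max_of_le_right (le_max_of_le_right (le_max_of_le_right (le_max_right _ _))))))))))))))))))))))))))))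
  -- the threshold
  have hev : ∀ᶠ x : ℝ in Filter.atTop, 32 ≤ x ∧ Cbig ≤ Real.log x ∧ max X₃ 3 ≤ x ∧
      max (max X₄ 3) (max N₁ (2 * |(a : ℝ)| + 1)) ≤ x ^ ε₀ ∧ Real.log x ^ Kbig ≤ x ^ η ∧
      (16 : ℝ) ≤ x ^ (ε₀ / 4) :=
    (Filter.eventually_ge_atTop 32).and ((Real.tendsto_log_atTop.eventually_ge_atTop Cbig).and
      ((Filter.eventually_ge_atTop _).and (((tendsto_rpow_atTop hε₀).eventually_ge_atTop _).and
      ((eventually_log_rpow_le_rpow Kbig hη).and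
        ((tendsto_rpow_atTop (by positivity : (0 : ℝ) < ε₀ / 4)).eventually_ge_atTop 16)))))
  obtain ⟨x₀, hx₀⟩ := Filter.eventually_atTop.1 hev
  refine ⟨ε₀, B₀, 8, x₀, hε₀, ?_⟩
  intro x hx M N Q R hMN hN1 hN2 hQ hR hQR ha' hi hii hiii β hSW hsift hA5 γ hγ
  obtain ⟨hx32, hΛC, hX3, hX4, hKx, h16⟩ := hx₀ x hx
  have hx16 : 16 ≤ x := by linarith only [hx32]
  have hx12 : 12 ≤ x := by linarith only [hx32]
  have hx5 : 5 ≤ x := by linarith only [hx32]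
  have hx1 : 1 ≤ x := by linarith only [hx32]
  have hx0 : 0 < x := by linarith only [hx32]
  set Λ : ℝ := Real.log x with hΛdef
  have h8e5 : (800000 : ℝ) ≤ Λ := (le_max_left _ _).trans hΛC
  have hΛ5 : 5 ≤ Λ := by linarith only [h8e5]
  have hΛ2 : 2 ≤ Λ := by linarith only [h8e5]
  have hΛ1 : 1 ≤ Λ := by linarith only [h8e5]
  have hΛ0 : 0 < Λ := by linarith only [h8e5]
  have hC : ∀ c : ℝ, c ≤ Cbig → c ≤ Λ := fun c hc => hc.trans hΛC
  have hπΛ : π ≤ Λ := by linarith only [Real.pi_lt_four, h8e5]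
  have hxm : ∀ {p q : ℝ}, p ≤ q → x ^ p ≤ x ^ q := fun h => Real.rpow_le_rpow_of_exponent_le hx1 h
  have hxp : ∀ p : ℝ, 0 < x ^ p := fun p => Real.rpow_pos_of_pos hx0 p
  have hKx' : ∀ {p : ℝ}, p ≤ Kbig → Λ ^ p ≤ x ^ η := fun hp => (lpow_le_lpow hΛ1 hp).trans hKx
  have h16' : ∀ {p : ℝ}, ε₀ / 4 ≤ p → (16 : ℝ) ≤ x ^ p := fun hp => h16.trans (hxm hp)
  -- the range
  obtain ⟨r1, r2, r3, r4, r5, r6, r7⟩ := range_facts hx1 hε₀ε hN1 hN2 hQ hR ha' hi hii hiii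
  obtain ⟨hN0, hNx, hMx, hMε, hM1⟩ := m_facts hx1 hMN hε₀.le r7 r6
  have hxε₀1 : 1 ≤ x ^ ε₀ := Real.one_le_rpow hx1 hε₀.le
  have hN0' : 0 < N := by linarith only [hN0]
  have hM0 : 0 < M := by linarith only [hM1]
  obtain ⟨f1, f2, f3, f4, f5, f6, f7⟩ := range_facts' hx1 hMN hε₀ hε₀1 hN0 hQ hR hQR r1 r2 r3 r4 r5
  have hQ0 : 0 < Q := by linarith only [hQ]
  have hR0 : 0 < R := by linarith only [hR]
  have hX4' : max X₄ 3 ≤ x ^ ε₀ := (le_max_left _ _).trans hX4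
  have hN₁a : max N₁ (2 * |(a : ℝ)| + 1) ≤ x ^ ε₀ := (le_max_right _ _).trans hX4
  have ha2 : 2 * |(a : ℝ)| + 1 ≤ x ^ ε₀ := (le_max_right _ _).trans hN₁a
  have haM : |(a : ℝ)| < M - M / 2 := by linarith only [ha2, hMε]
  have hax : |(a : ℝ)| ≤ x := by linarith only [ha2, hMε, hMx, abs_nonneg (a : ℝ)]
  have hQx : Q ≤ 2 * x := by nlinarith only [hQR, hR, hQ0]
  have hRx : R ≤ 2 * x := by nlinarith only [hQR, hQ, hR0]
  have hRN : R ≤ N := by nlinarith only [r4, hxε₀1, hR0]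
  have hRNx : R ≤ N * x ^ (-ε₀) := by
    have : R * x ^ ε₀ * x ^ (-ε₀) ≤ N * x ^ (-ε₀) := mul_le_mul_of_nonneg_right r4 (hxp _).le
    rwa [mul_assoc, ← Real.rpow_add hx0, add_neg_cancel, Real.rpow_zero, mul_one] at this
  have hNR2 : N / R ≤ 2 * x := by rw [div_le_iff₀ hR0]; nlinarith only [hNx, hR, hx0]
  -- the parameters
  set Q₀ : ℝ := Λ ^ A₁ with hQ₀def
  set z : ℝ := Λ ^ B₀ with hzdef
  have hQ₀1 : 1 ≤ Q₀ := Real.one_le_rpow hΛ1 hA₁0.le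
  have hQ₀0 : 0 < Q₀ := by linarith only [hQ₀1]
  have hz1' : 1 ≤ z := Real.one_le_rpow hΛ1 hB₀0
  have hQ₀sq : Q₀ ^ 2 ≤ Λ ^ (A₁ + A₁) := by rw [sq, Real.rpow_add hΛ0]
  set Hn : ℕ := ⌊16 * x ^ ε₁ * Q ^ 2 * R / M⌋₊ with hHndef
  set θ : ℝ := 8 * Q ^ 2 * R / (2 * π * (M / 2) * ((Hn : ℝ) + 1)) with hθdef
  have hθ0 : 0 ≤ θ := by positivity
  set P₀ : ℝ := x ^ (ε₀ / 3) with hP₀def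
  have hP₀ : 0 < P₀ := hxp _
  set T : ℝ := (CT * (6 * x) ^ (η / ((b : ℝ) + 1))) ^ ((b : ℝ) + 1) with hTdef
  have hT0 : 0 ≤ T := by positivity
  have hTle : T ≤ cT * x ^ η := by
    rw [hTdef, hcTdef, Real.mul_rpow hCT0 (by positivity), ← Real.rpow_mul (by positivity),
      div_mul_cancel₀ _ (by positivity : ((b : ℝ) + 1) ≠ 0), Real.mul_rpow (by norm_num) hx0.le]
    ring_nf; rfl
  set S₂ : ℝ := l2Sq N β with hS₂def
  have hS₂0 : 0 ≤ S₂ := l2Sq_nonneg N β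
  have hlogN : ε₀ * Λ ≤ Real.log N ∧ Real.log N ≤ Λ := by
    constructor
    · have : Real.log (x ^ ε₀) ≤ Real.log N := Real.log_le_log (hxp _) r7
      rwa [Real.log_rpow hx0] at this
    · exact Real.log_le_log hN0' hNx
  have hlogN0 : 0 < Real.log N := lt_of_lt_of_le (by positivity) hlogN.1
  set W : ℝ := C₀' * S₂ * N / Real.log N ^ A' with hWdef
  have hW0 : 0 ≤ W := by positivity
  set D : ℝ := Cδ * (2 * N) ^ η with hDdef
  have hD0 : 0 ≤ D := by positivity
  set Dτ : ℕ := ⌈Cδ * (4 * N * Q) ^ η⌉₊ with hDτdef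
  -- γ with natural exponent; Lemma 3 thresholds
  have hγb : ∀ q, |γ q| ≤ (σ 0 q : ℝ) ^ b := gamma_natpow hB hγ
  have hX₀ : max X₃ 3 ≤ 2 * (M - M / 2) * N := by
    have : 2 * (M - M / 2) * N = x := by rw [← hMN]; ring
    rw [this]; exact hX3
  have hX₀' : max X₄ 3 ≤ 2 * M + M / 2 := hX4'.trans (hMε.trans (by linarith only [hM0]))
  -- levels and logarithms
  have hlev2 := level_e2 hx1 hMN hM0 hN0' hQ0 hR0 hε₀ hε₀one f1 (h16' (by linarith only [hε₀]))
  have hlev := level_e1 (R := R) hx1 hMN hM0 hε₀one hRNx ((show (5:ℝ) ≤ 16 by norm_num).trans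
    (h16' (by linarith only [hε₀])))
  have hlev' := level_e1' (Q := Q) (R := R) hx1 hM0 hMx hε₀ hε₀one f1 ((show (4:ℝ) ≤ 16 by norm_num).trans
    (h16' (by linarith only [hε₀])))
  have hTv := tau_shift_le_T (b := b) hMN hM0 hN0' hax hη hCT0 hTδ
  obtain ⟨hlgn, hlgm, hω⟩ := log_ranges hx5 hMN hM1 hN0
  -- E7 (uniform Poisson)
  have hS2u := e7_le (half_pos hM0) (by linarith only [hM0] : M / 2 ≤ M) a hN0'.le hQ hR β hγb (hCm' b)
    (hCm' (b + 2)) (hCm' 1)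
  -- Theorem 0 (a): the BDH input
  have hlogNpow : Real.log N ^ (2 * A' + 4) ≤ Λ ^ (2 * A' + 4) :=
    Real.rpow_le_rpow hlogN0.le hlogN.2 (by linarith only [hA'0])
  have hlevel : 2 * Q₀ * R ≤ N / Real.log N ^ (2 * A' + 4) := by
    rw [le_div_iff₀ (Real.rpow_pos_of_pos hlogN0 _)]
    have hpre : 2 * Q₀ * Real.log N ^ (2 * A' + 4) ≤ x ^ η :=
      (lpow_mul hΛ1 (by positivity) (lpow_mul hΛ1 hQ₀0.le (const_le_lpow (show (2:ℝ) ≤ Λ by linarith only [h8e5])) ((le_refl Q₀ : Q₀ ≤ Λ ^ A₁))) (hlogNpow)).trans (hKx' (by simp only [hKbigdef, hA'def, hA₁def, hKtotdef, hKMdef]; linarith only [n1, n2, n3, n4, n5, n6, n7, n8, n9, n10, n11, n12, n13, n14, n15, n16, hB₃0, hB₄0, hA.le]))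
    calc 2 * Q₀ * R * Real.log N ^ (2 * A' + 4) = (2 * Q₀ * Real.log N ^ (2 * A' + 4)) * R := by ring
      _ ≤ x ^ η * R := mul_le_mul_of_nonneg_right hpre hR0.le
      _ ≤ x ^ ε₀ * R := mul_le_mul_of_nonneg_right (hxm hηε₀) hR0.le
      _ ≤ N := by linarith only [r4]
  have hN₁ : N₁ ≤ N := ((le_max_left _ _).trans hN₁a).trans r7
  have hBDH : ∀ d : ℕ, 1 ≤ d → ∑ q ∈ Icc 1 ⌊2 * Q₀ * R⌋₊, bdhD N β d q ≤ W * (σ 0 d : ℝ) ^ b := by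
    have h := bdh_input hN0' hlogN0 (h0a N hN₁ β hSW) hlevel (rfl : Csw = Csw)
    intro d hd
    exact (h d hd).trans (le_of_eq (by rw [hWdef]))
  have hWa : 128 * W * Q₀ * (Cm (2 * b)) ^ 2 * (2 * Λ) ^ (2 * km (2 * b)) * Λ ^ A ≤ S₂ * N := by
    have hG : (128 * C₀' * ε₀ ^ (-A')) * Q₀ * (Cm (2 * b)) ^ 2 * (2 * Λ) ^ (2 * km (2 * b)) * Λ ^ A ≤ Λ ^ A' :=
      (lpow_mul hΛ1 (Real.rpow_nonneg hΛ0.le A) (lpow_mul hΛ1 (by positivity : (0:ℝ) ≤ (2 * Λ) ^ (2 * km (2 * b))) (lpow_mul hΛ1 (sq_nonneg _) (lpow_mul hΛ1 hQ₀0.le (const_le_lpow (hC _ cbW)) ((le_refl Q₀ : Q₀ ≤ Λ ^ A₁))) (const_le_lpow (hC _ cbN))) (lam_two_mul_pow_le hΛ2 (2 * km (2 * b)))) (le_refl (Λ ^ A))).trans (lpow_le_lpow hΛ1 (by simp only [hA'def, hA₁def, hKtotdef, hKMdef]; push_cast; linarith only [n1, n2, n3, n4, n5, n6, n7, n8, n9,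 n10, n11, n12, n13, n14, n15, n16, hB₃0, hB₄0, hA.le]))
    have hG' : C₀' * (128 * Q₀ * (Cm (2 * b)) ^ 2 * (2 * Λ) ^ (2 * km (2 * b)) * Λ ^ A) ≤ Real.log N ^ A' := by
      have h1 : (ε₀ * Λ) ^ A' ≤ Real.log N ^ A' := Real.rpow_le_rpow (by positivity) hlogN.1 hA'0.le
      rw [Real.mul_rpow hε₀.le hΛ0.le] at h1
      have hε' : 0 < ε₀ ^ A' := Real.rpow_pos_of_pos hε₀ _
      have e : ε₀ ^ (-A') * ε₀ ^ A' = 1 := by rw [← Real.rpow_add hε₀, neg_add_cancel, Real.rpow_zero]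
      calc C₀' * (128 * Q₀ * (Cm (2 * b)) ^ 2 * (2 * Λ) ^ (2 * km (2 * b)) * Λ ^ A)
          = ((128 * C₀' * ε₀ ^ (-A')) * Q₀ * (Cm (2 * b)) ^ 2 * (2 * Λ) ^ (2 * km (2 * b)) * Λ ^ A) *
              ε₀ ^ A' := by
            calc _ = C₀' * (128 * Q₀ * (Cm (2 * b)) ^ 2 * (2 * Λ) ^ (2 * km (2 * b)) * Λ ^ A) *
                  (ε₀ ^ (-A') * ε₀ ^ A') := by rw [e, mul_one]
              _ = _ := by ring
        _ ≤ Λ ^ A' * ε₀ ^ A' := mul_le_mul_of_nonneg_right hG hε'.le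
        _ = ε₀ ^ A' * Λ ^ A' := mul_comm _ _
        _ ≤ Real.log N ^ A' := h1
    have hw := w_saving (G := 128 * Q₀ * (Cm (2 * b)) ^ 2 * (2 * Λ) ^ (2 * km (2 * b)) * Λ ^ A) hlogN0
      (mul_nonneg hS₂0 hN0'.le) hG'
    calc 128 * W * Q₀ * (Cm (2 * b)) ^ 2 * (2 * Λ) ^ (2 * km (2 * b)) * Λ ^ A
        = (128 * Q₀ * (Cm (2 * b)) ^ 2 * (2 * Λ) ^ (2 * km (2 * b)) * Λ ^ A) *
            (C₀' * S₂ * N / Real.log N ^ A') := by rw [hWdef]; ring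
      _ ≤ S₂ * N := hw
  -- the polylogarithmic savings
  have hz4 : Real.sqrt (Real.sqrt z) = Λ ^ (B₀ / 4) := by
    rw [hzdef, Real.sqrt_eq_rpow, Real.sqrt_eq_rpow, ← Real.rpow_mul hΛ0.le, ← Real.rpow_mul hΛ0.le]; ring_nf
  have hev8 : 3 * (8 + derivConst 2) * (4 * Cm (b + 2)) ^ 2 * (4 * Cm 3) * (2 : ℝ) ^ (2 * km (b + 2) + km 3) *
      Λ ^ (2 * km (b + 2) + km 3) * Λ ^ A ≤ x ^ ε₀ :=
    ((lpow_mul hΛ1 (Real.rpow_nonneg hΛ0.le A) (lpow_mul hΛ1 (by positivity : (0:ℝ) ≤ Λ ^ (2 * km (b + 2) + km 3)) (lpow_mul hΛ1 (by positivity : (0:ℝ) ≤ (2:ℝ) ^ (2 * km (b + 2) + km 3)) (lpow_mul hΛ1 (mul_nonneg (by norm_num) (hCm0 _).le) (lpow_mul hΛ1 (sq_nonneg _) (lpow_mul hΛ1 (by positivity) (const_le_lpow (show (3:ℝ) ≤ Λ by linarith only [h8e5])) (const_le_lpow (hC _ cbK2))) (const_le_lpow (hC _ cbA))) (const_le_lpow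 (hC _ cbB))) (lam_two_pow_le hΛ2 (2 * km (b + 2) + km 3))) (pow_le_rpow_natCast Λ (2 * km (b + 2) + km 3))) (le_refl (Λ ^ A))).trans (hKx' (by simp only [hKbigdef, hA'def, hA₁def, hKtotdef, hKMdef]; push_cast; linarith only [n1, n2, n3, n4, n5, n6, n7, n8, n9, n10, n11, n12, n13, n14, n15, n16, hB₃0, hB₄0, hA.le]))).trans (hxm hηε₀)
  have hev7 : 12 * (8 + derivConst 2) * (4 * Cm b) * (4 * Cm (b + 2)) * (4 * Cm 1) *
      (2 : ℝ) ^ (km b + km (b + 2) + km 1) * Λ ^ (km b + km (b + 2) + km 1) * Λ ^ A ≤ x ^ ε₀ :=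
    ((lpow_mul hΛ1 (Real.rpow_nonneg hΛ0.le A) (lpow_mul hΛ1 (by positivity : (0:ℝ) ≤ Λ ^ (km b + km (b + 2) + km 1)) (lpow_mul hΛ1 (by positivity : (0:ℝ) ≤ (2:ℝ) ^ (km b + km (b + 2) + km 1)) (lpow_mul hΛ1 (mul_nonneg (by norm_num) (hCm0 _).le) (lpow_mul hΛ1 (mul_nonneg (by norm_num) (hCm0 _).le) (lpow_mul hΛ1 (mul_nonneg (by norm_num) (hCm0 _).le) (lpow_mul hΛ1 (by positivity) (const_le_lpow (show (12:ℝ) ≤ Λ by linarith only [h8e5])) (const_le_lpow (hC _ cbK2))) (const_le_lpow (hC _ cbC))) (const_le_lpow (hC _ cbD))) (const_le_lpow (hC _ cbE))) (lam_two_pow_le hΛ2 (km b + km (b + 2) + km 1))) (pow_le_rpow_natCast Λ (km b + km (b + 2) + km 1))) (le_refl (Λ ^ A))).trans (hKx' (by simp only [hKbigdef, hA'def, hA₁def, hKtotdef, hKMdef]; push_cast; linarith only [n1, n2, n3, n4, n5, n6, n7, n8, n9, n10, n11, n12, n13, n14, n15, n16, hB₃0, hB₄0, hA.le]))).trans (hxm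 hηε₀)
  have hsave5 : 64 * Real.sqrt (8 * Cm 1 * Real.sqrt (32 * Cm 2)) * (Cm b) ^ 2 *
      (2 : ℝ) ^ (2 * km b + (km 1 + km 2)) * Q₀ * Λ ^ (2 * km b + (km 1 + km 2)) * Λ ^ A ≤
      Real.sqrt (Real.sqrt z) := by
    rw [hz4]
    exact (lpow_mul hΛ1 (Real.rpow_nonneg hΛ0.le A) (lpow_mul hΛ1 (by positivity : (0:ℝ) ≤ Λ ^ (2 * km b + (km 1 + km 2))) (lpow_mul hΛ1 hQ₀0.le (lpow_mul hΛ1 (by positivity : (0:ℝ) ≤ (2:ℝ) ^ (2 * km b + (km 1 + km 2))) (lpow_mul hΛ1 (sq_nonneg _) (lpow_mul hΛ1 (Real.sqrt_nonneg _) (const_le_lpow (show (64:ℝ) ≤ Λ by linarith only [h8e5])) (const_le_lpow (hC _ cbF))) (const_le_lpow (hC _ cbG))) (lam_two_pow_le hΛ2 (2 * km b + (km 1 + km 2)))) ((le_refl Q₀ : Q₀ ≤ Λ ^ A₁))) (pow_le_rpow_natCast Λ (2 * km b + (km 1 + km 2)))) (le_refl (Λ ^ A))).trans (lpow_le_lpow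 hΛ1 (by simp only [hB₀def, hA₁def, hKtotdef, hKMdef]; push_cast; linarith only [n1, n2, n3, n4, n5, n6, n7, n8, n9, n10, n11, n12, n13, n14, n15, n16, hB₃0, hB₄0, hA.le]))
  have hsave2 : 5 * C₃ * (2 : ℝ) ^ B₃ * Λ ^ B₃ *
      (4 * Cm (b + ⌈B₃⌉₊) * (2 : ℝ) ^ km (b + ⌈B₃⌉₊) * Λ ^ km (b + ⌈B₃⌉₊)) *
      Real.sqrt (6 * (Cm (2 * ⌈B₃⌉₊) + Cm (2 * ⌈B₃⌉₊ + 2)) *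
        Real.sqrt (4 * (6 * (Cm (4 * ⌈B₃⌉₊) + Cm (4 * ⌈B₃⌉₊ + 4))))) *
        ((2 : ℝ) ^ (km (4 * ⌈B₃⌉₊) + km (4 * ⌈B₃⌉₊ + 4) + (km (2 * ⌈B₃⌉₊) + km (2 * ⌈B₃⌉₊ + 2))) *
          Λ ^ (km (4 * ⌈B₃⌉₊) + km (4 * ⌈B₃⌉₊ + 4) + (km (2 * ⌈B₃⌉₊) + km (2 * ⌈B₃⌉₊ + 2)))) *
        Λ ^ A ≤ Real.sqrt (Real.sqrt z) := by
    rw [hz4]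
    exact (lpow_mul hΛ1 (Real.rpow_nonneg hΛ0.le A) (lpow_mul hΛ1 (by positivity) (lpow_mul hΛ1 (Real.sqrt_nonneg _) (lpow_mul hΛ1 (by positivity) (lpow_mul hΛ1 (Real.rpow_nonneg hΛ0.le B₃) (lpow_mul hΛ1 (Real.rpow_nonneg (by norm_num) B₃) (lpow_mul hΛ1 hC₃0 (const_le_lpow (show (5:ℝ) ≤ Λ by linarith only [h8e5])) (const_le_lpow (hC _ cbC3))) (lam_two_rpow_le hΛ2 hB₃0)) (le_refl (Λ ^ B₃))) (lpow_mul hΛ1 (by positivity : (0:ℝ) ≤ Λ ^ (km (b + ⌈B₃⌉₊))) (lpow_mul hΛ1 (by positivity : (0:ℝ) ≤ (2:ℝ) ^ (km (b + ⌈B₃⌉₊))) (lpow_mul hΛ1 (hCm0 _).le (const_le_lpow (show (4:ℝ) ≤ Λ by linarith only [h8e5])) (const_le_lpow (hC _ cbH))) (lam_two_pow_le hΛ2 (km (b + ⌈B₃⌉₊)))) (pow_le_rpow_natCast Λ (km (b + ⌈B₃⌉₊))))) (const_le_lpow (hC _ cbI))) (lpow_mul hΛ1 (by positivity : (0:ℝ)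 ≤ Λ ^ (km (4 * ⌈B₃⌉₊) + km (4 * ⌈B₃⌉₊ + 4) + (km (2 * ⌈B₃⌉₊) + km (2 * ⌈B₃⌉₊ + 2)))) (lam_two_pow_le hΛ2 (km (4 * ⌈B₃⌉₊) + km (4 * ⌈B₃⌉₊ + 4) + (km (2 * ⌈B₃⌉₊) + km (2 * ⌈B₃⌉₊ + 2)))) (pow_le_rpow_natCast Λ (km (4 * ⌈B₃⌉₊) + km (4 * ⌈B₃⌉₊ + 4) + (km (2 * ⌈B₃⌉₊) + km (2 * ⌈B₃⌉₊ + 2)))))) (le_refl (Λ ^ A))).trans (lpow_le_lpow hΛ1 (by simp only [hB₀def, hA₁def, hKtotdef, hKMdef]; push_cast; linarith only [n1, n2, n3, n4, n5, n6, n7, n8, n9, n10, n11, n12, n13, n14, n15, n16, hB₃0, hB₄0, hA.le]))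
  have hz1 : 1280 * C₃ * C₄ * (2 : ℝ) ^ B₃ * (2 * Λ) ^ B₃ * (2 * Λ) ^ B₄ *
      Cm (b + ⌈B₄⌉₊) * Cm (⌈B₃⌉₊ + ⌈B₄⌉₊) *
      (2 * Λ) ^ (km (b + ⌈B₄⌉₊) + km (⌈B₃⌉₊ + ⌈B₄⌉₊)) * Λ * Λ ^ A ≤ z :=
    (lpow_mul hΛ1 (Real.rpow_nonneg hΛ0.le A) (lpow_mul hΛ1 hΛ0.le (lpow_mul hΛ1 (by positivity : (0:ℝ) ≤ (2 * Λ) ^ (km (b + ⌈B₄⌉₊) + km (⌈B₃⌉₊ + ⌈B₄⌉₊))) (lpow_mul hΛ1 (hCm0 _).le (lpow_mul hΛ1 (hCm0 _).le (lpow_mul hΛ1 (Real.rpow_nonneg (by positivity) B₄) (lpow_mul hΛ1 (Real.rpow_nonneg (by positivity) B₃) (lpow_mul hΛ1 (Real.rpow_nonneg (by norm_num) B₃) (lpow_mul hΛ1 hC₄0 (lpow_mul hΛ1 hC₃0 (const_le_lpow (show (1280:ℝ) ≤ Λ by linarith only [h8e5])) (const_le_lpow (hC _ cbC3))) (const_le_lpow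 (hC _ cbC4))) (lam_two_rpow_le hΛ2 hB₃0)) (lam_two_mul_rpow_le hΛ2 hB₃0)) (lam_two_mul_rpow_le hΛ2 hB₄0)) (const_le_lpow (hC _ cbJ))) (const_le_lpow (hC _ cbK))) (lam_two_mul_pow_le hΛ2 (km (b + ⌈B₄⌉₊) + km (⌈B₃⌉₊ + ⌈B₄⌉₊)))) (const_le_lpow (le_refl Λ))) (le_refl (Λ ^ A))).trans (lpow_le_lpow hΛ1 (by simp only [hB₀def, hA₁def, hKtotdef, hKMdef]; push_cast; linarith only [n1, n2, n3, n4, n5, n6, n7, n8, n9, n10, n11, n12, n13, n14, n15, n16, hB₃0, hB₄0, hA.le]))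
  have hQ₀1' : 320 * C₃ * C₄ * (2 * Λ) ^ B₃ * (2 * Λ) ^ B₄ * Cm (b + 1 + ⌈B₃⌉₊ + ⌈B₄⌉₊) *
      Cm (⌈B₃⌉₊ + ⌈B₄⌉₊) * (2 * Λ) ^ (km (b + 1 + ⌈B₃⌉₊ + ⌈B₄⌉₊) + km (⌈B₃⌉₊ + ⌈B₄⌉₊)) *
      Λ ^ A ≤ Q₀ :=
    (lpow_mul hΛ1 (Real.rpow_nonneg hΛ0.le A) (lpow_mul hΛ1 (by positivity : (0:ℝ) ≤ (2 * Λ) ^ (km (b + 1 + ⌈B₃⌉₊ + ⌈B₄⌉₊) + km (⌈B₃⌉₊ + ⌈B₄⌉₊))) (lpow_mul hΛ1 (hCm0 _).le (lpow_mul hΛ1 (hCm0 _).le (lpow_mul hΛ1 (Real.rpow_nonneg (by positivity) B₄) (lpow_mul hΛ1 (Real.rpow_nonneg (by positivity) B₃) (lpow_mul hΛ1 hC₄0 (lpow_mul hΛ1 hC₃0 (const_le_lpow (show (320:ℝ) ≤ Λ by linarith only [h8e5])) (const_le_lpow (hC _ cbC3))) (const_le_lpow (hC _ cbC4))) (lam_two_mul_rpow_le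 hΛ2 hB₃0)) (lam_two_mul_rpow_le hΛ2 hB₄0)) (const_le_lpow (hC _ cbL))) (const_le_lpow (hC _ cbK))) (lam_two_mul_pow_le hΛ2 (km (b + 1 + ⌈B₃⌉₊ + ⌈B₄⌉₊) + km (⌈B₃⌉₊ + ⌈B₄⌉₊)))) (le_refl (Λ ^ A))).trans (lpow_le_lpow hΛ1 (by simp only [hA₁def, hKtotdef, hKMdef]; push_cast; linarith only [n1, n2, n3, n4, n5, n6, n7, n8, n9, n10, n11, n12, n13, n14, n15, n16, hB₃0, hB₄0, hA.le]))
  have hzb : 2048 * (Cm b) ^ 2 * (2 * Λ) ^ (2 * km b + 1) * Λ ^ A ≤ z :=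
    (lpow_mul hΛ1 (Real.rpow_nonneg hΛ0.le A) (lpow_mul hΛ1 (by positivity : (0:ℝ) ≤ (2 * Λ) ^ (2 * km b + 1)) (lpow_mul hΛ1 (sq_nonneg _) (const_le_lpow (show (2048:ℝ) ≤ Λ by linarith only [h8e5])) (const_le_lpow (hC _ cbG))) (lam_two_mul_pow_le hΛ2 (2 * km b + 1))) (le_refl (Λ ^ A))).trans (lpow_le_lpow hΛ1 (by simp only [hB₀def, hA₁def, hKtotdef, hKMdef]; push_cast; linarith only [n1, n2, n3, n4, n5, n6, n7, n8, n9, n10, n11, n12, n13, n14, n15, n16, hB₃0, hB₄0, hA.le]))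
  have hQ₀c : 12288 * Cm 1 * (Cm b) ^ 2 * Cm (2 * b + 1) * (2 * Λ) ^ (km 1 + 2 * km b + km (2 * b + 1)) *
      Λ ^ A ≤ Q₀ :=
    (lpow_mul hΛ1 (Real.rpow_nonneg hΛ0.le A) (lpow_mul hΛ1 (by positivity : (0:ℝ) ≤ (2 * Λ) ^ (km 1 + 2 * km b + km (2 * b + 1))) (lpow_mul hΛ1 (hCm0 _).le (lpow_mul hΛ1 (sq_nonneg _) (lpow_mul hΛ1 (hCm0 _).le (const_le_lpow (show (12288:ℝ) ≤ Λ by linarith only [h8e5])) (const_le_lpow (hC _ cbO))) (const_le_lpow (hC _ cbG))) (const_le_lpow (hC _ cbP))) (lam_two_mul_pow_le hΛ2 (km 1 + 2 * km b + km (2 * b + 1)))) (le_refl (Λ ^ A))).trans (lpow_le_lpow hΛ1 (by simp only [hA₁def, hKtotdef, hKMdef]; push_cast; linarith only [n1, n2, n3, n4, n5, n6, n7, n8, n9, n10, n11, n12, n13, n14, n15, n16, hB₃0, hB₄0, hA.le]))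
  have hRN6 : 1024 * (Cm b) ^ 2 * (2 * Λ) ^ (2 * km b + 1) * Q₀ * Λ ^ A * R ≤ N := by
    have h1 : 1024 * (Cm b) ^ 2 * (2 * Λ) ^ (2 * km b + 1) * Q₀ * Λ ^ A ≤ x ^ ε₀ :=
      ((lpow_mul hΛ1 (Real.rpow_nonneg hΛ0.le A) (lpow_mul hΛ1 hQ₀0.le (lpow_mul hΛ1 (by positivity : (0:ℝ) ≤ (2 * Λ) ^ (2 * km b + 1)) (lpow_mul hΛ1 (sq_nonneg _) (const_le_lpow (show (1024:ℝ) ≤ Λ by linarith only [h8e5])) (const_le_lpow (hC _ cbG))) (lam_two_mul_pow_le hΛ2 (2 * km b + 1))) ((le_refl Q₀ : Q₀ ≤ Λ ^ A₁))) (le_refl (Λ ^ A))).trans (hKx' (by simp only [hKbigdef, hA'def, hA₁def, hKtotdef, hKMdef]; push_cast; linarith only [n1, n2, n3, n4, n5, n6, n7, n8, n9, n10, n11, n12, n13, n14, n15, n16, hB₃0, hB₄0, hA.le]))).trans (hxm hηε₀)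
    calc _ ≤ x ^ ε₀ * R := mul_le_mul_of_nonneg_right h1 hR0.le
      _ ≤ N := by linarith only [r4]
  have hQ₀x : Q₀ ≤ x :=
    ((lpow_le_lpow hΛ1 (by simp only [hKbigdef, hA'def, hA₁def, hKtotdef, hKMdef]; linarith only [n1, n2, n3, n4, n5, n6, n7, n8, n9, n10, n11, n12, n13, n14, n15, n16, hB₃0, hB₄0, hA.le])).trans hKx).trans ((hxm hη1).trans (le_of_eq (Real.rpow_one x)))
  -- E1's `x`-power savings
  have hPT : ∀ c : ℝ, 0 ≤ c → c ≤ Λ →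
      c * (T * (4 * Λ + 1) * (4 * Cm (b + 1) * (2 * Λ) ^ km (b + 1))) * Λ ^ A ≤ x ^ η * x ^ η := by
    intro c hc0 hcΛ
    have h1 : c * ((4 * Λ + 1) * (4 * Cm (b + 1) * (2 * Λ) ^ km (b + 1))) * Λ ^ A ≤
        Λ ^ ((1 : ℝ) + ((2 : ℝ) + (1 + 1 + 2 * (km (b + 1) : ℝ))) + A) :=
      lpow_mul hΛ1 (Real.rpow_nonneg hΛ0.le A) (lpow_mul hΛ1 (by positivity) (const_le_lpow hcΛ)
        (lpow_mul hΛ1 (by positivity) (four_mul_add_one_le hΛ5) (lpow_mul hΛ1 (by positivity : (0:ℝ) ≤ (2 * Λ) ^ (km (b + 1))) (lpow_mul hΛ1 (hCm0 _).le (const_le_lpow (show (4:ℝ) ≤ Λ by linarith only [h8e5])) (const_le_lpow (hC _ cbM))) (lam_two_mul_pow_le hΛ2 (km (b + 1)))))) (le_refl _)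
    have h2 : cT * Λ ^ ((1 : ℝ) + ((2 : ℝ) + (1 + 1 + 2 * (km (b + 1) : ℝ))) + A) ≤ x ^ η :=
      (lpow_mul hΛ1 (Real.rpow_nonneg hΛ0.le _) (const_le_lpow (hC _ cbT)) (le_refl _)).trans (hKx' (by simp only [hKbigdef, hA'def, hA₁def, hKtotdef, hKMdef]; linarith only [n1, n2, n3, n4, n5, n6, n7, n8, n9, n10, n11, n12, n13, n14, n15, n16, hB₃0, hB₄0, hA.le]))
    calc c * (T * (4 * Λ + 1) * (4 * Cm (b + 1) * (2 * Λ) ^ km (b + 1))) * Λ ^ A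
        = T * (c * ((4 * Λ + 1) * (4 * Cm (b + 1) * (2 * Λ) ^ km (b + 1))) * Λ ^ A) := by ring
      _ ≤ (cT * x ^ η) * Λ ^ ((1 : ℝ) + ((2 : ℝ) + (1 + 1 + 2 * (km (b + 1) : ℝ))) + A) :=
          mul_le_mul hTle h1 (by positivity) (by positivity)
      _ = x ^ η * (cT * Λ ^ ((1 : ℝ) + ((2 : ℝ) + (1 + 1 + 2 * (km (b + 1) : ℝ))) + A)) := by ring
      _ ≤ x ^ η * x ^ η := mul_le_mul_of_nonneg_left h2 (hxp _).le
  have hx2η : x ^ η * x ^ η = x ^ (2 * η) := by rw [← Real.rpow_add hx0]; ring_nf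
  have h3a : 320 * (T * (4 * Λ + 1) * (4 * Cm (b + 1) * (2 * Λ) ^ km (b + 1))) * Λ ^ A ≤ P₀ := by
    calc 320 * (T * (4 * Λ + 1) * (4 * Cm (b + 1) * (2 * Λ) ^ km (b + 1))) * Λ ^ A
        ≤ x ^ η * x ^ η := hPT 320 (by norm_num) (by linarith only [h8e5])
      _ = x ^ (2 * η) := hx2η
      _ ≤ P₀ := hxm (by rw [hηdef]; linarith only [hε₀])
  have h3b : 128 * (T * (4 * Λ + 1) * (4 * Cm (b + 1) * (2 * Λ) ^ km (b + 1))) * Λ ^ A *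
      (Q * N * R) ≤ x * P₀ := by
    calc 128 * (T * (4 * Λ + 1) * (4 * Cm (b + 1) * (2 * Λ) ^ km (b + 1))) * Λ ^ A * (Q * N * R)
        ≤ (x ^ η * x ^ η) * x ^ (1 - 4 * ε₀) :=
          mul_le_mul (hPT 128 (by norm_num) (by linarith only [h8e5])) r5 (by positivity) (by positivity)
      _ = x ^ (2 * η + (1 - 4 * ε₀)) := by rw [hx2η, ← Real.rpow_add hx0]
      _ ≤ x ^ ((1 : ℝ) + ε₀ / 3) := hxm (by rw [hηdef]; linarith only [hε₀])
      _ = x * P₀ := by rw [Real.rpow_add hx0, Real.rpow_one]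
  have h3c : 160 * (T * (4 * Λ + 1) * (4 * Cm (b + 1) * (2 * Λ) ^ km (b + 1))) * Λ ^ A * R ≤ N := by
    calc 160 * (T * (4 * Λ + 1) * (4 * Cm (b + 1) * (2 * Λ) ^ km (b + 1))) * Λ ^ A * R
        ≤ (x ^ η * x ^ η) * R := mul_le_mul_of_nonneg_right (hPT 160 (by norm_num) (by linarith only [h8e5])) hR0.le
      _ = x ^ (2 * η) * R := by rw [hx2η]
      _ ≤ x ^ ε₀ * R := mul_le_mul_of_nonneg_right (hxm (by rw [hηdef]; linarith only [hε₀])) hR0.le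
      _ ≤ N := by linarith only [r4]
  have h3d : 64 * (T * (4 * Λ + 1) * (4 * Cm (b + 1) * (2 * Λ) ^ km (b + 1))) * Λ ^ A * (Q * R ^ 2) ≤ x := by
    calc 64 * (T * (4 * Λ + 1) * (4 * Cm (b + 1) * (2 * Λ) ^ km (b + 1))) * Λ ^ A * (Q * R ^ 2)
        ≤ (x ^ η * x ^ η) * x ^ (1 - 5 * ε₀) :=
          mul_le_mul (hPT 64 (by norm_num) (by linarith only [h8e5])) f2 (by positivity) (by positivity)
      _ = x ^ (2 * η + (1 - 5 * ε₀)) := by rw [hx2η, ← Real.rpow_add hx0]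
      _ ≤ x ^ (1 : ℝ) := hxm (by rw [hηdef]; linarith only [hε₀])
      _ = x := Real.rpow_one x
  -- H, θ, the tail and the phase
  have hHle : (Hn : ℝ) ≤ 16 * x ^ ε₁ * Q ^ 2 * R / M := Nat.floor_le (by positivity)
  have hHnR : (Hn : ℝ) ≤ R := floorH_le_R hx0 hM0 hR0 f3 (h16' (by linarith only [hε₀]))
  have hHx : (Hn : ℝ) ≤ 2 * x := hHnR.trans hRx
  have hHK : (Hn : ℝ) * (N / R) ≤ N := by
    calc (Hn : ℝ) * (N / R) ≤ R * (N / R) := mul_le_mul_of_nonneg_right hHnR (by positivity)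
      _ = N := by field_simp
  obtain ⟨hθx, hHθ⟩ := theta_bounds (ε₁ := ε₁) hx1 hM1 hQ0 hQx hR0 hQR
  have htail : 3072 * derivConst j * (Cm b) ^ 2 * (2 * Λ) ^ (2 * km b) * Q₀ * Λ ^ A * R *
      ((Hn : ℝ) + 1) * θ ^ j ≤ 1 := by
    have hP : 3072 * derivConst j * (Cm b) ^ 2 * (2 * Λ) ^ (2 * km b) * Q₀ * Λ ^ A ≤ x ^ η :=
      (lpow_mul hΛ1 (Real.rpow_nonneg hΛ0.le A) (lpow_mul hΛ1 hQ₀0.le (lpow_mul hΛ1 (by positivity : (0:ℝ) ≤ (2 * Λ) ^ (2 * km b)) (lpow_mul hΛ1 (sq_nonneg _) (lpow_mul hΛ1 hKj (const_le_lpow (show (3072:ℝ) ≤ Λ by linarith only [h8e5])) (const_le_lpow (hC _ cbQ))) (const_le_lpow (hC _ cbG))) (lam_two_mul_pow_le hΛ2 (2 * km b))) ((le_refl Q₀ : Q₀ ≤ Λ ^ A₁))) (le_refl (Λ ^ A))).trans (hKx' (by simp only [hKbigdef, hA'def, hA₁def, hKtotdef, hKMdef]; push_cast; linarith only [n1, n2,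 n3, n4, n5, n6, n7, n8, n9, n10, n11, n12, n13, n14, n15, n16, hB₃0, hB₄0, hA.le]))
    exact tail_small hx12 hP hη1 hR0.le hRx (by positivity) hθ0 hθx hHθ hj2 hj5
  have hphase : 786432 * π * |(a : ℝ)| * (Cm b) ^ 2 * (2 * Λ) ^ (2 * km b) * Q₀ ^ 2 * Λ ^ A *
      x ^ (2 * ε₁) * (Q ^ 2 * R ^ 2 * N) ≤ x ^ 2 := by
    have hP : 786432 * π * |(a : ℝ)| * (Cm b) ^ 2 * (2 * Λ) ^ (2 * km b) * Q₀ ^ 2 * Λ ^ A ≤ x ^ η :=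
      (lpow_mul hΛ1 (Real.rpow_nonneg hΛ0.le A) (lpow_mul hΛ1 (by positivity) (lpow_mul hΛ1 (by positivity : (0:ℝ) ≤ (2 * Λ) ^ (2 * km b)) (lpow_mul hΛ1 (sq_nonneg _) (lpow_mul hΛ1 (abs_nonneg _) (lpow_mul hΛ1 Real.pi_pos.le (const_le_lpow (show (786432:ℝ) ≤ Λ by linarith only [h8e5])) (const_le_lpow hπΛ)) (const_le_lpow (hC _ cbR))) (const_le_lpow (hC _ cbG))) (lam_two_mul_pow_le hΛ2 (2 * km b))) (hQ₀sq)) (le_refl (Λ ^ A))).trans (hKx' (by simp only [hKbigdef, hA'def, hA₁def, hKtotdef, hKMdef]; push_cast; linarith only [n1, n2, n3, n4, n5, n6, n7, n8, n9, n10, n11, n12, n13, n14, n15, n16, hB₃0, hB₄0, hA.le]))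
    calc _ ≤ x ^ η * x ^ (2 * ε₁) * x ^ (2 - 4 * ε₀) :=
          mul_le_mul (mul_le_mul_of_nonneg_right hP (hxp _).le) f7 (by positivity) (by positivity)
      _ = x ^ (η + 2 * ε₁ + (2 - 4 * ε₀)) := by rw [← Real.rpow_add hx0, ← Real.rpow_add hx0]
      _ ≤ x ^ ((2 : ℕ) : ℝ) := hxm (by rw [hηdef, hε₁def]; push_cast; linarith only [hε₀])
      _ = x ^ 2 := Real.rpow_natCast x 2
  -- E4 data
  obtain ⟨hD, hDτ⟩ := divisor_inputs hN0' hQ0 hCδ0 hη hδ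
  have hA5' : ∑ n ∈ dyadic N, β n ^ 4 ≤ C₅' * N ^ (ε₀ - 1) * l2Sq N β ^ 2 := a5_conv hN0' hA5
  -- the (9.21)-type saving `hbig`
  have hlog4Q0 : 0 ≤ Real.log (4 * Q) := Real.log_nonneg (by linarith only [hQ])
  have hlog4Q : Real.log (4 * Q) ^ km (2 * b) ≤ Λ ^ (2 * (km (2 * b) : ℝ)) :=
    (pow_le_pow_left₀ hlog4Q0 (log_four_mul_le hx16 hQ0 hQx) _).trans (lam_two_mul_pow_le hΛ2 _)
  have h4Λ1 : 2 * (2 * Λ) + 1 ≤ Λ ^ (2 : ℝ) := by have := four_mul_add_one_le hΛ5; linarith only [this]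
  have h23Λ : 2 + 3 * Λ ≤ Λ ^ (2 : ℝ) := two_add_three_mul_le (by linarith only [hΛ5])
  have hPP : 4 * Q₀ * τa * (2 * (2 * Λ) + 1) * (3 * Q₀) * (2 * Real.sqrt (32 * derivConst 2)) *
      (2 + 3 * Λ) * (4 * Cm (2 * b) * Real.log (4 * Q) ^ km (2 * b)) ≤ x ^ η :=
    (lpow_mul hΛ1 (mul_nonneg (mul_nonneg (by norm_num) (hCm0 _).le) (pow_nonneg hlog4Q0 _)) (lpow_mul hΛ1 (by positivity) (lpow_mul hΛ1 (by positivity) (lpow_mul hΛ1 (by positivity) (lpow_mul hΛ1 (by positivity) (lpow_mul hΛ1 hτa0 (lpow_mul hΛ1 hQ₀0.le (const_le_lpow (show (4:ℝ) ≤ Λ by linarith only [h8e5])) ((le_refl Q₀ : Q₀ ≤ Λ ^ A₁))) (const_le_lpow (hC _ cbS))) (h4Λ1)) (lpow_mul hΛ1 hQ₀0.le (const_le_lpow (show (3:ℝ) ≤ Λ by linarith only [h8e5])) ((le_refl Q₀ : Q₀ ≤ Λ ^ A₁)))) (const_le_lpow (hC _ cbU))) (h23Λ)) (lpow_mul hΛ1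 (pow_nonneg hlog4Q0 _) (lpow_mul hΛ1 (hCm0 _).le (const_le_lpow (show (4:ℝ) ≤ Λ by linarith only [h8e5])) (const_le_lpow (hC _ cbV))) (hlog4Q))).trans (hKx' (by simp only [hKbigdef, hA'def, hA₁def, hKtotdef, hKMdef]; linarith only [n1, n2, n3, n4, n5, n6, n7, n8, n9, n10, n11, n12, n13, n14, n15, n16, hB₃0, hB₄0, hA.le]))
  have hDτb : Real.sqrt (Dτ : ℝ) ≤ cD1 * x ^ η := sqrt_Dtau_le hx1 hN0'.le hNx hQ0.le hQx hCδ0 hη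
  have hPηb : Real.sqrt (C₇ * (4 * N * Q * (2 * Q) * (N / R) * (Hn : ℝ) * (2 * N)) ^ η) ≤ cD2 * x ^ (3 * η) :=
    sqrt_Peta_le hx1 hN0'.le hNx hQ0.le hQx hR0 hNR2 (Nat.cast_nonneg _) hHx hC₇0 hη
  have hlastb : Real.sqrt 8 + 2 * Real.sqrt (48 * Real.sqrt (D * C₅') * N ^ (ε₀ / 2)) ≤
      cD3 * x ^ (η / 4 + ε₀ / 4) := last_factor_le hx1 hN0' hNx hCδ0 hC₅'0 hη hε₀
  have hbig : (4 * Q₀ * (a.natAbs.divisors.card : ℝ) * (2 * (2 * Λ) + 1) * (3 * Q₀) *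
        (2 * Real.sqrt (32 * derivConst 2)) * (2 + 3 * Λ) * (4 * Cm (2 * b) * Real.log (4 * Q) ^ km (2 * b)) *
        Real.sqrt (Dτ : ℝ) * Real.sqrt (C₇ * (4 * N * Q * (2 * Q) * (N / R) * (Hn : ℝ) * (2 * N)) ^ η) *
        (4 * x ^ (ε₁ / 2)) *
        (Real.sqrt 8 + 2 * Real.sqrt (48 * Real.sqrt (D * C₅') * N ^ (ε₀ / 2)))) * Λ ^ A ≤ x ^ ε₀ := by
    have hcD : cD1 * cD2 * 4 * cD3 * Λ ^ A ≤ x ^ η := (lpow_mul hΛ1 (Real.rpow_nonneg hΛ0.le A) (lpow_mul hΛ1 hcD30 (lpow_mul hΛ1 (by norm_num : (0:ℝ) ≤ (4:ℝ)) (lpow_mul hΛ1 hcD20 (const_le_lpow (hC _ cbX)) (const_le_lpow (hC _ cbY))) (const_le_lpow (show (4:ℝ) ≤ Λ by linarith only [h8e5]))) (const_le_lpow (hC _ cbZ))) (le_refl (Λ ^ A))).trans (hKx' (by simp only [hKbigdef, hA'def, hA₁def, hKtotdef, hKMdef]; linarith only [n1, n2, n3, n4, n5, n6, n7, n8, n9,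 n10, n11, n12, n13, n14, n15, n16, hB₃0, hB₄0, hA.le]))
    have hτa' : (a.natAbs.divisors.card : ℝ) = τa := rfl
    rw [hτa']
    have hPP0 : 0 ≤ 4 * Q₀ * τa * (2 * (2 * Λ) + 1) * (3 * Q₀) * (2 * Real.sqrt (32 * derivConst 2)) *
        (2 + 3 * Λ) * (4 * Cm (2 * b) * Real.log (4 * Q) ^ km (2 * b)) := by
      have : 0 ≤ Real.log (4 * Q) := Real.log_nonneg (by linarith only [hQ])
      positivity
    calc (4 * Q₀ * τa * (2 * (2 * Λ) + 1) * (3 * Q₀) *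
          (2 * Real.sqrt (32 * derivConst 2)) * (2 + 3 * Λ) * (4 * Cm (2 * b) * Real.log (4 * Q) ^ km (2 * b)) *
          Real.sqrt (Dτ : ℝ) * Real.sqrt (C₇ * (4 * N * Q * (2 * Q) * (N / R) * (Hn : ℝ) * (2 * N)) ^ η) *
          (4 * x ^ (ε₁ / 2)) *
          (Real.sqrt 8 + 2 * Real.sqrt (48 * Real.sqrt (D * C₅') * N ^ (ε₀ / 2)))) * Λ ^ A
        ≤ (x ^ η * (cD1 * x ^ η) * (cD2 * x ^ (3 * η)) * (4 * x ^ (ε₁ / 2)) * (cD3 * x ^ (η / 4 + ε₀ / 4))) *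
            Λ ^ A := by
          refine mul_le_mul_of_nonneg_right ?_ (Real.rpow_nonneg hΛ0.le A)
          have s1 := mul_le_mul hPP hDτb (Real.sqrt_nonneg _) (hxp η).le
          have s2 := mul_le_mul s1 hPηb (Real.sqrt_nonneg _) (by positivity)
          have s3 := mul_le_mul_of_nonneg_right s2 (by positivity : (0:ℝ) ≤ 4 * x ^ (ε₁ / 2))
          exact mul_le_mul s3 hlastb (by positivity) (by positivity)
      _ = (cD1 * cD2 * 4 * cD3 * Λ ^ A) *
            (x ^ η * x ^ η * x ^ (3 * η) * x ^ (ε₁ / 2) * x ^ (η / 4 + ε₀ / 4)) := by ring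
      _ ≤ x ^ η * (x ^ η * x ^ η * x ^ (3 * η) * x ^ (ε₁ / 2) * x ^ (η / 4 + ε₀ / 4)) :=
          mul_le_mul_of_nonneg_right hcD (by positivity)
      _ = x ^ (η + (η + η + 3 * η + ε₁ / 2 + (η / 4 + ε₀ / 4))) := by
          simp only [← Real.rpow_add hx0]
      _ ≤ x ^ ε₀ := hxm (by rw [hηdef, hε₁def]; linarith only [hε₀])
  -- assemble
  have hcore := theorem2_core ha (hx := hx32) (hMN := hMN) (hN := hN0) (hNx := hNx) (hMx := hMx) (hM1 := hM1)
    (haM := haM) (hQ := hQ) (hQx := hQx) (hR := hR) (hRx := hRx) (hRN := hRN) (hQ₀ := hQ₀1) (hQ₀x := hQ₀x)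
    (hz := hz1') (hγ := hγb) (hsift := hsift) (km := km) (hm := hCm') (hCm := hCm0)
    (hN2 := r6) (hQNR := r5.trans ((hxm (p := 1 - 4 * ε₀) (q := 1 - ε₀) (by linarith only [hε₀])).trans
      (by linarith only [hxp (1 - ε₀)])))
    (hev8 := hev8) (hev7 := hev7) (hS2u := hS2u) (hsave5 := hsave5)
    (hC₃ := hC₃0) (hB₃ := hB₃0) (hC₄ := hC₄0) (hB₄ := hB₄0) (hP₀ := hP₀) (hT := hT0)
    (hω₀0 := (by positivity : (0:ℝ) ≤ 4 * Λ)) (hlg0 := (by positivity : (0:ℝ) ≤ 2 * Λ)) (hlgΛ := le_refl _)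
    (hω₀Λ := le_refl _)
    (hL3 := hL3) (hL3' := hL3') (hX₀ := hX₀) (hX₀' := hX₀') (hlev2 := hlev2) (hlgn := hlgn) (hlev := hlev)
    (hlev' := hlev') (hTv := hTv) (hlgm := hlgm) (hω := hω) (hsave2 := hsave2) (hz1 := hz1) (hQ₀1 := hQ₀1')
    (h3a := h3a) (h3b := h3b) (h3c := h3c) (h3d := h3d)
    (hW := hW0) (hBDH := hBDH) (hWa := hWa) (hzb := hzb) (hRN6 := hRN6) (hQ₀c := hQ₀c)
    (hj := hj2) (hθ0 := hθ0) (hθ := le_refl θ) (hHle := hHle) (htail := htail) (hphase := hphase)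
    (h7 := h7') (hC₇ := hC₇0) (hD := hD) (hD0 := hD0) (hC₅ := hC₅'0) (hDτ := hDτ) (hA5 := hA5')
    (hPη := rfl) (hHK := hHK) (hr1 := f4) (hr2 := f5) (hr3 := f6) (hbig := hbig)
  calc dispG a M N Q R β γ ≤ 8 * (l2Sq N β * x * R⁻¹ / Λ ^ A) := hcore
    _ = 8 * l2Sq N β * x * R⁻¹ / Λ ^ A := by ring

end BFI

end Literature.NumberTheory.Sieve
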